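import Mathlib
import Summits.NavierStokesRegularity.NavierStokesRegularity.Theses.EulerZoomLiouville
import Summits.NavierStokesRegularity.NavierStokesRegularity.Theorems.EulerZoomLiouvillePowerGaugeEulerLiouvilleBirthDefsFive
import Summits.NavierStokesRegularity.NavierStokesRegularity.Theorems.EulerZoomLiouvillePowerGaugeEulerLiouvilleHelicityTubeMember
import Summits.NavierStokesRegularity.NavierStokesRegularity.Theorems.EulerZoomLiouvillePowerGaugeEulerLiouvilleHelicityTubeTubeTransportFree
import Summits.NavierStokesRegularity.NavierStokesRegularity.Theorems.EulerZoomLiouvillePowerGaugeEulerLiouvilleCasimirFloorTransport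
import Summits.NavierStokesRegularity.NavierStokesRegularity.Theorems.EulerZoomLiouvillePowerGaugeEulerLiouvilleSwirlfreeLedgerDecay
import Summits.NavierStokesRegularity.NavierStokesRegularity.Theorems.EulerZoomLiouvillePowerGaugeEulerLiouvilleBackwardTools
import Literature.Analysis.FluidPDE.SelfSimilarEulerProfile
import Literature.Analysis.FluidPDE.SelfSimilarCollapseAnsatz
import Literature.Analysis.FluidPDE.AxisymHouLiVariables
import Literature.Analysis.FluidPDE.TaoEnstrophyLocalisation
import Literature.Analysis.FluidPDE.WeakSolution
import Literature.Analysis.FunctionSpaces.SobolevDomain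
import Literature.Analysis.FunctionSpaces.SobolevBallScaling
import Literature.Analysis.FunctionSpaces.SobolevTraceDensityProofs
import Literature.Analysis.FunctionSpaces.SobolevDomainProofs
import Literature.Analysis.FluidPDE.AxisymmetricEuler
import Literature.Analysis.FluidPDE.ClassicalSolution
import Literature.Analysis.FluidPDE.ClassicalSolutionCalculus
import Literature.Analysis.FluidPDE.VectorCalculus
import Summits.NavierStokesRegularity.NavierStokesRegularity.Theorems.EulerZoomLiouvillePowerGaugeEulerLiouvilleChiralAnchorTransport
import HarnessLib.Audit
/-!
v119 TARGET SYNC (g12, 2026-08-29T15:3xZ; asked by LEAD 19832 g17, nsreg STATUS 15:29:40Z — the LAST registration of lineage ns-typeII-p2, D-0168 E1):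
birth v119 (commit a0222d65cbc8, sha16 af7a41b1fec37376; 52 stubs / 49 filled / 3 open) adds spiral parity for the four regularity-free senses —
binder #41 `¬ IsPastSpiralTameWeak ρ u` (`Theorems/…BirthDefsFive.lean` p727264; filled stub `stub_pastSpiralTameWeak := Spiral.pastSpiralTameWeak_trivial …`,
ns-ezl-w3 g9 p728352) inserted after `¬ IsPastSpiralSubExtremal ρ u` (40 → 41 binders).  This file: `import …BirthDefsFive` (was `…Four`), target re-copied
VERBATIM from birth v119, compositions take the new hypothesis (`_ntw`, dropped — K6 keeps its text); K1–K6 texts UNCHANGED (farm rc 0, sorries 1 = K6).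
v118 TARGET SYNC (g12, 2026-08-29T15:1xZ; asked by LEAD 19832 g17, nsreg STATUS 15:01:44Z): the LEAD's birth v118 (commit a7acbce54963, sha16 3de4b498580094dc;
51 stubs / 48 filled / 3 open) KILLED the sub-extremal SPIRAL stratum of line `relative_equilibria` BY NAME — binder #40 `¬ IsPastSpiralSubExtremal ρ u`
(`Theorems/…BirthDefsFour.lean` p725060; filled stub `stub_pastSpiralSubExtremal := Spiral.pastSpiralSubExtremal_trivial …`, p727289) inserted after
`¬ IsPastSelfSimilarSubExtremal ρ u` in `stub_nonSelfSimilarRest` (39 → 40 binders).  This file: `import …BirthDefsFour` (was `…Three`), the target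
`Sig.stub_nonSelfSimilarRest` re-copied VERBATIM from birth v118, the compositions' binder lists take the new hypothesis (`_nsp`, dropped — K6 is the
line's own complement and keeps its text); K1–K6 statement texts UNCHANGED, every proof re-checked (farm rc 0, sorries 1 = K6).
v117 IMPORT SWITCH (g12, 2026-08-29T14:1xZ; asked by LEAD 19832 g16 FINAL): the LEAD's birth v117 (commit 5e45166c439e, sha16 04b64fff177970e8) moved the 52
binder predicates into the reviewed, importable `Theorems/…BirthDefs{,Two,Three}.lean` (namespace `…Theorems.PowerGaugeEulerLiouville.Birth`).  This file now
IMPORTS `…BirthDefsThree` and OPENS that namespace; the 45 local verbatim copies (`E3`, `InClass`, …, `IsSlabBoundedSwirlFree`) are DELETED, so every predicate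
name below denotes the LEAD's own declaration; the target `Sig.stub_nonSelfSimilarRest` is re-copied VERBATIM from birth v117 (39 binders, text = v116's);
K1–K6 statement texts UNCHANGED, every proof re-checked unchanged (farm rc 0, sorries 1 = K6).  Size 198 801 B → ≈136 kB (cap headroom restored).
v116 COPY SYNC (g11, 2026-08-29T13:3xZ): the LEAD's birth v116 (sha16 2d4063891c2dccd4) added THREE any-axis binders `¬ (∃ R : E3 ≃ₗᵢ[ℝ] E3, …)` (slab-bounded
swirl-free / axisym slow drifting / DSS classical tame, conjugated by `R`) to `stub_nonSelfSimilarRest` (36 → 39 binders); this file's copy of the target is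
VERBATIM v116 and the compositions ignore the three new binders (`_nS' _n13' _n29'`); all statement texts of this line's own stubs UNCHANGED.
# Line `chiral_anchor` — «THE VOLUME PRICE OF A CHIRAL VORTEX TUBE, WITHOUT A DRIFT ENVELOPE» (ideator ns-idea-11 g10/g11, line g10-2; REV8)
# crux `EulerZoomLiouville.PowerGaugeEulerLiouville` = stmt-NavierStokesRegularity-19832; target (BY NAME, VERBATIM v115 text): the LEAD skeleton's
# open stub `Sig.stub_nonSelfSimilarRest` (`Lines/birth.lean` v115 97807a79e132, sha256[:16] `282f55b374550410`, ns-typeII-p2 g16; REV8 = v115 copy sync: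
# one more binder `¬ IsSlabBoundedSwirlFree u p` — line `casimir_haul`'s stratum, killed in the skeleton — and the copied def `IsSlabBoundedSwirlFree`).

NO SUMMIT AND NO CRUX IS PROVED HERE.  ★ REV7 = v114 COPY SYNC — THE LINE IS ABSORBED: the LEAD's v114 put the binder `¬ IsChiralTubePast u p` (this
line's stratum, text below = the LEAD's, `IsTubeDatum`/`tubeHelicity` unfolded) into `stub_nonSelfSimilarRest` and filled its new stub `stub_chiralTubePast`
IN THE SKELETON by name from the Theorems ports of K1–K4 (ns-ezl-w3 g8 p711242/p716554, ns-ezl-w1 g9 p713294/p713697 porting this file's proofs).  Hence the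
declared open complement K6 `stub_anchorFace` (the target's 34 old negated binders + `¬ IsChiralTubePast u p` ⇒ trivial) is now LITERALLY the LEAD's open
stub up to the position of one binder, and `nonSelfSimilarRest_of_face` is a re-ordering; nothing of this line remains open except the wall itself.  KEPT AS
THE RECORD (all sorry-free): K1 `stub_anchorFlow` := tree theorem `ChiralAnchor.stub_anchorFlow_filler`; K2 `stub_shellFloor`, K3 `stub_farVolume`, K4
`stub_anchorRace` PROVED in-file; ★ `not_isChiralTubePast_of_inClass` (the chiral-tube stratum is EMPTY in Seregin's class for EVERY `ρ > 0`),
`not_isHelicalTubePast_of_inClass` (every `κ < 1`), ★ `no_helical_compactVorticity_slice` (no slab-bounded classical past has a slice with compactly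
supported vorticity of non-zero total helicity).  ONE sorried stub: K6 (the wall).
VERBATIM-COPY DECLARATION: the predicates `InClass … IsClassicalConcentrating`, `IsChiralTubePast` and the target `Sig.stub_nonSelfSimilarRest` below are
COPIED VERBATIM (def bodies; LEAD docstrings elided for the 200 kB cap) from `Lines/birth.lean` v115 so that this file NEVER imports `Lines.birth` and the
target is concluded BY NAME with the LEAD's exact text; a LEAD re-word of any copied predicate obliges a re-copy (successor duty, HOME HANDOFF).
Stratum, mechanism (FLOOR · FAR VOLUME · RACE), why this line / why novel / bears_on / cheapest falsifier: the line card `Lines/chiral_anchor.md`.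
-/

noncomputable section

open MeasureTheory Set Filter Topology Metric
open scoped ENNReal NNReal ContDiff

set_option linter.dupNamespace false
set_option maxSynthPendingDepth 3

namespace Summit.NavierStokesRegularity.NavierStokesRegularity.Cruxes.PowerGaugeEulerLiouville.ChiralAnchor

open Summit.NavierStokesRegularity.NavierStokesRegularity.Theorems.PowerGaugeEulerLiouville.Birth

/-! ## The LEAD skeleton's binder predicates are IMPORTED since v117 (`Theorems/…BirthDefs{,Two,Three,Four,Five}.lean`, namespace
`…Theorems.PowerGaugeEulerLiouville.Birth`, opened above — the local verbatim copies of v110–v116 are gone); the target below is the LEAD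
skeleton's open stub `Sig.stub_nonSelfSimilarRest`, VERBATIM birth.lean v119 (it lives in the non-importable `Lines/birth.lean`, hence copied). -/

/-- Signature of `stub_nonSelfSimilarRest` (OPEN; reshaped v17–v74, binder history in the CENSUS files): in the window, a member with energy present at `t = −∞` lying in
NONE of the landed past / clock / DSS / weak strata named by the binders below (velocity-only binders since v54/v58) is trivial. -/
def Sig.stub_nonSelfSimilarRest : Prop :=
  ∀ ρ : ℝ, 0 < ρ → ρ ≤ 1 / 2 →
    ∀ (u : ℝ → E3 → E3) (p : ℝ → E3 → ℝ) (H : ℝ → E3 → E3 →L[ℝ] E3) (c : ℝ≥0),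
      InClass ρ u p H c → ¬ QuiescentPast u → ¬ IsPastSteady ρ u → ¬ IsWeakTamePast u H → ¬ PastFrozenDirection H →
        ¬ IsSelfSimilarVelocity u → ¬ IsCollapseClockC2 u →
        ¬ IsPastSelfSimilarClassical ρ u → ¬ IsPastSelfSimilarSubExtremal ρ u → ¬ IsPastSpiralSubExtremal ρ u → ¬ IsPastSpiralTameWeak ρ u → ¬ IsShapeFastClock ρ u →
        ¬ IsSwirlFreeDrifting u p → ¬ IsSwirlFreeSlowDrifting ρ u p → ¬ IsMirrorOutgoing ρ u p → ¬ IsSlabBoundedSwirlFree u p → ¬ (∃ R : E3 ≃ₗᵢ[ℝ] E3, IsSlabBoundedSwirlFree (fun τ x => R (u τ (R.symm x))) (fun τ x => p τ (R.symm x))) → ¬ IsAxisymSlowDrifting ρ u p → ¬ (∃ R : E3 ≃ₗᵢ[ℝ] E3, IsAxisymSlowDrifting ρ (fun τ x => R (u τ (R.symm x))) (fun τ x => p τ (R.symm x))) → ¬ IsTameBreather ρ u p → ¬ IsDiscreteBreather ρ u → ¬ IsDiscreteClock ρ u →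
        ¬ IsOffRateSelfSimilar ρ u →
        ¬ IsBernoulliClockedCore u p → ¬ IsHelicalTubePast ρ u p → ¬ IsChiralTubePast u p → ¬ IsStretchingBudgeted ρ u p → ¬ IsAnchoredBudgeted ρ u p →
        ¬ IsConfinedVortex ρ u p → ¬ IsFadingTamePast u p →
        ¬ IsTameClassicalShapePreserving ρ u p → ¬ HasOneSidedPressurePast ρ u p → ¬ IsExtinctConservative ρ u p →
        ¬ (ρ = 1 / 2 ∧ IsDSSPowerSpread ρ u) → ¬ IsDSSCompactVorticity ρ u p →
        ¬ IsDSSClassicalTame ρ u p → ¬ (∃ R : E3 ≃ₗᵢ[ℝ] E3, IsDSSClassicalTame ρ (fun τ x => R (u τ (R.symm x))) (fun τ x => p τ (R.symm x))) → ¬ IsDSSClassicalEnergy ρ u p → ¬ IsClassicalVorticityTame u p → ¬ IsSymmetricWeak u H →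
        ¬ IsWeakFluxTame u p H → ¬ IsClassicalConcentrating ρ u p →
        Function.uncurry u =ᵐ[volume.restrict (Set.Iio (0 : ℝ) ×ˢ (Set.univ : Set E3))] 0

/-- Shorthand for the common conclusion «`u = 0` a.e. on `(−∞,0) × ℝ³`». -/
@[reducible] def VanishesAE (u : ℝ → E3 → E3) : Prop :=
  Function.uncurry u =ᵐ[volume.restrict (Set.Iio (0 : ℝ) ×ˢ (Set.univ : Set E3))] 0


/-! ## The new stratum and the line's interface -/

/-- A TUBE DATUM `(χ, R)` for the slice `v` — the cut-off clause of the LEAD's face `IsHelicalTubePast`, binder for binder: `χ ∈ C^∞`,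
`|χ| ≤ 1`, `χ = 0` off `B(0,R)`, and `χ` is constant along the vortex lines of `v` (`Dχ[curl v] ≡ 0`). -/
@[reducible] def IsTubeDatum (v : E3 → E3) (χ : E3 → ℝ) (R : ℝ) : Prop :=
  ContDiff ℝ ∞ χ ∧ (∀ x : E3, |χ x| ≤ 1) ∧ (∀ x : E3, R ≤ ‖x‖ → χ x = 0) ∧
    ∀ x : E3, fderiv ℝ χ x (Literature.Analysis.FluidPDE.curl v x) = 0

/-- The WEIGHTED (Moffatt) HELICITY of the slice `v` against the weight `χ`: `∫ χ ⟪v, curl v⟫`. -/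
def tubeHelicity (v : E3 → E3) (χ : E3 → ℝ) : ℝ :=
  ∫ x, χ x * inner ℝ (v x) (Literature.Analysis.FluidPDE.curl v x)

/-- An ANCHOR FLOW for `u` on the time-slab `[t₁,t₀]` carrying the label set `T` (kinematics only): a jointly continuous family `X r : ℝ³ → ℝ³`
with `X t₀ = id` on `T`; every trajectory `σ ↦ X σ y` (`y ∈ T`) solves `ẋ = u(σ,x)` on `[t₁,t₀]`; each `X r` is injective on `T`; images of
measurable subsets of `T` are measurable WITH THE SAME VOLUME and satisfy the `ℝ≥0∞` change-of-variables identity (incompressibility, the only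
conservation law this line uses besides Moffatt's); and all images of `T` stay in one ball. -/
def IsAnchorFlow (u : ℝ → E3 → E3) (t₁ t₀ : ℝ) (T : Set E3) (X : ℝ → E3 → E3) : Prop :=
  Continuous (fun q : ℝ × E3 => X q.1 q.2) ∧
    (∀ y ∈ T, X t₀ y = y) ∧
    (∀ r ∈ Set.Icc t₁ t₀, ∀ y ∈ T, HasDerivWithinAt (fun σ : ℝ => X σ y) (u r (X r y)) (Set.Icc t₁ t₀) r) ∧
    (∀ r ∈ Set.Icc t₁ t₀, Set.InjOn (X r) T) ∧
    (∀ r ∈ Set.Icc t₁ t₀, ∀ S ⊆ T, MeasurableSet S → MeasurableSet (X r '' S) ∧ volume (X r '' S) = volume S) ∧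
    (∀ r ∈ Set.Icc t₁ t₀, ∀ S ⊆ T, MeasurableSet S → ∀ g : E3 → ℝ≥0∞, Measurable g →
      ∫⁻ x in X r '' S, g x = ∫⁻ y in S, g (X r y)) ∧
    (∃ R' : ℝ, ∀ r ∈ Set.Icc t₁ t₀, X r '' T ⊆ Metric.ball (0 : E3) R')

/-- TUBE TRANSPORT along an anchor flow (Moffatt / Cauchy's formula): a family of transported cut-offs `χ' r` with `χ' t₀ = χ`, each a tube datum
for the slice `u r`, equal to `χ` along trajectories from `T`, vanishing off the image `X r '' T`, and of the SAME weighted helicity. -/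
def IsTubeTransport (u : ℝ → E3 → E3) (t₁ t₀ : ℝ) (T : Set E3) (χ : E3 → ℝ) (X : ℝ → E3 → E3) (χ' : ℝ → E3 → ℝ) : Prop :=
  χ' t₀ = χ ∧
    ∀ r ∈ Set.Icc t₁ t₀,
      (∃ R' : ℝ, 0 < R' ∧ IsTubeDatum (u r) (χ' r) R') ∧
        (∀ y ∈ T, χ' r (X r y) = χ y) ∧
        (∀ x : E3, χ' r x ≠ 0 → x ∈ X r '' T) ∧
        tubeHelicity (u r) (χ' r) = tubeHelicity (u t₀) χ

/-- `u` HAS ANCHOR FLOWS: for all `t₁ < t₀ < 0` with the velocity bounded on `[t₁,t₀] × ℝ³` and every tube datum `(χ,R)` of the slice `u t₀`,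
the label set `T = {χ ≠ 0}` is carried by an anchor flow with a tube transport. -/
def HasAnchorFlows (u : ℝ → E3 → E3) : Prop :=
  ∀ t₀ : ℝ, t₀ < 0 → ∀ t₁ : ℝ, t₁ < t₀ →
    (∃ B : ℝ, ∀ r ∈ Set.Icc t₁ t₀, ∀ x : E3, ‖u r x‖ ≤ B) →
      ∀ (χ : E3 → ℝ) (R : ℝ), 0 < R → IsTubeDatum (u t₀) χ R →
        ∃ (X : ℝ → E3 → E3) (χ' : ℝ → E3 → ℝ),
          IsAnchorFlow u t₁ t₀ {x : E3 | χ x ≠ 0} X ∧ IsTubeTransport u t₁ t₀ {x : E3 | χ x ≠ 0} χ X χ'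

/-- THE SHELL HELICITY FLOOR (per slice, pure analysis): one constant `C` such that for every ball `B(0,R)`, every `C¹` field `v`, every measurable
weight `|w| ≤ 1` vanishing off a measurable set `T` OF FINITE VOLUME,
`|∫_{B_R} w ⟪v, curl v⟫| ≤ C vol(T)^{1/3} (‖Dv‖_{L²(B_R)} + R⁻¹ ‖v‖_{L²(B_R)}) ‖curl v‖_{L²(B_R)}` — Hölder (`‖v‖_{L²(T ∩ B_R)} ≤ vol(T)^{1/3}
‖v‖_{L⁶(B_R)}`) and the scale-invariant ball Sobolev inequality (tree: `Literature.Analysis.FunctionSpaces.exists_eLpNorm_le_ball`). -/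
def ShellHelicityFloor : Prop :=
  ∃ C : ℝ, 0 < C ∧ ∀ R : ℝ, 0 < R → ∀ v : E3 → E3, ContDiff ℝ 1 v →
    ∀ w : E3 → ℝ, Measurable w → (∀ x : E3, |w x| ≤ 1) →
      ∀ T : Set E3, MeasurableSet T → volume T < ⊤ → (∀ x : E3, x ∉ T → w x = 0) →
        |∫ x in Metric.ball (0 : E3) R, w x * inner ℝ (v x) (Literature.Analysis.FluidPDE.curl v x)| ≤
          C * (volume T).toReal ^ (1 / 3 : ℝ) *
              (Real.sqrt (∫ x in Metric.ball (0 : E3) R, ‖fderiv ℝ v x‖ ^ 2) +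
                R⁻¹ * Real.sqrt (∫ x in Metric.ball (0 : E3) R, ‖v x‖ ^ 2)) *
            Real.sqrt (∫ x in Metric.ball (0 : E3) R, ‖Literature.Analysis.FluidPDE.curl v x‖ ^ 2)

/-- THE FAR-VOLUME BOUND (tentacle-proof travel estimate): one constant `C` such that for every member of the class (any `ρ > 0`, classical), every
anchor flow `X` on `[t₁,t₀]` (`−R² < t₁ < t₀ < 0`) of a measurable label set `T ⊆ B(0,R₀)`, every `s ∈ [t₁,t₀]`, every scale `R ≥ 2R₀` and every
measurable set `E₀ ⊆ T` of labels that are FAR at time `s` (`‖X s y‖ ≥ R`):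
`vol(E₀)^{1/6} (R − R₀) ≤ C √c (√(t₀−s) R^{(1−ρ)/2} + (t₀−s) R^{−(1/2+ρ)})` — the Lagrangian clamp functional `Ψ(r) = ∫_{E₀} min(‖X r y‖, R)`,
`|Ψ'| ≤ vol(E₀)^{5/6} ‖u r‖_{L⁶(B_R)}` (volume preservation + Hölder), Sobolev on `B_R`, and the `E`/`A`-gauges on the window `(−R², 0)`. -/
def FarVolumeBound : Prop :=
  ∃ C : ℝ, 0 < C ∧ ∀ ρ : ℝ, 0 < ρ →
    ∀ (u : ℝ → E3 → E3) (p : ℝ → E3 → ℝ) (H : ℝ → E3 → E3 →L[ℝ] E3) (c : ℝ≥0), InClass ρ u p H c →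
      Literature.Analysis.FluidPDE.IsClassicalEulerSolutionOn (Set.Iio 0) 0 u p →
        ∀ (t₁ t₀ : ℝ) (T : Set E3) (X : ℝ → E3 → E3), t₁ < t₀ → t₀ < 0 → MeasurableSet T → IsAnchorFlow u t₁ t₀ T X →
          ∀ R₀ : ℝ, 0 < R₀ → T ⊆ Metric.ball (0 : E3) R₀ →
            ∀ R : ℝ, 2 * R₀ ≤ R → -R ^ 2 < t₁ →
              ∀ s ∈ Set.Icc t₁ t₀, ∀ E₀ ⊆ T, MeasurableSet E₀ → (∀ y ∈ E₀, R ≤ ‖X s y‖) →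
                (volume E₀).toReal ^ (1 / 6 : ℝ) * (R - R₀) ≤
                  C * Real.sqrt (c : ℝ) * (Real.sqrt (t₀ - s) * R ^ ((1 - ρ) / 2) + (t₀ - s) * R ^ (-(1 / 2 + ρ)))

/-! ## Registered stubs (sorried) -/

/-- K1 (S/M, port): classical members HAVE ANCHOR FLOWS on every velocity-bounded slab (re-assembly of `HelicityTube.tubesPersist_of_driftingPastWith_free`
with the slab bound `B` in place of the drift envelope — drift radius `B(t₀−t₁)` — plus `CasimirFloorTransport`'s volume / change-of-variables bookkeeping). -/
def Sig.stub_anchorFlow : Prop :=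
  ∀ (u : ℝ → E3 → E3) (p : ℝ → E3 → ℝ), Literature.Analysis.FluidPDE.IsClassicalEulerSolutionOn (Set.Iio 0) 0 u p → HasAnchorFlows u

/-- K1 FILLED (REV5): LANDED in the tree by seat ns-ezl-w3 g8 as `Theorems.….ChiralAnchor.stub_anchorFlow_filler` (δ-unfolded verbatim;
`…Theorems.EulerZoomLiouvillePowerGaugeEulerLiouvilleChiralAnchorFlow|Transport`), cited here by name. -/
theorem stub_anchorFlow : Sig.stub_anchorFlow := by
  intro u p hcl
  exact Summit.NavierStokesRegularity.NavierStokesRegularity.Theorems.PowerGaugeEulerLiouville.ChiralAnchor.stub_anchorFlow_filler u p hcl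

/-- K2 (S/M): the shell helicity floor (Hölder + `exists_eLpNorm_le_ball`). -/
def Sig.stub_shellFloor : Prop :=
  ShellHelicityFloor

section K2Proof
open Literature.Analysis.FunctionSpaces Literature.Analysis.FunctionSpaces.SobolevApprox

/-- (K2, proof) real `L^q` quantity of a continuous function on a ball from its `eLpNorm` (`q ≥ 1`). [folklore] -/
theorem eLpNorm_restrict_ball_eq_ofReal {G : Type*} [NormedAddCommGroup G] {f : E3 → G} (hf : Continuous f)
    (R : ℝ) {q : ℝ≥0} (hq : 1 ≤ q) :
    eLpNorm f (q : ℝ≥0∞) (volume.restrict (ball (0 : E3) R)) =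
      ENNReal.ofReal ((∫ x in ball (0 : E3) R, ‖f x‖ ^ (q : ℝ)) ^ (q : ℝ)⁻¹) := by
  have hmem : MemLp f (q : ℝ≥0∞) (volume.restrict (ball (0 : E3) R)) :=
    memLp_restrict_of_continuous_of_isBounded (Ω := ⟨ball (0 : E3) R, isOpen_ball⟩) hf isBounded_ball
  have hq0 : (q : ℝ≥0∞) ≠ 0 := by
    have : (0 : ℝ≥0) < q := lt_of_lt_of_le zero_lt_one hq
    exact_mod_cast this.ne'
  rw [hmem.eLpNorm_eq_integral_rpow_norm hq0 ENNReal.coe_ne_top]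
  simp

/-- **K2 PROVED (REV2): the shell helicity floor `ShellHelicityFloor` holds** — pointwise `|w⟪v,curl v⟫| ≤ 𝟙_T‖v‖‖curl v‖`, Cauchy–Schwarz,
Hölder with exponents `3/2, 3` (`∫_B 𝟙_T‖v‖² ≤ vol(T)^{2/3}‖v‖²_{L⁶(B)}`) and the tree's scale-invariant ball Sobolev inequality
`Literature.Analysis.FunctionSpaces.exists_eLpNorm_le_ball` (`p = 2`, `p' = 6`, `n = 3`; `memSobolevDomain_one_of_contDiff`,
`HasWeakFDerivOn.of_contDiff_holds`).  Constant `C + 1` with `C` the Sobolev constant. [folklore] -/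
theorem shellHelicityFloor_holds : ShellHelicityFloor := by
  classical
  have hfin : (Module.finrank ℝ E3 : ℝ) = 3 := by simp
  obtain ⟨C, hC⟩ := exists_eLpNorm_le_ball (E := E3) (F := E3) (p := 2) (p' := 6) (by norm_num)
    (by rw [hfin]; norm_num) (by rw [hfin]; norm_num)
  refine ⟨(C : ℝ) + 1, by positivity, fun R hR v hv w hw hw1 T hT hTfin hwT => ?_⟩
  set B : Set E3 := ball (0 : E3) R with hB
  set μ : Measure E3 := volume.restrict B with hμ
  have hBm : MeasurableSet B := measurableSet_ball
  haveI : IsFiniteMeasure μ := by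
    rw [hμ]; exact isFiniteMeasure_restrict.2 (measure_ball_lt_top).ne
  set cv : E3 → E3 := Literature.Analysis.FluidPDE.curl v with hcv
  have hvc : Continuous v := hv.continuous
  have hωc : Continuous cv := by
    rw [hcv, Literature.Analysis.FluidPDE.curl_eq_curlCLM_comp]
    exact Literature.Analysis.FluidPDE.curlCLM.continuous.comp (hv.continuous_fderiv one_ne_zero)
  have hDc : Continuous (fderiv ℝ v) := hv.continuous_fderiv one_ne_zero
  obtain ⟨Mv, hMv⟩ := (isCompact_closedBall (0 : E3) R).exists_bound_of_continuousOn hvc.continuousOn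
  obtain ⟨Mω, hMω⟩ := (isCompact_closedBall (0 : E3) R).exists_bound_of_continuousOn hωc.continuousOn
  set f : E3 → ℝ := fun x => T.indicator (fun _ => (1 : ℝ)) x * ‖v x‖ with hf
  set g : E3 → ℝ := fun x => ‖cv x‖ with hg
  have hind_m : Measurable fun x => T.indicator (fun _ => (1 : ℝ)) x := (measurable_const.indicator hT)
  have hf_m : AEStronglyMeasurable f μ := (hind_m.mul hvc.norm.measurable).aestronglyMeasurable
  have hg_m : AEStronglyMeasurable g μ := hωc.norm.aestronglyMeasurable
  have hind01 : ∀ x, T.indicator (fun _ => (1 : ℝ)) x = 0 ∨ T.indicator (fun _ => (1 : ℝ)) x = 1 := by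
    intro x; by_cases hx : x ∈ T <;> simp [Set.indicator, hx]
  have hind_nn : ∀ x, 0 ≤ T.indicator (fun _ => (1 : ℝ)) x := fun x => by
    rcases hind01 x with h | h <;> simp [h]
  have hind_le : ∀ x, T.indicator (fun _ => (1 : ℝ)) x ≤ 1 := fun x => by
    rcases hind01 x with h | h <;> simp [h]
  have hf_nn : ∀ x, 0 ≤ f x := fun x => mul_nonneg (hind_nn x) (norm_nonneg _)
  have hg_nn : ∀ x, 0 ≤ g x := fun x => norm_nonneg _
  have hpt : ∀ x, ‖w x * inner ℝ (v x) (cv x)‖ ≤ f x * g x := by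
    intro x
    rw [norm_mul, Real.norm_eq_abs]
    by_cases hx : x ∈ T
    · have : T.indicator (fun _ => (1 : ℝ)) x = 1 := by simp [hx]
      rw [hf, hg]; simp only [this, one_mul]
      calc |w x| * ‖inner ℝ (v x) (cv x)‖ ≤ 1 * (‖v x‖ * ‖cv x‖) :=
            mul_le_mul (hw1 x) (norm_inner_le_norm _ _) (norm_nonneg _) zero_le_one
        _ = ‖v x‖ * ‖cv x‖ := one_mul _
    · rw [hwT x hx]; simp [mul_nonneg (hf_nn x) (hg_nn x)]
  have hB_sub : B ⊆ closedBall (0 : E3) R := ball_subset_closedBall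
  have hf_bd : ∀ᵐ x ∂μ, ‖f x‖ ≤ Mv := by
    rw [hμ]; refine ae_restrict_of_forall_mem hBm fun x hx => ?_
    rw [Real.norm_of_nonneg (hf_nn x), hf]
    calc T.indicator (fun _ => (1 : ℝ)) x * ‖v x‖ ≤ 1 * ‖v x‖ :=
          mul_le_mul_of_nonneg_right (hind_le x) (norm_nonneg _)
      _ = ‖v x‖ := one_mul _
      _ ≤ Mv := hMv x (hB_sub hx)
  have hg_bd : ∀ᵐ x ∂μ, ‖g x‖ ≤ Mω := by
    rw [hμ]; refine ae_restrict_of_forall_mem hBm fun x hx => ?_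
    rw [hg, Real.norm_of_nonneg (norm_nonneg _)]; exact hMω x (hB_sub hx)
  have hf2 : MemLp f 2 μ := MemLp.of_bound hf_m Mv hf_bd
  have hg2 : MemLp g 2 μ := MemLp.of_bound hg_m Mω hg_bd
  have hfg_int : Integrable (fun x => f x * g x) μ := hf2.integrable_mul hg2
  have hCS : |∫ x, w x * inner ℝ (v x) (cv x) ∂μ| ≤
      Real.sqrt (∫ x, f x ^ 2 ∂μ) * Real.sqrt (∫ x, g x ^ 2 ∂μ) := by
    calc |∫ x, w x * inner ℝ (v x) (cv x) ∂μ|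
        = ‖∫ x, w x * inner ℝ (v x) (cv x) ∂μ‖ := (Real.norm_eq_abs _).symm
      _ ≤ ∫ x, ‖w x * inner ℝ (v x) (cv x)‖ ∂μ := norm_integral_le_integral_norm _
      _ ≤ ∫ x, f x * g x ∂μ :=
          integral_mono_of_nonneg (ae_of_all _ fun x => norm_nonneg _) hfg_int (ae_of_all _ hpt)
      _ ≤ (∫ x, f x ^ (2 : ℝ) ∂μ) ^ (1 / (2 : ℝ)) * (∫ x, g x ^ (2 : ℝ) ∂μ) ^ (1 / (2 : ℝ)) :=
          integral_mul_le_Lp_mul_Lq_of_nonneg Real.HolderConjugate.two_two (ae_of_all _ hf_nn)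
            (ae_of_all _ hg_nn) (by simpa using hf2) (by simpa using hg2)
      _ = Real.sqrt (∫ x, f x ^ 2 ∂μ) * Real.sqrt (∫ x, g x ^ 2 ∂μ) := by
          simp only [Real.rpow_two, Real.sqrt_eq_rpow]
  have hf_sq : ∀ x, f x ^ 2 = T.indicator (fun _ => (1 : ℝ)) x * ‖v x‖ ^ 2 := by
    intro x; rcases hind01 x with h | h <;> simp [hf, h]
  have hMv0 : 0 ≤ Mv := (norm_nonneg _).trans (hMv 0 (mem_closedBall_self hR.le))
  have hind32 : MemLp (fun x => T.indicator (fun _ => (1 : ℝ)) x) (ENNReal.ofReal (3 / 2)) μ :=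
    MemLp.of_bound hind_m.aestronglyMeasurable 1
      (ae_of_all _ fun x => by rw [Real.norm_of_nonneg (hind_nn x)]; exact hind_le x)
  have hv2_m : AEStronglyMeasurable (fun x => ‖v x‖ ^ 2) μ :=
    (hvc.norm.pow 2).aestronglyMeasurable
  have hv2_bd : ∀ᵐ x ∂μ, ‖‖v x‖ ^ 2‖ ≤ Mv ^ 2 := by
    rw [hμ]; refine ae_restrict_of_forall_mem hBm fun x hx => ?_
    rw [Real.norm_of_nonneg (by positivity)]
    exact pow_le_pow_left₀ (norm_nonneg _) (hMv x (hB_sub hx)) 2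
  have hv2_3 : MemLp (fun x => ‖v x‖ ^ 2) (ENNReal.ofReal 3) μ := MemLp.of_bound hv2_m (Mv ^ 2) hv2_bd
  have hp32 : (3 / 2 : ℝ).HolderConjugate 3 := by rw [Real.holderConjugate_iff]; norm_num
  have hH := integral_mul_le_Lp_mul_Lq_of_nonneg hp32 (ae_of_all _ hind_nn)
    (ae_of_all _ fun x => by positivity) hind32 hv2_3
  have hind_rpow : ∀ x, T.indicator (fun _ => (1 : ℝ)) x ^ (3 / 2 : ℝ) = T.indicator (fun _ => (1 : ℝ)) x := by
    intro x; rcases hind01 x with h | h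
    · rw [h, Real.zero_rpow (by norm_num)]
    · rw [h, Real.one_rpow]
  have hvolTB : ∫ x, T.indicator (fun _ => (1 : ℝ)) x ∂μ ≤ (volume T).toReal := by
    have h1 : ∫ x, T.indicator (fun _ => (1 : ℝ)) x ∂μ = μ.real T := integral_indicator_one hT
    rw [h1, measureReal_def, hμ, Measure.restrict_apply hT]
    exact ENNReal.toReal_mono hTfin.ne (measure_mono inter_subset_left)
  have hvolT0 : 0 ≤ (volume T).toReal := ENNReal.toReal_nonneg
  have hv6 : ∀ x, (‖v x‖ ^ 2) ^ (3 : ℝ) = ‖v x‖ ^ (6 : ℝ) := by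
    intro x
    rw [show (3 : ℝ) = ((3 : ℕ) : ℝ) by norm_num, Real.rpow_natCast,
      show (6 : ℝ) = ((6 : ℕ) : ℝ) by norm_num, Real.rpow_natCast, ← pow_mul]
  have hI2le : ∫ x, f x ^ 2 ∂μ ≤ (volume T).toReal ^ (2 / 3 : ℝ) * (∫ x, ‖v x‖ ^ (6 : ℝ) ∂μ) ^ (1 / 3 : ℝ) := by
    have hlhs : ∫ x, f x ^ 2 ∂μ = ∫ x, T.indicator (fun _ => (1 : ℝ)) x * ‖v x‖ ^ 2 ∂μ :=
      integral_congr_ae (ae_of_all _ hf_sq)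
    rw [hlhs]
    refine hH.trans ?_
    simp only [hind_rpow, hv6]
    have h23 : (1 / (3 / 2 : ℝ)) = (2 / 3 : ℝ) := by norm_num
    rw [h23]
    have hI6nn : 0 ≤ (∫ x, ‖v x‖ ^ (6 : ℝ) ∂μ) ^ (1 / 3 : ℝ) := Real.rpow_nonneg (integral_nonneg fun x => by positivity) _
    exact mul_le_mul_of_nonneg_right (Real.rpow_le_rpow (integral_nonneg fun x => hind_nn x) hvolTB (by norm_num)) hI6nn
  have hSob := hC 0 R hR v (fderiv ℝ v)
    (memSobolevDomain_one_of_contDiff (Ω := ⟨B, isOpen_ball⟩) hv isBounded_ball)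
    (HasWeakFDerivOn.of_contDiff_holds (E' := E3) (F := E3) ⟨B, isOpen_ball⟩ volume hv)
  have e6 := eLpNorm_restrict_ball_eq_ofReal (G := E3) hvc R (q := 6) (by norm_num)
  have e2 := eLpNorm_restrict_ball_eq_ofReal (G := E3) hvc R (q := 2) (by norm_num)
  have e2' := eLpNorm_restrict_ball_eq_ofReal (G := E3 →L[ℝ] E3) hDc R (q := 2) (by norm_num)
  set I6r : ℝ := (∫ x, ‖v x‖ ^ ((6 : ℝ≥0) : ℝ) ∂μ) ^ ((6 : ℝ≥0) : ℝ)⁻¹ with hI6r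
  set I2r : ℝ := (∫ x, ‖v x‖ ^ ((2 : ℝ≥0) : ℝ) ∂μ) ^ ((2 : ℝ≥0) : ℝ)⁻¹ with hI2r
  set J2r : ℝ := (∫ x, ‖fderiv ℝ v x‖ ^ ((2 : ℝ≥0) : ℝ) ∂μ) ^ ((2 : ℝ≥0) : ℝ)⁻¹ with hJ2r
  have hI6r0 : 0 ≤ I6r := Real.rpow_nonneg (integral_nonneg fun x => by positivity) _
  have hI2r0 : 0 ≤ I2r := Real.rpow_nonneg (integral_nonneg fun x => by positivity) _
  have hJ2r0 : 0 ≤ J2r := Real.rpow_nonneg (integral_nonneg fun x => by positivity) _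
  have hS : I6r ≤ (C : ℝ) * (R⁻¹ * I2r + J2r) := by
    have h := hSob
    rw [← hB, ← hμ] at h
    rw [e6, e2, e2'] at h
    rw [← ENNReal.ofReal_inv_of_pos hR,
      ← ENNReal.ofReal_mul (inv_nonneg.2 hR.le), ← ENNReal.ofReal_add (by positivity) hJ2r0,
      ← ENNReal.ofReal_coe_nnreal, ← ENNReal.ofReal_mul (NNReal.coe_nonneg C)] at h
    exact (ENNReal.ofReal_le_ofReal_iff (by positivity)).1 h
  have hI2r_eq : I2r = Real.sqrt (∫ x, ‖v x‖ ^ 2 ∂μ) := by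
    simp only [hI2r, NNReal.coe_ofNat, Real.rpow_two, Real.sqrt_eq_rpow, one_div]
  have hJ2r_eq : J2r = Real.sqrt (∫ x, ‖fderiv ℝ v x‖ ^ 2 ∂μ) := by
    simp only [hJ2r, NNReal.coe_ofNat, Real.rpow_two, Real.sqrt_eq_rpow, one_div]
  have hI6int0 : 0 ≤ ∫ x, ‖v x‖ ^ (6 : ℝ) ∂μ := integral_nonneg fun x => by positivity
  have hsqrt6 : Real.sqrt ((∫ x, ‖v x‖ ^ (6 : ℝ) ∂μ) ^ (1 / 3 : ℝ)) = I6r := by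
    rw [hI6r, Real.sqrt_eq_rpow, ← Real.rpow_mul hI6int0]
    norm_num
  have hsqrtT : Real.sqrt ((volume T).toReal ^ (2 / 3 : ℝ)) = (volume T).toReal ^ (1 / 3 : ℝ) := by
    rw [Real.sqrt_eq_rpow, ← Real.rpow_mul hvolT0]
    norm_num
  have hsqf : Real.sqrt (∫ x, f x ^ 2 ∂μ) ≤ (volume T).toReal ^ (1 / 3 : ℝ) * I6r := by
    calc Real.sqrt (∫ x, f x ^ 2 ∂μ)
        ≤ Real.sqrt ((volume T).toReal ^ (2 / 3 : ℝ) * (∫ x, ‖v x‖ ^ (6 : ℝ) ∂μ) ^ (1 / 3 : ℝ)) :=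
          Real.sqrt_le_sqrt hI2le
      _ = (volume T).toReal ^ (1 / 3 : ℝ) * I6r := by
          rw [Real.sqrt_mul (Real.rpow_nonneg hvolT0 _), hsqrt6, hsqrtT]
  have hg_eq : (∫ x, g x ^ 2 ∂μ) = ∫ x, ‖cv x‖ ^ 2 ∂μ := rfl
  have hT13 : 0 ≤ (volume T).toReal ^ (1 / 3 : ℝ) := Real.rpow_nonneg hvolT0 _
  have hsg0 : 0 ≤ Real.sqrt (∫ x, ‖cv x‖ ^ 2 ∂μ) := Real.sqrt_nonneg _
  have hsum0 : 0 ≤ Real.sqrt (∫ x, ‖fderiv ℝ v x‖ ^ 2 ∂μ) + R⁻¹ * Real.sqrt (∫ x, ‖v x‖ ^ 2 ∂μ) := by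
    positivity
  calc |∫ x, w x * inner ℝ (v x) (cv x) ∂μ|
      ≤ Real.sqrt (∫ x, f x ^ 2 ∂μ) * Real.sqrt (∫ x, g x ^ 2 ∂μ) := hCS
    _ ≤ ((volume T).toReal ^ (1 / 3 : ℝ) * I6r) * Real.sqrt (∫ x, ‖cv x‖ ^ 2 ∂μ) := by
        rw [hg_eq]; exact mul_le_mul_of_nonneg_right hsqf hsg0
    _ ≤ ((volume T).toReal ^ (1 / 3 : ℝ) * ((C : ℝ) * (R⁻¹ * I2r + J2r))) *
          Real.sqrt (∫ x, ‖cv x‖ ^ 2 ∂μ) := by gcongr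
    _ = (C : ℝ) * (volume T).toReal ^ (1 / 3 : ℝ) *
          (Real.sqrt (∫ x, ‖fderiv ℝ v x‖ ^ 2 ∂μ) + R⁻¹ * Real.sqrt (∫ x, ‖v x‖ ^ 2 ∂μ)) *
          Real.sqrt (∫ x, ‖cv x‖ ^ 2 ∂μ) := by
        rw [hI2r_eq, hJ2r_eq]; ring
    _ ≤ ((C : ℝ) + 1) * (volume T).toReal ^ (1 / 3 : ℝ) *
          (Real.sqrt (∫ x, ‖fderiv ℝ v x‖ ^ 2 ∂μ) + R⁻¹ * Real.sqrt (∫ x, ‖v x‖ ^ 2 ∂μ)) *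
          Real.sqrt (∫ x, ‖cv x‖ ^ 2 ∂μ) := by
        have hC1 : (C : ℝ) ≤ (C : ℝ) + 1 := by linarith
        gcongr

end K2Proof

/-- K2 FILLED (REV2, in-file, sorry-free): `stub_shellFloor` := `shellHelicityFloor_holds`. -/
theorem stub_shellFloor : Sig.stub_shellFloor :=
  shellHelicityFloor_holds

/-- K3 (M): the far-volume bound for members with an anchor flow — PROVED in-file (REV3) right below. -/
def Sig.stub_farVolume : Prop :=
  FarVolumeBound

section K3Proof
/-! ### K3 PROVED (REV3): the far-volume bound `FarVolumeBound` — helper calculus (the `C¹` radial clamp and the per-label travel bound)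
lives in the sub-namespace `K3`; the theorem is `K3.farVolumeBound_holds`. [folklore: Lagrangian clamp functional + volume preservation + Hölder 6/5–6 +
scale-invariant ball Sobolev `exists_eLpNorm_le_ball` + the `A`-gauge slice bound `Backward.lintegral_ball_le_of_gaugeA` + the `E`-gauge window bound
`SwirlfreeLedger.setLIntegral_window_frobenius_fderiv_le` (tree, EulerZoomLiouville Theorems).] -/
namespace K3
open Literature.Analysis Literature.Analysis.FluidPDE
open Literature.Analysis.FunctionSpaces Literature.Analysis.FunctionSpaces.SobolevApprox
open Summit.NavierStokesRegularity.NavierStokesRegularity.Theorems.PowerGaugeEulerLiouville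

/-! ### U1: the `C¹` radial clamp -/

/-- Slope profile: continuous, values in `[0,1]`, vanishing off `(R₀, R)`, equal to `1` on `[R₀+δ, R−δ]`. -/
def slope (R₀ R δ : ℝ) (r : ℝ) : ℝ :=
  max 0 (min 1 (min ((r - R₀) / δ) ((R - r) / δ)))

theorem slope_continuous (R₀ R δ : ℝ) : Continuous (slope R₀ R δ) := by
  unfold slope
  exact continuous_const.max (continuous_const.min
    (((continuous_id.sub continuous_const).div_const _).min ((continuous_const.sub continuous_id).div_const _)))

theorem slope_nonneg (R₀ R δ r : ℝ) : 0 ≤ slope R₀ R δ r := le_max_left _ _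

theorem slope_le_one (R₀ R δ r : ℝ) : slope R₀ R δ r ≤ 1 := max_le zero_le_one (min_le_left _ _)

theorem slope_eq_zero_of_le {R₀ R δ r : ℝ} (hδ : 0 < δ) (hr : r ≤ R₀) : slope R₀ R δ r = 0 := by
  unfold slope
  apply max_eq_left
  calc min 1 (min ((r - R₀) / δ) ((R - r) / δ)) ≤ (r - R₀) / δ := (min_le_right _ _).trans (min_le_left _ _)
    _ ≤ 0 := div_nonpos_iff.2 (Or.inr ⟨by linarith, hδ.le⟩)

theorem slope_eq_zero_of_ge {R₀ R δ r : ℝ} (hδ : 0 < δ) (hr : R ≤ r) : slope R₀ R δ r = 0 := by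
  unfold slope
  apply max_eq_left
  calc min 1 (min ((r - R₀) / δ) ((R - r) / δ)) ≤ (R - r) / δ := (min_le_right _ _).trans (min_le_right _ _)
    _ ≤ 0 := div_nonpos_iff.2 (Or.inr ⟨by linarith, hδ.le⟩)

theorem slope_eq_one_of_mem {R₀ R δ r : ℝ} (hδ : 0 < δ) (h1 : R₀ + δ ≤ r) (h2 : r ≤ R - δ) :
    slope R₀ R δ r = 1 := by
  unfold slope
  have hmin : 1 ≤ min ((r - R₀) / δ) ((R - r) / δ) :=
    le_min ((le_div_iff₀ hδ).2 (by linarith)) ((le_div_iff₀ hδ).2 (by linarith))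
  rw [min_eq_left hmin, max_eq_right zero_le_one]

/-- The clamp profile `g(r) = ∫₀ʳ slope`. -/
def prof (R₀ R δ : ℝ) (r : ℝ) : ℝ := ∫ x in (0 : ℝ)..r, slope R₀ R δ x

theorem prof_hasDerivAt (R₀ R δ r : ℝ) : HasDerivAt (prof R₀ R δ) (slope R₀ R δ r) r :=
  ((slope_continuous R₀ R δ).integral_hasStrictDerivAt 0 r).hasDerivAt

theorem prof_continuous (R₀ R δ : ℝ) : Continuous (prof R₀ R δ) :=
  continuous_iff_continuousAt.2 fun r => (prof_hasDerivAt R₀ R δ r).continuousAt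

theorem prof_eq_zero_of_le {R₀ R δ r : ℝ} (hR₀ : 0 ≤ R₀) (hδ : 0 < δ) (hr : r ≤ R₀) : prof R₀ R δ r = 0 := by
  unfold prof
  rw [intervalIntegral.integral_congr (g := fun _ => (0 : ℝ)) ?_, intervalIntegral.integral_zero]
  intro x hx
  have hx' : x ≤ R₀ := by
    rcases le_total 0 r with h | h
    · rw [uIcc_of_le h] at hx; exact hx.2.trans hr
    · rw [uIcc_of_ge h] at hx; exact hx.2.trans hR₀
  exact slope_eq_zero_of_le hδ hx'

theorem prof_eq_of_ge {R₀ R δ r : ℝ} (hδ : 0 < δ) (hr : R ≤ r) : prof R₀ R δ r = prof R₀ R δ R := by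
  unfold prof
  have hi : ∀ a b : ℝ, IntervalIntegrable (slope R₀ R δ) volume a b := fun a b =>
    (slope_continuous R₀ R δ).intervalIntegrable a b
  rw [← intervalIntegral.integral_add_adjacent_intervals (hi 0 R) (hi R r)]
  have h0 : ∫ x in R..r, slope R₀ R δ x = 0 := by
    rw [intervalIntegral.integral_congr (g := fun _ => (0 : ℝ)) ?_, intervalIntegral.integral_zero]
    intro x hx
    rw [uIcc_of_le hr] at hx
    exact slope_eq_zero_of_ge hδ hx.1
  rw [h0, add_zero]

theorem prof_R_ge {R₀ R δ : ℝ} (hR₀ : 0 < R₀) (hR : 2 * R₀ ≤ R) (hδ : δ = (R - R₀) / 4) :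
    (R - R₀) / 2 ≤ prof R₀ R δ R := by
  have hδ0 : 0 < δ := by rw [hδ]; linarith
  have hi : ∀ a b : ℝ, IntervalIntegrable (slope R₀ R δ) volume a b := fun a b =>
    (slope_continuous R₀ R δ).intervalIntegrable a b
  unfold prof
  rw [← intervalIntegral.integral_add_adjacent_intervals (hi 0 (R₀ + δ)) (hi (R₀ + δ) R),
    ← intervalIntegral.integral_add_adjacent_intervals (hi (R₀ + δ) (R - δ)) (hi (R - δ) R)]
  have h1 : 0 ≤ ∫ x in (0 : ℝ)..(R₀ + δ), slope R₀ R δ x :=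
    intervalIntegral.integral_nonneg (by linarith) fun x _ => slope_nonneg _ _ _ _
  have h3 : 0 ≤ ∫ x in (R - δ)..R, slope R₀ R δ x :=
    intervalIntegral.integral_nonneg (by linarith) fun x _ => slope_nonneg _ _ _ _
  have h2 : ∫ x in (R₀ + δ)..(R - δ), slope R₀ R δ x = (R - R₀) / 2 := by
    rw [intervalIntegral.integral_congr (g := fun _ => (1 : ℝ)) ?_, intervalIntegral.integral_const, smul_eq_mul,
      mul_one, hδ]
    · ring
    · intro x hx
      rw [uIcc_of_le (by linarith)] at hx
      exact slope_eq_one_of_mem hδ0 hx.1 hx.2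
  linarith

/-- The clamp `φ(x) = g(‖x‖)` and its derivative. -/
def clamp (R₀ R δ : ℝ) (x : E3) : ℝ := prof R₀ R δ ‖x‖

def clampDeriv (R₀ R δ : ℝ) (x : E3) : E3 →L[ℝ] ℝ :=
  if x = 0 then 0 else (slope R₀ R δ ‖x‖) • fderiv ℝ (fun w : E3 => ‖w‖) x

theorem clamp_hasFDerivAt {R₀ R δ : ℝ} (hR₀ : 0 < R₀) (hδ : 0 < δ) (x : E3) :
    HasFDerivAt (clamp R₀ R δ) (clampDeriv R₀ R δ x) x := by
  by_cases hx : x = 0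
  · subst hx
    rw [clampDeriv, if_pos rfl]
    have hev : (fun _ : E3 => (0 : ℝ)) =ᶠ[𝓝 (0 : E3)] clamp R₀ R δ := by
      filter_upwards [Metric.ball_mem_nhds (0 : E3) hR₀] with w hw
      rw [clamp, prof_eq_zero_of_le hR₀.le hδ]
      rw [mem_ball, dist_zero_right] at hw
      exact hw.le
    exact (hasFDerivAt_const (0 : ℝ) (0 : E3)).congr_of_eventuallyEq hev.symm
  · rw [clampDeriv, if_neg hx]
    have hn : HasFDerivAt (fun w : E3 => ‖w‖) (fderiv ℝ (fun w : E3 => ‖w‖) x) x :=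
      ((contDiffAt_norm ℝ hx (n := 1)).differentiableAt one_ne_zero).hasFDerivAt
    exact (prof_hasDerivAt R₀ R δ ‖x‖).comp_hasFDerivAt x hn

theorem norm_clampDeriv_le (R₀ R δ : ℝ) (x : E3) : ‖clampDeriv R₀ R δ x‖ ≤ slope R₀ R δ ‖x‖ := by
  by_cases hx : x = 0
  · rw [clampDeriv, if_pos hx, norm_zero]; exact slope_nonneg _ _ _ _
  · rw [clampDeriv, if_neg hx, norm_smul, Real.norm_of_nonneg (slope_nonneg _ _ _ _)]
    have h1 : ‖fderiv ℝ (fun w : E3 => ‖w‖) x‖ ≤ 1 := by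
      have := norm_fderiv_le_of_lipschitz ℝ (f := fun w : E3 => ‖w‖) (x₀ := x) lipschitzWith_one_norm
      simpa using this
    calc slope R₀ R δ ‖x‖ * ‖fderiv ℝ (fun w : E3 => ‖w‖) x‖ ≤ slope R₀ R δ ‖x‖ * 1 :=
          mul_le_mul_of_nonneg_left h1 (slope_nonneg _ _ _ _)
      _ = slope R₀ R δ ‖x‖ := mul_one _

/-! ### U2: the per-label travel bound -/

theorem clamp_continuous (R₀ R δ : ℝ) : Continuous (clamp R₀ R δ) :=
  (prof_continuous R₀ R δ).comp continuous_norm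

/-- Along a trajectory `σ ↦ X σ y` with velocity `u σ (X σ y)` (within `[t₁,t₀]`), the clamp can drop between `s` and `t₀` by at most
`∫_s^{t₀} slope(‖X σ y‖) ‖u σ (X σ y)‖ dσ`. -/
theorem label_bound {R₀ R δ : ℝ} (hR₀ : 0 < R₀) (hδ : 0 < δ) {u : ℝ → E3 → E3} {X : ℝ → E3 → E3}
    {t₁ t₀ s : ℝ} {y : E3} (ht₀ : t₀ < 0) (hs : s ∈ Icc t₁ t₀)
    (hu : ContinuousOn (Function.uncurry u) (Iio (0 : ℝ) ×ˢ (univ : Set E3)))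
    (hXc : Continuous (fun q : ℝ × E3 => X q.1 q.2))
    (hXd : ∀ r ∈ Icc t₁ t₀, HasDerivWithinAt (fun σ => X σ y) (u r (X r y)) (Icc t₁ t₀) r) :
    clamp R₀ R δ (X s y) - clamp R₀ R δ (X t₀ y) ≤
      ∫ σ in s..t₀, slope R₀ R δ ‖X σ y‖ * ‖u σ (X σ y)‖ := by
  have ht₁t₀ : t₁ ≤ t₀ := hs.1.trans hs.2
  have hXy : Continuous fun σ : ℝ => X σ y := hXc.comp (continuous_id.prodMk continuous_const)
  set b : ℝ → ℝ := fun σ => slope R₀ R δ ‖X σ y‖ * ‖u σ (X σ y)‖ with hb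
  have hbc : ContinuousOn b (Iio 0) := by
    have h1 : Continuous fun σ : ℝ => slope R₀ R δ ‖X σ y‖ :=
      (slope_continuous R₀ R δ).comp (continuous_norm.comp hXy)
    have h2 : ContinuousOn (fun σ : ℝ => u σ (X σ y)) (Iio 0) := by
      have hmap : MapsTo (fun σ : ℝ => ((σ, X σ y) : ℝ × E3)) (Iio 0) (Iio (0 : ℝ) ×ˢ (univ : Set E3)) :=
        fun σ hσ => mk_mem_prod hσ (mem_univ _)
      exact hu.comp (continuous_id.prodMk hXy).continuousOn hmap
    exact h1.continuousOn.mul h2.norm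
  set proj : ℝ → ℝ := fun σ => max t₁ (min t₀ σ) with hproj
  have hprojc : Continuous proj := continuous_const.max (continuous_const.min continuous_id)
  have hproj_mem : ∀ σ, proj σ ∈ Icc t₁ t₀ := fun σ =>
    ⟨le_max_left _ _, max_le ht₁t₀ (min_le_left _ _)⟩
  have hproj_id : ∀ σ ∈ Icc t₁ t₀, proj σ = σ := fun σ hσ => by
    rw [hproj]; simp only; rw [min_eq_right hσ.2, max_eq_right hσ.1]
  set b'' : ℝ → ℝ := fun σ => b (proj σ) with hb''
  have hb''c : Continuous b'' :=
    hbc.comp_continuous hprojc fun σ => lt_of_le_of_lt (hproj_mem σ).2 ht₀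
  set B : ℝ → ℝ := fun σ => ∫ x in s..σ, b'' x with hB
  have hBd : ∀ σ, HasDerivAt B (b'' σ) σ := fun σ => (hb''c.integral_hasStrictDerivAt s σ).hasDerivAt
  set f : ℝ → ℝ := fun σ => clamp R₀ R δ (X σ y) - clamp R₀ R δ (X s y) with hf
  set f' : ℝ → ℝ := fun σ => clampDeriv R₀ R δ (X σ y) (u σ (X σ y)) with hf'
  have hfc : ContinuousOn f (Icc s t₀) :=
    (((clamp_continuous R₀ R δ).comp hXy).sub continuous_const).continuousOn
  have hfd : ∀ x ∈ Ico s t₀, HasDerivWithinAt f (f' x) (Ici x) x := by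
    intro x hx
    have hx' : x ∈ Icc t₁ t₀ := ⟨hs.1.trans hx.1, hx.2.le⟩
    have h1 : HasDerivWithinAt (fun σ => clamp R₀ R δ (X σ y)) (clampDeriv R₀ R δ (X x y) (u x (X x y)))
        (Icc t₁ t₀) x := by
      have := (clamp_hasFDerivAt (R := R) hR₀ hδ (X x y)).comp_hasDerivWithinAt x (hXd x hx')
      simpa [Function.comp_def] using this
    have h2 : HasDerivWithinAt f (f' x) (Icc t₁ t₀) x := by
      rw [hf, hf']; exact h1.sub_const _
    refine h2.mono_of_mem_nhdsWithin ?_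
    exact mem_of_superset (Icc_mem_nhdsGE hx.2) (Icc_subset_Icc hx'.1 le_rfl)
  have hbound : ∀ x ∈ Ico s t₀, ‖f' x‖ ≤ b'' x := by
    intro x hx
    have hx' : x ∈ Icc t₁ t₀ := ⟨hs.1.trans hx.1, hx.2.le⟩
    rw [hb'']; simp only; rw [hproj_id x hx', hb]; simp only; rw [hf']
    calc ‖clampDeriv R₀ R δ (X x y) (u x (X x y))‖ ≤ ‖clampDeriv R₀ R δ (X x y)‖ * ‖u x (X x y)‖ :=
          ContinuousLinearMap.le_opNorm _ _
      _ ≤ slope R₀ R δ ‖X x y‖ * ‖u x (X x y)‖ :=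
          mul_le_mul_of_nonneg_right (norm_clampDeriv_le _ _ _ _) (norm_nonneg _)
  have ha : ‖f s‖ ≤ B s := by
    rw [hf, hB]; simp
  have key := image_norm_le_of_norm_deriv_right_le_deriv_boundary hfc hfd ha hBd hbound
    (right_mem_Icc.2 hs.2)
  have hint : B t₀ = ∫ σ in s..t₀, b σ := by
    rw [hB]
    refine intervalIntegral.integral_congr fun σ hσ => ?_
    rw [uIcc_of_le hs.2] at hσ
    show b (proj σ) = b σ
    rw [hproj_id σ ⟨hs.1.trans hσ.1, hσ.2⟩]
  have hft₀ : f t₀ = clamp R₀ R δ (X t₀ y) - clamp R₀ R δ (X s y) := rfl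
  rw [hft₀, hint, Real.norm_eq_abs] at key
  have := neg_le_of_abs_le key
  linarith


/-! ### K3: assembly -/

/-- **K3 PROVED (REV3): `FarVolumeBound` holds**, with `C = 2·C_S + 1` (`C_S` the scale-invariant `W^{1,2} → L⁶` Sobolev constant on balls of `ℝ³`):
radial clamp along trajectories (fencing lemma), Tonelli, volume preservation, Hölder `(6/5, 6)`, Sobolev, the `A`- and `E`-gauges (recipe in the card). -/
theorem farVolumeBound_holds : FarVolumeBound := by
  classical
  have hfin : (Module.finrank ℝ E3 : ℝ) = 3 := by simp
  obtain ⟨CS, hCS⟩ := exists_eLpNorm_le_ball (E := E3) (F := E3) (p := 2) (p' := 6) (by norm_num)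
    (by rw [hfin]; norm_num) (by rw [hfin]; norm_num)
  refine ⟨2 * (CS : ℝ) + 1, by positivity, ?_⟩
  intro ρ hρ u p H c hcls hcl t₁ t₀ T X ht₁ ht₀ hT hX R₀ hR₀ hTR₀ R hR hRt₁ s hs E₀ hE₀T hE₀m hfar
  obtain ⟨hXc, hXid, hXd, hXinj, hXvol, hXcov, hXbdd⟩ := hX
  obtain ⟨_, hH, hgauge⟩ := hcls
  have hA : ∀ a : ℝ, 0 < a → ENNReal.ofReal (a ^ (2 * ρ)) * cknA a (0 : ℝ × E3) u ≤ (c : ℝ≥0∞) :=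
    fun a ha => le_trans (le_trans le_self_add le_self_add) (hgauge a ha)
  have hE : ∀ a : ℝ, 0 < a → ENNReal.ofReal (a ^ ρ) * cknE a (0 : ℝ × E3) H ≤ (c : ℝ≥0∞) :=
    fun a ha => le_trans (le_trans le_add_self le_self_add) (hgauge a ha)
  have hR0 : 0 < R := by linarith
  set δ : ℝ := (R - R₀) / 4 with hδdef
  have hδ : 0 < δ := by rw [hδdef]; linarith
  have ht₁t₀ : t₁ ≤ t₀ := ht₁.le
  have hIcc0 : Icc t₁ t₀ ⊆ Iio 0 := fun r hr => lt_of_le_of_lt hr.2 ht₀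
  have hu_cont : ContinuousOn (Function.uncurry u) (Iio (0 : ℝ) ×ˢ (univ : Set E3)) :=
    hcl.smooth_velocity.continuousOn
  have hlabel : ∀ y ∈ E₀, prof R₀ R δ R ≤ ∫ σ in s..t₀, slope R₀ R δ ‖X σ y‖ * ‖u σ (X σ y)‖ := by
    intro y hy
    have hyT : y ∈ T := hE₀T hy
    have h1 : clamp R₀ R δ (X s y) = prof R₀ R δ R := by
      rw [clamp]; exact prof_eq_of_ge hδ (hfar y hy)
    have h2 : clamp R₀ R δ (X t₀ y) = 0 := by
      rw [clamp, hXid y hyT]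
      have : ‖y‖ < R₀ := by simpa using hTR₀ hyT
      exact prof_eq_zero_of_le hR₀.le hδ this.le
    have := label_bound (R := R) hR₀ hδ ht₀ hs hu_cont hXc (fun r hr => hXd r hr y hyT)
    rw [h1, h2, sub_zero] at this
    exact this
  set I : Set ℝ := Ioo s t₀ with hIdef
  have hIm : MeasurableSet I := measurableSet_Ioo
  have hI_Icc : I ⊆ Icc t₁ t₀ := fun σ hσ => ⟨hs.1.trans hσ.1.le, hσ.2.le⟩
  have hI0 : I ⊆ Iio 0 := hI_Icc.trans hIcc0
  set F : E3 → ℝ → ℝ≥0∞ := fun y σ => ENNReal.ofReal (slope R₀ R δ ‖X σ y‖ * ‖u σ (X σ y)‖) with hFdef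
  have hB : ENNReal.ofReal (prof R₀ R δ R) * volume E₀ ≤ ∫⁻ y in E₀, ∫⁻ σ in I, F y σ := by
    rw [← setLIntegral_const]
    refine lintegral_mono_ae ((ae_restrict_iff' hE₀m).2 (ae_of_all _ fun y hy => ?_))
    have hyT : y ∈ T := hE₀T hy
    have hXy : Continuous fun σ : ℝ => X σ y := hXc.comp (continuous_id.prodMk continuous_const)
    have hbc : ContinuousOn (fun σ : ℝ => slope R₀ R δ ‖X σ y‖ * ‖u σ (X σ y)‖) (Iio 0) := by
      have h1 : Continuous fun σ : ℝ => slope R₀ R δ ‖X σ y‖ :=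
        (slope_continuous R₀ R δ).comp (continuous_norm.comp hXy)
      have h2 : ContinuousOn (fun σ : ℝ => u σ (X σ y)) (Iio 0) := by
        have hmap : MapsTo (fun σ : ℝ => ((σ, X σ y) : ℝ × E3)) (Iio 0) (Iio (0 : ℝ) ×ˢ (univ : Set E3)) :=
          fun σ hσ => mk_mem_prod hσ (mem_univ _)
        exact hu_cont.comp (continuous_id.prodMk hXy).continuousOn hmap
      exact h1.continuousOn.mul h2.norm
    have hint : IntegrableOn (fun σ : ℝ => slope R₀ R δ ‖X σ y‖ * ‖u σ (X σ y)‖) (Ioc s t₀) volume :=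
      ((hbc.mono ((Icc_subset_Icc hs.1 le_rfl).trans hIcc0)).integrableOn_compact isCompact_Icc).mono_set
        Ioc_subset_Icc_self
    have hnn : 0 ≤ᵐ[volume.restrict (Ioc s t₀)] fun σ : ℝ => slope R₀ R δ ‖X σ y‖ * ‖u σ (X σ y)‖ :=
      ae_of_all _ fun σ => mul_nonneg (slope_nonneg _ _ _ _) (norm_nonneg _)
    calc ENNReal.ofReal (prof R₀ R δ R)
        ≤ ENNReal.ofReal (∫ σ in s..t₀, slope R₀ R δ ‖X σ y‖ * ‖u σ (X σ y)‖) :=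
          ENNReal.ofReal_le_ofReal (hlabel y hy)
      _ = ∫⁻ σ in Ioc s t₀, F y σ := by
          rw [intervalIntegral.integral_of_le hs.2, ofReal_integral_eq_lintegral_ofReal hint hnn]
      _ = ∫⁻ σ in I, F y σ := setLIntegral_congr Ioo_ae_eq_Ioc.symm
  have hFm : AEMeasurable (Function.uncurry F) ((volume.restrict E₀).prod (volume.restrict I)) := by
    rw [Measure.prod_restrict, ← Measure.volume_eq_prod]
    have hcont : ContinuousOn (Function.uncurry F) ((univ : Set E3) ×ˢ Iio (0 : ℝ)) := by
      have hX' : Continuous fun q : E3 × ℝ => X q.2 q.1 := hXc.comp (continuous_snd.prodMk continuous_fst)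
      have h1 : Continuous fun q : E3 × ℝ => slope R₀ R δ ‖X q.2 q.1‖ :=
        (slope_continuous R₀ R δ).comp (continuous_norm.comp hX')
      have h2 : ContinuousOn (fun q : E3 × ℝ => u q.2 (X q.2 q.1)) ((univ : Set E3) ×ˢ Iio (0 : ℝ)) := by
        have hmap : MapsTo (fun q : E3 × ℝ => ((q.2, X q.2 q.1) : ℝ × E3)) ((univ : Set E3) ×ˢ Iio (0 : ℝ))
            (Iio (0 : ℝ) ×ˢ (univ : Set E3)) := fun q hq => mk_mem_prod hq.2 (mem_univ _)
        exact hu_cont.comp (continuous_snd.prodMk hX').continuousOn hmap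
      exact ENNReal.continuous_ofReal.comp_continuousOn (h1.continuousOn.mul h2.norm)
    exact (hcont.mono (prod_mono (subset_univ _) hI0)).aemeasurable (hE₀m.prod hIm)
  have hC : ∫⁻ y in E₀, ∫⁻ σ in I, F y σ = ∫⁻ σ in I, ∫⁻ y in E₀, F y σ := lintegral_lintegral_swap hFm
  set V₀ : ℝ≥0∞ := volume E₀ with hV₀def
  have hV₀fin : V₀ ≠ ⊤ :=
    ((measure_mono (hE₀T.trans hTR₀)).trans_lt (measure_ball_lt_top (μ := volume) (x := (0 : E3)) (r := R₀))).ne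
  set μR : Measure E3 := volume.restrict (ball (0 : E3) R) with hμRdef
  set MA : ℝ≥0∞ := (ENNReal.ofReal ((c : ℝ) * R ^ (1 - 2 * ρ))) ^ (1 / 2 : ℝ) with hMAdef
  set Gd : ℝ → ℝ≥0∞ := fun σ => (∫⁻ x in ball (0 : E3) R, ‖fderiv ℝ (u σ) x‖ₑ ^ (2 : ℝ)) ^ (1 / 2 : ℝ)
    with hGddef
  have hL6 : ∀ f : E3 → E3, eLpNorm f ((6 : ℝ≥0) : ℝ≥0∞) μR = (∫⁻ x, ‖f x‖ₑ ^ (6 : ℝ) ∂μR) ^ (1 / 6 : ℝ) := by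
    intro f
    rw [eLpNorm_eq_lintegral_rpow_enorm_toReal (by norm_num) ENNReal.coe_ne_top]
    simp only [ENNReal.coe_toReal, NNReal.coe_ofNat]
  have hL2 : ∀ {G : Type} [NormedAddCommGroup G] (f : E3 → G),
      eLpNorm f ((2 : ℝ≥0) : ℝ≥0∞) μR = (∫⁻ x, ‖f x‖ₑ ^ (2 : ℝ) ∂μR) ^ (1 / 2 : ℝ) := by
    intro G _ f
    rw [eLpNorm_eq_lintegral_rpow_enorm_toReal (by norm_num) ENNReal.coe_ne_top]
    simp only [ENNReal.coe_toReal, NNReal.coe_ofNat]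
  have hD : ∀ σ ∈ I, ∫⁻ y in E₀, F y σ ≤
      V₀ ^ (5 / 6 : ℝ) * ((CS : ℝ≥0∞) * ((ENNReal.ofReal R)⁻¹ * MA + Gd σ)) := by
    intro σ hσ
    have hσIcc : σ ∈ Icc t₁ t₀ := hI_Icc hσ
    have hσ0 : σ ∈ Iio (0 : ℝ) := hI0 hσ
    have hσR : σ ∈ Ioo (-(R ^ 2)) 0 := ⟨lt_of_lt_of_le hRt₁ (hs.1.trans hσ.1.le), hσ0⟩
    have hv : ContDiff ℝ 1 (u σ) := (hcl.contDiff_velocity hσ0).of_le (by norm_cast)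
    have hvc : Continuous (u σ) := hv.continuous
    set g : E3 → ℝ≥0∞ := fun x => ENNReal.ofReal (slope R₀ R δ ‖x‖ * ‖u σ x‖) with hgdef
    have hgm : Measurable g :=
      ENNReal.measurable_ofReal.comp (((slope_continuous R₀ R δ).comp continuous_norm).mul hvc.norm).measurable
    have hcov : ∫⁻ y in E₀, F y σ = ∫⁻ x in X σ '' E₀, g x := (hXcov σ hσIcc E₀ hE₀T hE₀m g hgm).symm
    obtain ⟨hAm, hAvol⟩ := hXvol σ hσIcc E₀ hE₀T hE₀m
    have hpt : ∀ x, g x ≤ (ball (0 : E3) R).indicator (fun x => ‖u σ x‖ₑ) x := by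
      intro x
      by_cases hx : x ∈ ball (0 : E3) R
      · rw [indicator_of_mem hx, hgdef]
        simp only
        rw [← ofReal_norm]
        refine ENNReal.ofReal_le_ofReal ?_
        have h1 := slope_le_one R₀ R δ ‖x‖
        have h2 := norm_nonneg (u σ x)
        nlinarith
      · rw [indicator_of_notMem hx, hgdef]
        simp only
        have hx' : R ≤ ‖x‖ := by simpa [mem_ball, dist_zero_right, not_lt] using hx
        rw [slope_eq_zero_of_ge hδ hx', zero_mul, ENNReal.ofReal_zero]
    set A' : Set E3 := ball (0 : E3) R ∩ X σ '' E₀ with hA'def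
    have h1 : ∫⁻ x in X σ '' E₀, g x ≤ ∫⁻ x in A', ‖u σ x‖ₑ := by
      calc ∫⁻ x in X σ '' E₀, g x ≤ ∫⁻ x in X σ '' E₀, (ball (0 : E3) R).indicator (fun x => ‖u σ x‖ₑ) x :=
            lintegral_mono fun x => hpt x
        _ = ∫⁻ x in A', ‖u σ x‖ₑ := by
            rw [lintegral_indicator measurableSet_ball, Measure.restrict_restrict measurableSet_ball]
    have hp65 : (6 / 5 : ℝ).HolderConjugate 6 := by rw [Real.holderConjugate_iff]; norm_num
    have h2 : ∫⁻ x in A', ‖u σ x‖ₑ ≤ (volume A') ^ (5 / 6 : ℝ) * (∫⁻ x in A', ‖u σ x‖ₑ ^ (6 : ℝ)) ^ (1 / 6 : ℝ) := by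
      have := ENNReal.lintegral_mul_le_Lp_mul_Lq (volume.restrict A') hp65 (f := fun _ => (1 : ℝ≥0∞))
        (g := fun x => ‖u σ x‖ₑ) aemeasurable_const hvc.measurable.enorm.aemeasurable
      have e1 : (fun a : E3 => ((fun _ : E3 => (1 : ℝ≥0∞)) * fun x => ‖u σ x‖ₑ) a) = fun x => ‖u σ x‖ₑ := by
        funext a; simp
      rw [e1] at this
      simp only [ENNReal.one_rpow, lintegral_const, Measure.restrict_apply_univ, one_mul] at this
      have e2 : (1 / (6 / 5 : ℝ)) = (5 / 6 : ℝ) := by norm_num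
      rw [e2] at this
      exact this
    have h3 : (volume A') ^ (5 / 6 : ℝ) ≤ V₀ ^ (5 / 6 : ℝ) :=
      ENNReal.rpow_le_rpow ((measure_mono inter_subset_right).trans hAvol.le) (by norm_num)
    have h4 : (∫⁻ x in A', ‖u σ x‖ₑ ^ (6 : ℝ)) ^ (1 / 6 : ℝ) ≤ eLpNorm (u σ) ((6 : ℝ≥0) : ℝ≥0∞) μR := by
      rw [hL6]
      exact ENNReal.rpow_le_rpow (lintegral_mono_set inter_subset_left) (by norm_num)
    have hSob := hCS 0 R hR0 (u σ) (fderiv ℝ (u σ))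
      (memSobolevDomain_one_of_contDiff (Ω := ⟨ball (0 : E3) R, isOpen_ball⟩) hv isBounded_ball)
      (HasWeakFDerivOn.of_contDiff_holds (E' := E3) (F := E3) ⟨ball (0 : E3) R, isOpen_ball⟩ volume hv)
    rw [← hμRdef] at hSob
    have h5 : eLpNorm (u σ) ((2 : ℝ≥0) : ℝ≥0∞) μR ≤ MA := by
      rw [hL2, hMAdef]
      refine ENNReal.rpow_le_rpow ?_ (by norm_num)
      have := Backward.lintegral_ball_le_of_gaugeA (u := u) hR0 (hA R hR0) hσR
      simpa only [ENNReal.rpow_two] using this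
    have h6 : eLpNorm (fderiv ℝ (u σ)) ((2 : ℝ≥0) : ℝ≥0∞) μR = Gd σ := by rw [hL2]
    calc ∫⁻ y in E₀, F y σ = ∫⁻ x in X σ '' E₀, g x := hcov
      _ ≤ ∫⁻ x in A', ‖u σ x‖ₑ := h1
      _ ≤ (volume A') ^ (5 / 6 : ℝ) * (∫⁻ x in A', ‖u σ x‖ₑ ^ (6 : ℝ)) ^ (1 / 6 : ℝ) := h2
      _ ≤ V₀ ^ (5 / 6 : ℝ) * eLpNorm (u σ) ((6 : ℝ≥0) : ℝ≥0∞) μR := mul_le_mul' h3 h4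
      _ ≤ V₀ ^ (5 / 6 : ℝ) * ((CS : ℝ≥0∞) * ((ENNReal.ofReal R)⁻¹ * eLpNorm (u σ) ((2 : ℝ≥0) : ℝ≥0∞) μR +
            eLpNorm (fderiv ℝ (u σ)) ((2 : ℝ≥0) : ℝ≥0∞) μR)) := mul_le_mul' le_rfl hSob
      _ ≤ V₀ ^ (5 / 6 : ℝ) * ((CS : ℝ≥0∞) * ((ENNReal.ofReal R)⁻¹ * MA + Gd σ)) := by
            rw [h6]; gcongr
  set τ : ℝ := t₀ - s with hτdef
  have hτ : 0 ≤ τ := by rw [hτdef]; linarith [hs.2]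
  have hvolI : volume I = ENNReal.ofReal τ := by rw [hIdef, Real.volume_Ioo]
  have hIR : I ⊆ Ioo (-(R ^ 2)) 0 := fun σ hσ => ⟨lt_of_lt_of_le hRt₁ (hs.1.trans hσ.1.le), hI0 hσ⟩
  set ME : ℝ≥0∞ := (ENNReal.ofReal ((c : ℝ) * R ^ (1 - ρ))) ^ (1 / 2 : ℝ) with hMEdef
  have hD_cont : ContinuousOn (Function.uncurry fun t x => fderiv ℝ (u t) x) (Iio (0 : ℝ) ×ˢ (univ : Set E3)) :=
    (hcl.smooth_velocity.fderiv_slice isOpen_Iio.uniqueDiffOn).continuousOn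
  have hGi : ∀ J : Set ℝ, J ⊆ Iio 0 → MeasurableSet J →
      AEMeasurable (Function.uncurry fun (σ : ℝ) (x : E3) => ‖fderiv ℝ (u σ) x‖ₑ ^ (2 : ℝ))
        ((volume.restrict J).prod (volume.restrict (ball (0 : E3) R))) := by
    intro J hJ0 hJm
    rw [Measure.prod_restrict, ← Measure.volume_eq_prod]
    have hDm : AEMeasurable (Function.uncurry fun t x => fderiv ℝ (u t) x)
        (volume.restrict (J ×ˢ ball (0 : E3) R)) :=
      (hD_cont.mono (prod_mono hJ0 (subset_univ _))).aemeasurable (hJm.prod measurableSet_ball)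
    exact hDm.enorm.pow_const _
  have hGdm : AEMeasurable Gd (volume.restrict I) := (hGi I hI0 hIm).lintegral_prod_right'.pow_const _
  have hwindow : ∫⁻ σ in I, Gd σ ^ (2 : ℝ) ≤ ENNReal.ofReal ((c : ℝ) * R ^ (1 - ρ)) := by
    have e2 : ∀ σ, Gd σ ^ (2 : ℝ) = ∫⁻ x in ball (0 : E3) R, ‖fderiv ℝ (u σ) x‖ₑ ^ (2 : ℝ) := by
      intro σ; rw [hGddef]; simp only; rw [← ENNReal.rpow_mul]; norm_num
    simp_rw [e2]
    have hpt : ∀ z : ℝ × E3, ‖fderiv ℝ (u z.1) z.2‖ₑ ^ (2 : ℝ) ≤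
        ENNReal.ofReal (frobeniusNormSq (fderiv ℝ (u z.1) z.2)) := by
      intro z
      rw [ENNReal.rpow_two, ← ofReal_norm, ← ENNReal.ofReal_pow (norm_nonneg _)]
      exact ENNReal.ofReal_le_ofReal (sq_opNorm_le_frobeniusNormSq _)
    calc ∫⁻ σ in I, ∫⁻ x in ball (0 : E3) R, ‖fderiv ℝ (u σ) x‖ₑ ^ (2 : ℝ)
        ≤ ∫⁻ σ in Ioo (-(R ^ 2)) 0, ∫⁻ x in ball (0 : E3) R, ‖fderiv ℝ (u σ) x‖ₑ ^ (2 : ℝ) :=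
          lintegral_mono_set hIR
      _ = ∫⁻ z in Ioo (-(R ^ 2)) 0 ×ˢ ball (0 : E3) R, ‖fderiv ℝ (u z.1) z.2‖ₑ ^ (2 : ℝ) := by
          rw [lintegral_lintegral (hGi _ Ioo_subset_Iio_self measurableSet_Ioo), Measure.prod_restrict,
            ← Measure.volume_eq_prod]
      _ ≤ ∫⁻ z in Ioo (-(R ^ 2)) 0 ×ˢ ball (0 : E3) R, ENNReal.ofReal (frobeniusNormSq (fderiv ℝ (u z.1) z.2)) :=
          lintegral_mono fun z => hpt z
      _ ≤ ENNReal.ofReal ((c : ℝ) * R ^ (1 - ρ)) :=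
          SwirlfreeLedger.setLIntegral_window_frobenius_fderiv_le hH hcl hE hR0
  have hGd_int : ∫⁻ σ in I, Gd σ ≤ (ENNReal.ofReal τ) ^ (1 / 2 : ℝ) * ME := by
    have hH2 := ENNReal.lintegral_mul_le_Lp_mul_Lq (volume.restrict I) Real.HolderConjugate.two_two
      (f := fun _ => (1 : ℝ≥0∞)) (g := Gd) aemeasurable_const hGdm
    have e1 : (fun a : ℝ => ((fun _ : ℝ => (1 : ℝ≥0∞)) * Gd) a) = Gd := by funext a; simp
    rw [e1] at hH2
    simp only [ENNReal.one_rpow, lintegral_const, Measure.restrict_apply_univ, one_mul] at hH2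
    rw [hvolI] at hH2
    refine hH2.trans (mul_le_mul' le_rfl ?_)
    rw [hMEdef]
    exact ENNReal.rpow_le_rpow hwindow (by norm_num)
  have hEtot : ∫⁻ σ in I, ∫⁻ y in E₀, F y σ ≤
      V₀ ^ (5 / 6 : ℝ) * ((CS : ℝ≥0∞) * ((ENNReal.ofReal R)⁻¹ * MA * ENNReal.ofReal τ +
        (ENNReal.ofReal τ) ^ (1 / 2 : ℝ) * ME)) := by
    calc ∫⁻ σ in I, ∫⁻ y in E₀, F y σ
        ≤ ∫⁻ σ in I, V₀ ^ (5 / 6 : ℝ) * ((CS : ℝ≥0∞) * ((ENNReal.ofReal R)⁻¹ * MA + Gd σ)) :=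
          lintegral_mono_ae ((ae_restrict_iff' hIm).2 (ae_of_all _ fun σ hσ => hD σ hσ))
      _ = V₀ ^ (5 / 6 : ℝ) * ((CS : ℝ≥0∞) * ((ENNReal.ofReal R)⁻¹ * MA * volume I + ∫⁻ σ in I, Gd σ)) := by
          rw [lintegral_const_mul' _ _ (ENNReal.rpow_ne_top_of_nonneg (by norm_num) hV₀fin),
            lintegral_const_mul' _ _ ENNReal.coe_ne_top, lintegral_add_left measurable_const, setLIntegral_const]
      _ ≤ V₀ ^ (5 / 6 : ℝ) * ((CS : ℝ≥0∞) * ((ENNReal.ofReal R)⁻¹ * MA * ENNReal.ofReal τ +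
            (ENNReal.ofReal τ) ^ (1 / 2 : ℝ) * ME)) := by
          rw [hvolI]; gcongr
  have hmain : ENNReal.ofReal (prof R₀ R δ R) * V₀ ≤
      V₀ ^ (5 / 6 : ℝ) * ((CS : ℝ≥0∞) * ((ENNReal.ofReal R)⁻¹ * MA * ENNReal.ofReal τ +
        (ENNReal.ofReal τ) ^ (1 / 2 : ℝ) * ME)) := hB.trans (hC.le.trans hEtot)
  have hprofR : (R - R₀) / 2 ≤ prof R₀ R δ R := prof_R_ge hR₀ hR hδdef
  have hprof0 : 0 ≤ prof R₀ R δ R := le_trans (by linarith) hprofR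
  have hc0 : 0 ≤ (c : ℝ) := c.coe_nonneg
  have hcA : 0 ≤ (c : ℝ) * R ^ (1 - 2 * ρ) := mul_nonneg hc0 (Real.rpow_nonneg hR0.le _)
  have hcE : 0 ≤ (c : ℝ) * R ^ (1 - ρ) := mul_nonneg hc0 (Real.rpow_nonneg hR0.le _)
  set mA : ℝ := ((c : ℝ) * R ^ (1 - 2 * ρ)) ^ (1 / 2 : ℝ) with hmAdef
  set mE : ℝ := ((c : ℝ) * R ^ (1 - ρ)) ^ (1 / 2 : ℝ) with hmEdef
  set τh : ℝ := τ ^ (1 / 2 : ℝ) with hτhdef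
  have hmA0 : 0 ≤ mA := Real.rpow_nonneg hcA _
  have hmE0 : 0 ≤ mE := Real.rpow_nonneg hcE _
  have hτh0 : 0 ≤ τh := Real.rpow_nonneg hτ _
  have eMA : ENNReal.ofReal mA = MA := by rw [hMAdef, hmAdef, ENNReal.ofReal_rpow_of_nonneg hcA (by norm_num)]
  have eME : ENNReal.ofReal mE = ME := by rw [hMEdef, hmEdef, ENNReal.ofReal_rpow_of_nonneg hcE (by norm_num)]
  have eτh : ENNReal.ofReal τh = (ENNReal.ofReal τ) ^ (1 / 2 : ℝ) := by
    rw [hτhdef, ENNReal.ofReal_rpow_of_nonneg hτ (by norm_num)]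
  set rhs : ℝ := (CS : ℝ) * (R⁻¹ * mA * τ + τh * mE) with hrhsdef
  have hrhs0 : 0 ≤ rhs := by rw [hrhsdef]; positivity
  have erhs : ENNReal.ofReal rhs =
      (CS : ℝ≥0∞) * ((ENNReal.ofReal R)⁻¹ * MA * ENNReal.ofReal τ + (ENNReal.ofReal τ) ^ (1 / 2 : ℝ) * ME) := by
    rw [hrhsdef, ENNReal.ofReal_mul (NNReal.coe_nonneg CS), ENNReal.ofReal_coe_nnreal,
      ENNReal.ofReal_add (by positivity) (by positivity), ENNReal.ofReal_mul (by positivity),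
      ENNReal.ofReal_mul (inv_nonneg.2 hR0.le), ENNReal.ofReal_inv_of_pos hR0, ENNReal.ofReal_mul hτh0, eMA, eME, eτh]
  have hform : R⁻¹ * mA * τ + τh * mE =
      Real.sqrt (c : ℝ) * (Real.sqrt τ * R ^ ((1 - ρ) / 2) + τ * R ^ (-(1 / 2 + ρ))) := by
    have hA' : mA = Real.sqrt (c : ℝ) * R ^ ((1 - 2 * ρ) / 2) := by
      rw [hmAdef, Real.mul_rpow hc0 (Real.rpow_nonneg hR0.le _), ← Real.rpow_mul hR0.le, ← Real.sqrt_eq_rpow]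
      congr 1; ring_nf
    have hE' : mE = Real.sqrt (c : ℝ) * R ^ ((1 - ρ) / 2) := by
      rw [hmEdef, Real.mul_rpow hc0 (Real.rpow_nonneg hR0.le _), ← Real.rpow_mul hR0.le, ← Real.sqrt_eq_rpow]
      congr 1; ring_nf
    have hτ' : τh = Real.sqrt τ := by rw [hτhdef, Real.sqrt_eq_rpow]
    have hpow : R⁻¹ * R ^ ((1 - 2 * ρ) / 2) = R ^ (-(1 / 2 + ρ)) := by
      rw [← Real.rpow_neg_one, ← Real.rpow_add hR0]
      congr 1; ring
    rw [hA', hE', hτ']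
    calc R⁻¹ * (Real.sqrt (c : ℝ) * R ^ ((1 - 2 * ρ) / 2)) * τ + Real.sqrt τ * (Real.sqrt (c : ℝ) * R ^ ((1 - ρ) / 2))
        = Real.sqrt (c : ℝ) * (Real.sqrt τ * R ^ ((1 - ρ) / 2) + τ * (R⁻¹ * R ^ ((1 - 2 * ρ) / 2))) := by ring
      _ = Real.sqrt (c : ℝ) * (Real.sqrt τ * R ^ ((1 - ρ) / 2) + τ * R ^ (-(1 / 2 + ρ))) := by rw [hpow]
  have htarget0 : 0 ≤ Real.sqrt (c : ℝ) * (Real.sqrt τ * R ^ ((1 - ρ) / 2) + τ * R ^ (-(1 / 2 + ρ))) := by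
    have := Real.rpow_nonneg hR0.le ((1 - ρ) / 2)
    have := Real.rpow_nonneg hR0.le (-(1 / 2 + ρ))
    positivity
  by_cases hV0 : V₀ = 0
  · -- trivial case
    have : V₀.toReal ^ (1 / 6 : ℝ) = 0 := by rw [hV0, ENNReal.toReal_zero, Real.zero_rpow (by norm_num)]
    rw [this, zero_mul]
    calc (0 : ℝ) ≤ (2 * (CS : ℝ) + 1) * (Real.sqrt (c : ℝ) * (Real.sqrt τ * R ^ ((1 - ρ) / 2) + τ * R ^ (-(1 / 2 + ρ)))) :=
          mul_nonneg (by positivity) htarget0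
      _ = _ := by ring
  · -- divide by `V₀ ^ (5/6)` and pass to reals
    have hsplit : V₀ = V₀ ^ (5 / 6 : ℝ) * V₀ ^ (1 / 6 : ℝ) := by
      rw [← ENNReal.rpow_add _ _ hV0 hV₀fin]; norm_num
    have h56_0 : V₀ ^ (5 / 6 : ℝ) ≠ 0 := by
      intro h; exact hV0 ((ENNReal.rpow_eq_zero_iff_of_pos (by norm_num)).1 h)
    have h56_top : V₀ ^ (5 / 6 : ℝ) ≠ ⊤ := ENNReal.rpow_ne_top_of_nonneg (by norm_num) hV₀fin
    have hmain' : ENNReal.ofReal (prof R₀ R δ R) * V₀ ^ (1 / 6 : ℝ) ≤ ENNReal.ofReal rhs := by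
      rw [erhs]
      refine (ENNReal.mul_le_mul_iff_right h56_0 h56_top).1 ?_
      calc V₀ ^ (5 / 6 : ℝ) * (ENNReal.ofReal (prof R₀ R δ R) * V₀ ^ (1 / 6 : ℝ))
          = ENNReal.ofReal (prof R₀ R δ R) * V₀ := by
            conv_rhs => rw [hsplit]
            ring
        _ ≤ _ := hmain
    have hreal : prof R₀ R δ R * V₀.toReal ^ (1 / 6 : ℝ) ≤ rhs := by
      have e : ENNReal.ofReal (prof R₀ R δ R) * V₀ ^ (1 / 6 : ℝ) =
          ENNReal.ofReal (prof R₀ R δ R * V₀.toReal ^ (1 / 6 : ℝ)) := by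
        rw [ENNReal.ofReal_mul hprof0, ← ENNReal.ofReal_rpow_of_nonneg (ENNReal.toReal_nonneg (a := V₀)) (by norm_num),
          ENNReal.ofReal_toReal hV₀fin]
      rw [e] at hmain'
      exact (ENNReal.ofReal_le_ofReal_iff hrhs0).1 hmain'
    have hV16 : 0 ≤ V₀.toReal ^ (1 / 6 : ℝ) := Real.rpow_nonneg ENNReal.toReal_nonneg _
    rw [hrhsdef, hform] at hreal
    calc V₀.toReal ^ (1 / 6 : ℝ) * (R - R₀) ≤ V₀.toReal ^ (1 / 6 : ℝ) * (2 * prof R₀ R δ R) :=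
          mul_le_mul_of_nonneg_left (by linarith) hV16
      _ = 2 * (prof R₀ R δ R * V₀.toReal ^ (1 / 6 : ℝ)) := by ring
      _ ≤ 2 * ((CS : ℝ) * (Real.sqrt (c : ℝ) * (Real.sqrt τ * R ^ ((1 - ρ) / 2) + τ * R ^ (-(1 / 2 + ρ))))) :=
          by linarith
      _ = (2 * (CS : ℝ)) * Real.sqrt (c : ℝ) * (Real.sqrt τ * R ^ ((1 - ρ) / 2) + τ * R ^ (-(1 / 2 + ρ))) := by ring
      _ ≤ (2 * (CS : ℝ) + 1) * Real.sqrt (c : ℝ) * (Real.sqrt τ * R ^ ((1 - ρ) / 2) + τ * R ^ (-(1 / 2 + ρ))) := by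
          rw [mul_assoc, mul_assoc (2 * (CS : ℝ) + 1)]
          exact mul_le_mul_of_nonneg_right (by linarith) htarget0

end K3
end K3Proof

/-- K3 FILLED (REV3, in-file, sorry-free): `stub_farVolume` := `K3.farVolumeBound_holds`. -/
theorem stub_farVolume : Sig.stub_farVolume :=
  K3.farVolumeBound_holds

/-! ## K4 PROVED (REV4): the ANCHOR RACE, sorry-free — `K4.anchorRace` from eight proved helpers (pigeonhole_sq_weights, floor_dichotomy,
exponent_race, memberShellFloor, farLabelVolume, windowBudget, raceSeries, hostingShell) and an assembly running the race as the POINTWISE inequality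
`1 ≤ Σ_{j<J} F_j(s)/e_j` on the window `(t₀−A², t₀)`, integrated in time (`lintegral_finsetSum'`); details in the line card. -/

section K4Proof

namespace K4

/-! ### K4 helper 1: pigeonhole with square weights -/

theorem sum_range_inv_succ_sq_le_two (J : ℕ) : ∑ j ∈ Finset.range J, ((j + 1 : ℝ) ^ 2)⁻¹ ≤ 2 := by
  have h := sum_Ioo_inv_sq_le (α := ℝ) 0 (J + 1)
  have e : ∑ j ∈ Finset.range J, ((j + 1 : ℝ) ^ 2)⁻¹ = ∑ i ∈ Finset.Ioo 0 (J + 1), ((i : ℝ) ^ 2)⁻¹ := by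
    have hI : Finset.Ioo 0 (J + 1) = Finset.image (fun j => j + 1) (Finset.range J) := by
      ext i
      simp only [Finset.mem_Ioo, Finset.mem_image, Finset.mem_range]
      constructor
      · rintro ⟨h1, h2⟩; exact ⟨i - 1, by omega, by omega⟩
      · rintro ⟨j, hj, rfl⟩; exact ⟨by omega, by omega⟩
    rw [hI, Finset.sum_image (fun a _ b _ h => by simpa using h)]
    simp
  rw [e]
  simpa using h

/-- **Pigeonhole with square weights**: if finitely many reals `h j` (`j < J`) sum to `H ≠ 0`, some `|h j| ≥ |H| / (4 (j+1)²)`. -/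
theorem pigeonhole_sq_weights (h : ℕ → ℝ) {H : ℝ} (hH : H ≠ 0) {J : ℕ}
    (hsum : ∑ j ∈ Finset.range J, h j = H) : ∃ j, j < J ∧ |H| / (4 * (j + 1 : ℝ) ^ 2) ≤ |h j| := by
  by_contra hcon
  push Not at hcon
  have hlt : ∀ j ∈ Finset.range J, |h j| < |H| / (4 * (j + 1 : ℝ) ^ 2) := fun j hj =>
    hcon j (Finset.mem_range.1 hj)
  have hHpos : 0 < |H| := abs_pos.2 hH
  have h1 : |H| ≤ ∑ j ∈ Finset.range J, |h j| := by
    rw [← hsum]; exact Finset.abs_sum_le_sum_abs _ _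
  have h2 : ∑ j ∈ Finset.range J, |h j| ≤ ∑ j ∈ Finset.range J, |H| / (4 * (j + 1 : ℝ) ^ 2) :=
    Finset.sum_le_sum fun j hj => (hlt j hj).le
  have h3 : ∑ j ∈ Finset.range J, |H| / (4 * (j + 1 : ℝ) ^ 2) = |H| / 4 * ∑ j ∈ Finset.range J, ((j + 1 : ℝ) ^ 2)⁻¹ := by
    rw [Finset.mul_sum]
    refine Finset.sum_congr rfl fun j _ => ?_
    field_simp
  have h4 := sum_range_inv_succ_sq_le_two J
  have : |H| ≤ |H| / 4 * 2 := by
    calc |H| ≤ _ := h1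
      _ ≤ _ := h2
      _ = _ := h3
      _ ≤ |H| / 4 * 2 := mul_le_mul_of_nonneg_left h4 (by positivity)
  linarith

/-! ### K4 helper 2: the floor dichotomy (pure algebra of the shell helicity floor + the `A`-gauge) -/

/-- **Floor dichotomy**: if `η ≤ K (G² + m G)` with `η, K > 0`, `m ≥ 0`, `G ≥ 0` (K2's floor after `‖curl v‖ ≤ √2‖∇v‖`, with `m = ‖v‖_{L²}/R`),
then `G² ≥ min (η/(2K)) (η²/(4 K² m²))` — read with the convention that the second entry is only used when `m > 0`. -/
theorem floor_dichotomy {η K m G : ℝ} (hη : 0 < η) (hK : 0 < K) (hm : 0 ≤ m) (hG : 0 ≤ G)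
    (h : η ≤ K * (G ^ 2 + m * G)) :
    η / (2 * K) ≤ G ^ 2 ∨ (0 < m ∧ η ^ 2 / (4 * K ^ 2 * m ^ 2) ≤ G ^ 2) := by
  rcases le_or_gt m G with hmG | hmG
  · -- `m ≤ G`: `η ≤ K (G² + G²) = 2 K G²`
    left
    rw [div_le_iff₀ (by positivity)]
    have h1 : m * G ≤ G ^ 2 := by nlinarith
    nlinarith [mul_le_mul_of_nonneg_left h1 hK.le]
  · -- `G < m`: `η ≤ K (m G + m G) = 2 K m G`, so `η² ≤ 4 K² m² G²`
    right
    have hm0 : 0 < m := lt_of_le_of_lt hG hmG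
    refine ⟨hm0, ?_⟩
    rw [div_le_iff₀ (by positivity)]
    have h1 : η ≤ 2 * K * m * G := by nlinarith
    have h2 : 0 ≤ 2 * K * m * G := by positivity
    nlinarith [mul_le_mul h1 h1 hη.le h2]

/-! ### K4 helper 3: the exponent race (every `ρ > 0`) -/

/-- **Exponent race**: for `ρ > 0` and any constants, `K₁ A^{1−ρ} + K₂ A^{2−2ρ} + K₃ A^{2−5ρ} < A²` for all large `A`. -/
theorem exponent_race {ρ : ℝ} (hρ : 0 < ρ) (K₁ K₂ K₃ : ℝ) :
    ∃ A₀ : ℝ, 1 ≤ A₀ ∧ ∀ A : ℝ, A₀ ≤ A →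
      K₁ * A ^ (1 - ρ) + K₂ * A ^ (2 - 2 * ρ) + K₃ * A ^ (2 - 5 * ρ) < A ^ 2 := by
  have hf : Tendsto (fun A : ℝ => K₁ * A ^ (-(1 + ρ)) + K₂ * A ^ (-(2 * ρ)) + K₃ * A ^ (-(5 * ρ))) atTop (𝓝 0) := by
    have h1 := (tendsto_rpow_neg_atTop (y := 1 + ρ) (by linarith)).const_mul K₁
    have h2 := (tendsto_rpow_neg_atTop (y := 2 * ρ) (by linarith)).const_mul K₂
    have h3 := (tendsto_rpow_neg_atTop (y := 5 * ρ) (by linarith)).const_mul K₃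
    simpa using (h1.add h2).add h3
  have hev : ∀ᶠ A : ℝ in atTop, K₁ * A ^ (-(1 + ρ)) + K₂ * A ^ (-(2 * ρ)) + K₃ * A ^ (-(5 * ρ)) < 1 :=
    hf (Iio_mem_nhds zero_lt_one)
  obtain ⟨A₁, hA₁⟩ := (hev.and (eventually_ge_atTop 1)).exists_forall_of_atTop
  refine ⟨max A₁ 1, le_max_right _ _, fun A hA => ?_⟩
  have hA1 : 1 ≤ A := (le_max_right _ _).trans hA
  have hA0 : 0 < A := lt_of_lt_of_le zero_lt_one hA1
  obtain ⟨hlt, -⟩ := hA₁ A ((le_max_left _ _).trans hA)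
  have hA2 : 0 < A ^ 2 := by positivity
  have e1 : A ^ (1 - ρ) = A ^ (-(1 + ρ)) * A ^ 2 := by
    rw [← Real.rpow_natCast A 2, ← Real.rpow_add hA0]; norm_num; ring_nf
  have e2 : A ^ (2 - 2 * ρ) = A ^ (-(2 * ρ)) * A ^ 2 := by
    rw [← Real.rpow_natCast A 2, ← Real.rpow_add hA0]; norm_num; ring_nf
  have e3 : A ^ (2 - 5 * ρ) = A ^ (-(5 * ρ)) * A ^ 2 := by
    rw [← Real.rpow_natCast A 2, ← Real.rpow_add hA0]; norm_num; ring_nf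
  rw [e1, e2, e3]
  have := mul_lt_mul_of_pos_right hlt hA2
  linarith [this]


/-! ### K4 helper 4: the MEMBER SHELL FLOOR (K2 + `‖curl v‖² ≤ 16‖∇v‖_F²` + the `A`-gauge + the floor dichotomy) -/

open Literature.Analysis Literature.Analysis.FluidPDE
open Summit.NavierStokesRegularity.NavierStokesRegularity.Theorems.PowerGaugeEulerLiouville

/-- **Member shell floor**: for a member of the class (any `ρ > 0`, classical), a ball `B_R`, a slice `s ∈ (−R², 0)` and a weight `|w| ≤ 1` vanishing
off a measurable set `T` of finite volume `≤ V`: if the weighted helicity `|∫_{B_R} w⟪u(s), curl u(s)⟫| ≥ η > 0`, then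
`∫_{B_R} ‖∇u(s)‖_F² ≥ min (η/(C₁ V^{1/3})) (η² R^{1+2ρ}/(C₁ c V^{2/3}))` (the bound is ANTITONE in `V`, so any upper bound `V` for
`vol T` may be fed — e.g. the far-label volume bound; Lean's `x/0 = 0` makes the degenerate case `c = 0` vacuous-true). -/
theorem memberShellFloor (hK2 : ShellHelicityFloor) :
    ∃ C₁ : ℝ, 0 < C₁ ∧ ∀ ρ : ℝ, 0 < ρ →
      ∀ (u : ℝ → E3 → E3) (p : ℝ → E3 → ℝ) (H : ℝ → E3 → E3 →L[ℝ] E3) (c : ℝ≥0), InClass ρ u p H c →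
        IsClassicalEulerSolutionOn (Set.Iio 0) 0 u p →
          ∀ R : ℝ, 0 < R → ∀ s ∈ Set.Ioo (-(R ^ 2)) 0, ∀ w : E3 → ℝ, Measurable w → (∀ x : E3, |w x| ≤ 1) →
            ∀ T : Set E3, MeasurableSet T → volume T < ⊤ → (∀ x : E3, x ∉ T → w x = 0) →
              ∀ V : ℝ, (volume T).toReal ≤ V →
              ∀ η : ℝ, 0 < η → η ≤ |∫ x in Metric.ball (0 : E3) R, w x * inner ℝ (u s x) (curl (u s) x)| →
                min (η / (C₁ * V ^ (1 / 3 : ℝ)))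
                    (η ^ 2 * R ^ (1 + 2 * ρ) / (C₁ * (c : ℝ) * V ^ (2 / 3 : ℝ))) ≤
                  ∫ x in Metric.ball (0 : E3) R, frobeniusNormSq (fderiv ℝ (u s) x) := by
  obtain ⟨C, hC, hK⟩ := hK2
  refine ⟨64 * (C + 1) ^ 2, by positivity, ?_⟩
  intro ρ hρ u p H c hcls hcl R hR s hs w hwm hw1 T hT hTfin hwT V hTV η hη hηle
  obtain ⟨_, hH, hgauge⟩ := hcls
  have hA : ENNReal.ofReal (R ^ (2 * ρ)) * cknA R (0 : ℝ × E3) u ≤ (c : ℝ≥0∞) :=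
    le_trans (le_trans le_self_add le_self_add) (hgauge R hR)
  have hs0 : s ∈ Set.Iio (0 : ℝ) := hs.2
  have hv : ContDiff ℝ 1 (u s) := (hcl.contDiff_velocity hs0).of_le (by norm_cast)
  have hvc : Continuous (u s) := hv.continuous
  have hDc : Continuous (fderiv ℝ (u s)) := hv.continuous_fderiv one_ne_zero
  have hcurlc : Continuous (curl (u s)) := by
    rw [curl_eq_curlCLM_comp]; exact curlCLM.continuous.comp hDc
  have hFc : Continuous fun x => frobeniusNormSq (fderiv ℝ (u s) x) := continuous_frobeniusNormSq_fderiv hv one_ne_zero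
  set B : Set E3 := Metric.ball (0 : E3) R with hBdef
  set V₀ : ℝ := (volume T).toReal with hV₀def
  have hV₀0 : 0 ≤ V₀ := ENNReal.toReal_nonneg
  have hV0 : 0 ≤ V := hV₀0.trans hTV
  set F : ℝ := ∫ x in B, frobeniusNormSq (fderiv ℝ (u s) x) with hFdef
  have hF0 : 0 ≤ F := integral_nonneg fun x => frobeniusNormSq_nonneg _
  have hint : ∀ {g : E3 → ℝ}, Continuous g → IntegrableOn g B volume := fun hg =>
    (hg.continuousOn.integrableOn_compact (isCompact_closedBall (0 : E3) R)).mono_set ball_subset_closedBall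
  have hD_le : ∫ x in B, ‖fderiv ℝ (u s) x‖ ^ 2 ≤ F :=
    integral_mono (hint (hDc.norm.pow 2)) (hint hFc) fun x => sq_opNorm_le_frobeniusNormSq _
  have hcurl_le : ∫ x in B, ‖curl (u s) x‖ ^ 2 ≤ 16 * F := by
    calc ∫ x in B, ‖curl (u s) x‖ ^ 2 ≤ ∫ x in B, 16 * frobeniusNormSq (fderiv ℝ (u s) x) :=
          integral_mono (hint (hcurlc.norm.pow 2)) ((hint hFc).const_mul 16) fun x =>
            SwirlfreeLedger.sq_norm_curl_le_frobeniusNormSq _ _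
      _ = 16 * F := integral_const_mul _ _
  have hM_le : ∫ x in B, ‖u s x‖ ^ 2 ≤ (c : ℝ) * R ^ (1 - 2 * ρ) := by
    have h1 := Backward.lintegral_ball_le_of_gaugeA (u := u) hR hA hs
    have h2 : ∫⁻ x in B, ‖u s x‖ₑ ^ 2 = ENNReal.ofReal (∫ x in B, ‖u s x‖ ^ 2) := by
      rw [ofReal_integral_eq_lintegral_ofReal (hint (g := fun x => ‖u s x‖ ^ 2) (hvc.norm.pow 2))
          (ae_of_all _ fun x => sq_nonneg _)]
      refine lintegral_congr fun x => ?_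
      rw [← ofReal_norm, ENNReal.ofReal_pow (norm_nonneg _)]
    rw [← hBdef, h2] at h1
    exact (ENNReal.ofReal_le_ofReal_iff (mul_nonneg c.coe_nonneg (Real.rpow_nonneg hR.le _))).1 h1
  set G : ℝ := Real.sqrt F with hGdef
  have hG0 : 0 ≤ G := Real.sqrt_nonneg _
  have hGsq : G ^ 2 = F := Real.sq_sqrt hF0
  have hGD : Real.sqrt (∫ x in B, ‖fderiv ℝ (u s) x‖ ^ 2) ≤ G := Real.sqrt_le_sqrt hD_le
  have hGc : Real.sqrt (∫ x in B, ‖curl (u s) x‖ ^ 2) ≤ 4 * G := by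
    calc Real.sqrt (∫ x in B, ‖curl (u s) x‖ ^ 2) ≤ Real.sqrt (16 * F) := Real.sqrt_le_sqrt hcurl_le
      _ = 4 * G := by
          rw [Real.sqrt_mul (by norm_num), show (16 : ℝ) = 4 ^ 2 by norm_num, Real.sqrt_sq (by norm_num)]
  set M : ℝ := Real.sqrt (∫ x in B, ‖u s x‖ ^ 2) with hMdef
  have hM0 : 0 ≤ M := Real.sqrt_nonneg _
  have hMsq : M ^ 2 ≤ (c : ℝ) * R ^ (1 - 2 * ρ) := by
    rw [hMdef, Real.sq_sqrt (integral_nonneg fun x => by positivity)]; exact hM_le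
  have hK2' := hK R hR (u s) hv w hwm hw1 T hT hTfin hwT
  rw [← hBdef, ← hV₀def, ← hMdef] at hK2'
  have hRinvM : 0 ≤ R⁻¹ * M := mul_nonneg (inv_nonneg.2 hR.le) hM0
  have hfac0 : 0 ≤ (Real.sqrt (∫ x in B, ‖fderiv ℝ (u s) x‖ ^ 2) + R⁻¹ * M) *
      Real.sqrt (∫ x in B, ‖curl (u s) x‖ ^ 2) :=
    mul_nonneg (add_nonneg (Real.sqrt_nonneg _) hRinvM) (Real.sqrt_nonneg _)
  by_cases hVz : V₀ = 0
  · -- `vol T = 0`: K2 gives `|∫…| ≤ 0`, contradicting `η > 0`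
    exfalso
    have : |∫ x in B, w x * inner ℝ (u s x) (curl (u s) x)| ≤ 0 := by
      calc _ ≤ _ := hK2'
        _ = 0 := by rw [hVz, Real.zero_rpow (by norm_num)]; ring
    linarith [abs_nonneg (∫ x in B, w x * inner ℝ (u s x) (curl (u s) x))]
  have hV₀pos : 0 < V₀ := lt_of_le_of_ne hV₀0 (Ne.symm hVz)
  have hVpos : 0 < V := lt_of_lt_of_le hV₀pos hTV
  have hV13 : 0 < V ^ (1 / 3 : ℝ) := Real.rpow_pos_of_pos hVpos _
  have hV13le : V₀ ^ (1 / 3 : ℝ) ≤ V ^ (1 / 3 : ℝ) := Real.rpow_le_rpow hV₀0 hTV (by norm_num)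
  set K : ℝ := 4 * C * V ^ (1 / 3 : ℝ) with hKdef
  have hKpos : 0 < K := by positivity
  have hmain : η ≤ K * (G ^ 2 + M / R * G) := by
    calc η ≤ |∫ x in B, w x * inner ℝ (u s x) (curl (u s) x)| := hηle
      _ ≤ C * V₀ ^ (1 / 3 : ℝ) *
            (Real.sqrt (∫ x in B, ‖fderiv ℝ (u s) x‖ ^ 2) + R⁻¹ * M) * Real.sqrt (∫ x in B, ‖curl (u s) x‖ ^ 2) := hK2'
      _ ≤ C * V ^ (1 / 3 : ℝ) *
            (Real.sqrt (∫ x in B, ‖fderiv ℝ (u s) x‖ ^ 2) + R⁻¹ * M) * Real.sqrt (∫ x in B, ‖curl (u s) x‖ ^ 2) := by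
          rw [mul_assoc, mul_assoc, mul_assoc, mul_assoc]
          exact mul_le_mul_of_nonneg_left (mul_le_mul_of_nonneg_right hV13le hfac0) hC.le
      _ ≤ C * V ^ (1 / 3 : ℝ) * (G + R⁻¹ * M) * (4 * G) := by
          have h0 : 0 ≤ C * V ^ (1 / 3 : ℝ) := by positivity
          have h1 : 0 ≤ Real.sqrt (∫ x in B, ‖fderiv ℝ (u s) x‖ ^ 2) + R⁻¹ * M :=
            add_nonneg (Real.sqrt_nonneg _) hRinvM
          have h2 : Real.sqrt (∫ x in B, ‖fderiv ℝ (u s) x‖ ^ 2) + R⁻¹ * M ≤ G + R⁻¹ * M := by linarith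
          exact mul_le_mul (mul_le_mul_of_nonneg_left h2 h0) hGc (Real.sqrt_nonneg _)
            (mul_nonneg h0 (le_trans h1 h2))
      _ = K * (G ^ 2 + M / R * G) := by rw [hKdef]; ring
  rcases floor_dichotomy hη hKpos (div_nonneg hM0 hR.le) hG0 hmain with h1 | ⟨hmpos, h2⟩
  · -- first branch: `η/(2K) ≤ F`
    refine min_le_of_left_le (le_trans ?_ (h1.trans_eq hGsq))
    rw [hKdef]
    apply div_le_div_of_nonneg_left hη.le (by positivity)
    nlinarith [hV13, hC]
  · -- second branch: `M > 0`, so `c > 0`, and `η²/(4K²(M/R)²) ≤ F`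
    have hMpos : 0 < M := by
      by_contra h
      push Not at h
      have hM00 : M = 0 := le_antisymm h hM0
      rw [hM00, zero_div] at hmpos
      exact lt_irrefl _ hmpos
    have hcpos : 0 < (c : ℝ) := by
      by_contra h
      push Not at h
      have hc0 : (c : ℝ) = 0 := le_antisymm h c.coe_nonneg
      rw [hc0, zero_mul] at hMsq
      nlinarith [hMpos]
    have hV23 : (V ^ (1 / 3 : ℝ)) ^ 2 = V ^ (2 / 3 : ℝ) := by
      rw [← Real.rpow_natCast, ← Real.rpow_mul hV0]; norm_num
    have hV23pos : 0 < V ^ (2 / 3 : ℝ) := Real.rpow_pos_of_pos hVpos _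
    have hR2 : R ^ (1 + 2 * ρ) * R ^ (1 - 2 * ρ) = R ^ 2 := by
      rw [← Real.rpow_add hR, show (1 + 2 * ρ) + (1 - 2 * ρ) = (2 : ℝ) by ring, Real.rpow_two]
    have hRpow : 0 < R ^ (1 + 2 * ρ) := Real.rpow_pos_of_pos hR _
    have hkey : 4 * K ^ 2 * (M / R) ^ 2 * R ^ (1 + 2 * ρ) ≤ 64 * (C + 1) ^ 2 * (c : ℝ) * V ^ (2 / 3 : ℝ) := by
      calc 4 * K ^ 2 * (M / R) ^ 2 * R ^ (1 + 2 * ρ)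
          = 64 * C ^ 2 * V ^ (2 / 3 : ℝ) * M ^ 2 * (R ^ (1 + 2 * ρ) / R ^ 2) := by
            rw [hKdef, div_pow, ← hV23]; ring
        _ ≤ 64 * C ^ 2 * V ^ (2 / 3 : ℝ) * ((c : ℝ) * R ^ (1 - 2 * ρ)) * (R ^ (1 + 2 * ρ) / R ^ 2) := by
            gcongr
        _ = 64 * C ^ 2 * (c : ℝ) * V ^ (2 / 3 : ℝ) * ((R ^ (1 + 2 * ρ) * R ^ (1 - 2 * ρ)) / R ^ 2) := by ring
        _ = 64 * C ^ 2 * (c : ℝ) * V ^ (2 / 3 : ℝ) := by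
            rw [hR2, div_self (pow_ne_zero 2 hR.ne'), mul_one]
        _ ≤ 64 * (C + 1) ^ 2 * (c : ℝ) * V ^ (2 / 3 : ℝ) := by
            have hC1 : C ^ 2 ≤ (C + 1) ^ 2 := pow_le_pow_left₀ hC.le (by linarith) 2
            exact mul_le_mul_of_nonneg_right (mul_le_mul_of_nonneg_right
              (mul_le_mul_of_nonneg_left hC1 (by norm_num)) c.coe_nonneg) hV23pos.le
    refine min_le_of_right_le ?_
    have hden : 0 < 4 * K ^ 2 * (M / R) ^ 2 * R ^ (1 + 2 * ρ) :=
      mul_pos (mul_pos (mul_pos (by norm_num) (pow_pos hKpos 2)) (pow_pos hmpos 2)) hRpow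
    have hnum : 0 ≤ η ^ 2 * R ^ (1 + 2 * ρ) := mul_nonneg (sq_nonneg _) hRpow.le
    calc η ^ 2 * R ^ (1 + 2 * ρ) / (64 * (C + 1) ^ 2 * (c : ℝ) * V ^ (2 / 3 : ℝ))
        ≤ η ^ 2 * R ^ (1 + 2 * ρ) / (4 * K ^ 2 * (M / R) ^ 2 * R ^ (1 + 2 * ρ)) :=
          div_le_div_of_nonneg_left hnum hden hkey
      _ = η ^ 2 / (4 * K ^ 2 * (M / R) ^ 2) := by rw [mul_div_mul_right _ _ hRpow.ne']
      _ ≤ G ^ 2 := h2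
      _ = F := hGsq

/-! ### K4 helper 5: the FAR-LABEL VOLUME bound (K3 packaged for the race: window length `≤ A²`, scale `R ≥ max (2R₀) A`, `A ≥ 1`) -/

/-- **Far-label volume**: along an anchor flow of a label set `T ⊆ B(0,R₀)` on a window `[t₁,t₀]` of length `≤ A²` (`A ≥ 1`), at every time `s` the
labels sent beyond radius `R ≥ max (2R₀) A` (with `−R² < t₁`) form a measurable set of volume `≤ (C₂ c A² R^{−(1+ρ)})³` (cubed form: its
`1/3` and `2/3` powers, which the member shell floor consumes, are then polynomial). -/
theorem farLabelVolume (hK3 : FarVolumeBound) :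
    ∃ C₂ : ℝ, 0 < C₂ ∧ ∀ ρ : ℝ, 0 < ρ →
      ∀ (u : ℝ → E3 → E3) (p : ℝ → E3 → ℝ) (H : ℝ → E3 → E3 →L[ℝ] E3) (c : ℝ≥0), InClass ρ u p H c →
        IsClassicalEulerSolutionOn (Set.Iio 0) 0 u p →
          ∀ (t₁ t₀ : ℝ) (T : Set E3) (X : ℝ → E3 → E3), t₁ < t₀ → t₀ < 0 → MeasurableSet T → IsAnchorFlow u t₁ t₀ T X →
            ∀ R₀ : ℝ, 0 < R₀ → T ⊆ Metric.ball (0 : E3) R₀ →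
              ∀ A : ℝ, 1 ≤ A → t₀ - t₁ ≤ A ^ 2 →
                ∀ R : ℝ, 2 * R₀ ≤ R → A ≤ R → -R ^ 2 < t₁ →
                  ∀ s ∈ Set.Icc t₁ t₀,
                    MeasurableSet {y : E3 | y ∈ T ∧ R ≤ ‖X s y‖} ∧
                      (volume {y : E3 | y ∈ T ∧ R ≤ ‖X s y‖}).toReal ≤
                        (C₂ * (c : ℝ) * A ^ 2 * R ^ (-(1 + ρ))) ^ 3 := by
  obtain ⟨C, hC, hK⟩ := hK3
  refine ⟨(4 * C) ^ 2, by positivity, ?_⟩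
  intro ρ hρ u p H c hcls hcl t₁ t₀ T X ht₁ ht₀ hT hX R₀ hR₀ hTR₀ A hA hlen R hRR₀ hAR hRt₁ s hs
  have hR0 : 0 < R := by linarith
  have hR1 : 1 ≤ R := hA.trans hAR
  have hXc : Continuous (fun q : ℝ × E3 => X q.1 q.2) := hX.1
  have hXs : Continuous (X s) := hXc.comp (continuous_const.prodMk continuous_id)
  set E₀ : Set E3 := {y : E3 | y ∈ T ∧ R ≤ ‖X s y‖} with hE₀def
  have hE₀m : MeasurableSet E₀ := hT.inter (measurableSet_le measurable_const hXs.norm.measurable)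
  refine ⟨hE₀m, ?_⟩
  have hE₀T : E₀ ⊆ T := fun y hy => hy.1
  have hfar : ∀ y ∈ E₀, R ≤ ‖X s y‖ := fun y hy => hy.2
  have h3 := hK ρ hρ u p H c hcls hcl t₁ t₀ T X ht₁ ht₀ hT hX R₀ hR₀ hTR₀ R hRR₀ hRt₁ s hs E₀ hE₀T hE₀m hfar
  set v : ℝ := (volume E₀).toReal with hvdef
  have hv0 : 0 ≤ v := ENNReal.toReal_nonneg
  have hc0 : 0 ≤ (c : ℝ) := c.coe_nonneg
  have hts0 : 0 ≤ t₀ - s := by linarith [hs.2]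
  have hts : t₀ - s ≤ A ^ 2 := by linarith [hs.1]
  have hA0 : 0 < A := by linarith
  have hsqrt : Real.sqrt (t₀ - s) ≤ A := by
    calc Real.sqrt (t₀ - s) ≤ Real.sqrt (A ^ 2) := Real.sqrt_le_sqrt hts
      _ = A := Real.sqrt_sq hA0.le
  have hp1 : 0 < R ^ ((1 - ρ) / 2) := Real.rpow_pos_of_pos hR0 _
  have hp2 : 0 < R ^ (-(1 / 2 + ρ)) := Real.rpow_pos_of_pos hR0 _
  have hp3 : 0 < R ^ (-(1 + ρ) / 2) := Real.rpow_pos_of_pos hR0 _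
  have hv16 : 0 ≤ v ^ (1 / 6 : ℝ) := Real.rpow_nonneg hv0 _
  have hsc : 0 ≤ Real.sqrt (c : ℝ) := Real.sqrt_nonneg _
  have h4 : v ^ (1 / 6 : ℝ) * R ≤
      2 * (C * Real.sqrt (c : ℝ)) * (A * R ^ ((1 - ρ) / 2) + A ^ 2 * R ^ (-(1 / 2 + ρ))) := by
    have hmono : Real.sqrt (t₀ - s) * R ^ ((1 - ρ) / 2) + (t₀ - s) * R ^ (-(1 / 2 + ρ)) ≤
        A * R ^ ((1 - ρ) / 2) + A ^ 2 * R ^ (-(1 / 2 + ρ)) :=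
      add_le_add (mul_le_mul_of_nonneg_right hsqrt hp1.le) (mul_le_mul_of_nonneg_right hts hp2.le)
    have h5 : v ^ (1 / 6 : ℝ) * (R - R₀) ≤ C * Real.sqrt (c : ℝ) * (A * R ^ ((1 - ρ) / 2) + A ^ 2 * R ^ (-(1 / 2 + ρ))) :=
      h3.trans (mul_le_mul_of_nonneg_left hmono (mul_nonneg hC.le hsc))
    have h6 : v ^ (1 / 6 : ℝ) * R ≤ 2 * (v ^ (1 / 6 : ℝ) * (R - R₀)) := by
      have : R ≤ 2 * (R - R₀) := by linarith
      nlinarith [hv16, this]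
    linarith [h5, h6]
  have h7 : A ^ 2 * R ^ (-(1 / 2 + ρ)) ≤ A * R ^ ((1 - ρ) / 2) := by
    have h8 : A * R ^ (-(1 / 2 + ρ)) ≤ R ^ ((1 - ρ) / 2) := by
      calc A * R ^ (-(1 / 2 + ρ)) ≤ R * R ^ (-(1 / 2 + ρ)) := mul_le_mul_of_nonneg_right hAR hp2.le
        _ = R ^ (1 / 2 - ρ) := by
            rw [show (1 / 2 - ρ : ℝ) = 1 + (-(1 / 2 + ρ)) by ring, Real.rpow_add hR0, Real.rpow_one]
        _ ≤ R ^ ((1 - ρ) / 2) := Real.rpow_le_rpow_of_exponent_le hR1 (by linarith)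
    calc A ^ 2 * R ^ (-(1 / 2 + ρ)) = A * (A * R ^ (-(1 / 2 + ρ))) := by ring
      _ ≤ A * R ^ ((1 - ρ) / 2) := mul_le_mul_of_nonneg_left h8 hA0.le
  have h9 : v ^ (1 / 6 : ℝ) * R ≤ (4 * C * Real.sqrt (c : ℝ) * A * R ^ (-(1 + ρ) / 2)) * R := by
    have e : R ^ ((1 - ρ) / 2) = R ^ (-(1 + ρ) / 2) * R := by
      rw [show ((1 - ρ) / 2 : ℝ) = -(1 + ρ) / 2 + 1 by ring, Real.rpow_add hR0, Real.rpow_one]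
    calc v ^ (1 / 6 : ℝ) * R ≤ 2 * (C * Real.sqrt (c : ℝ)) * (A * R ^ ((1 - ρ) / 2) + A * R ^ ((1 - ρ) / 2)) :=
          h4.trans (by gcongr)
      _ = (4 * C * Real.sqrt (c : ℝ) * A * R ^ (-(1 + ρ) / 2)) * R := by rw [e]; ring
  have h10 : v ^ (1 / 6 : ℝ) ≤ 4 * C * Real.sqrt (c : ℝ) * A * R ^ (-(1 + ρ) / 2) :=
    le_of_mul_le_mul_right h9 hR0
  have hY0 : 0 ≤ 4 * C * Real.sqrt (c : ℝ) * A * R ^ (-(1 + ρ) / 2) := by positivity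
  have h11 := pow_le_pow_left₀ hv16 h10 6
  have ev : (v ^ (1 / 6 : ℝ)) ^ (6 : ℕ) = v := by
    rw [← Real.rpow_natCast, ← Real.rpow_mul hv0]; norm_num
  have esc : Real.sqrt (c : ℝ) ^ (6 : ℕ) = (c : ℝ) ^ 3 := by
    rw [show (6 : ℕ) = 2 * 3 by norm_num, pow_mul, Real.sq_sqrt hc0]
  have eR : (R ^ (-(1 + ρ) / 2)) ^ (6 : ℕ) = (R ^ (-(1 + ρ))) ^ 3 := by
    rw [← Real.rpow_natCast, ← Real.rpow_mul hR0.le, ← Real.rpow_natCast (R ^ (-(1 + ρ))), ← Real.rpow_mul hR0.le]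
    congr 1; push_cast; ring
  calc v = (v ^ (1 / 6 : ℝ)) ^ (6 : ℕ) := ev.symm
    _ ≤ (4 * C * Real.sqrt (c : ℝ) * A * R ^ (-(1 + ρ) / 2)) ^ (6 : ℕ) := h11
    _ = (4 * C) ^ 6 * Real.sqrt (c : ℝ) ^ (6 : ℕ) * A ^ 6 * (R ^ (-(1 + ρ) / 2)) ^ (6 : ℕ) := by ring
    _ = (4 * C) ^ 6 * (c : ℝ) ^ 3 * A ^ 6 * (R ^ (-(1 + ρ))) ^ 3 := by rw [esc, eR]
    _ = ((4 * C) ^ 2 * (c : ℝ) * A ^ 2 * R ^ (-(1 + ρ))) ^ 3 := by ring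

/-! ### K4 helper 6: the WINDOW BUDGET (the `E`-gauge, sliced: `∫_{−a²}^{0} (∫_{B_a} ‖∇u(s)‖_F²) ds ≤ c a^{1−ρ}`, with measurability) -/

theorem continuous_frobeniusNormSq_clm : Continuous fun L : E3 →L[ℝ] E3 => frobeniusNormSq L := by
  unfold frobeniusNormSq
  refine continuous_finsetSum _ fun i _ => ?_
  exact ((ContinuousLinearMap.apply ℝ E3 (stdOrthonormalBasis ℝ E3 i)).continuous.norm).pow 2

/-- **Window budget**: for a member of the class (classical) and a scale `a > 0`, the slice Dirichlet integrals `F_a(s) = ∫_{B_a} ‖∇u(s)‖_F²` are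
a.e.-measurable on `(−a², 0)` and `∫_{(−a²,0)} F_a(s) ds ≤ c a^{1−ρ}` (stated in `ℝ≥0∞`). -/
theorem windowBudget {ρ : ℝ} {u : ℝ → E3 → E3} {p : ℝ → E3 → ℝ} {H : ℝ → E3 → E3 →L[ℝ] E3} {c : ℝ≥0}
    (hcls : InClass ρ u p H c) (hcl : IsClassicalEulerSolutionOn (Set.Iio 0) 0 u p) {a : ℝ} (ha : 0 < a) :
    AEMeasurable (fun s : ℝ => ENNReal.ofReal (∫ x in Metric.ball (0 : E3) a, frobeniusNormSq (fderiv ℝ (u s) x)))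
        (volume.restrict (Set.Ioo (-(a ^ 2)) 0)) ∧
      ∫⁻ s in Set.Ioo (-(a ^ 2)) 0, ENNReal.ofReal (∫ x in Metric.ball (0 : E3) a, frobeniusNormSq (fderiv ℝ (u s) x)) ≤
        ENNReal.ofReal ((c : ℝ) * a ^ (1 - ρ)) := by
  obtain ⟨_, hH, hgauge⟩ := hcls
  have hE : ∀ a : ℝ, 0 < a → ENNReal.ofReal (a ^ ρ) * cknE a (0 : ℝ × E3) H ≤ (c : ℝ≥0∞) :=
    fun a ha => le_trans (le_trans le_add_self le_self_add) (hgauge a ha)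
  set I : Set ℝ := Set.Ioo (-(a ^ 2)) 0 with hIdef
  set B : Set E3 := Metric.ball (0 : E3) a with hBdef
  have hI0 : I ⊆ Set.Iio 0 := fun σ hσ => hσ.2
  have hD_cont : ContinuousOn (Function.uncurry fun t x => fderiv ℝ (u t) x) (Set.Iio (0 : ℝ) ×ˢ (Set.univ : Set E3)) :=
    (hcl.smooth_velocity.fderiv_slice isOpen_Iio.uniqueDiffOn).continuousOn
  have hG_cont : ContinuousOn (Function.uncurry fun (t : ℝ) (x : E3) => ENNReal.ofReal (frobeniusNormSq (fderiv ℝ (u t) x)))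
      (Set.Iio (0 : ℝ) ×ˢ (Set.univ : Set E3)) :=
    ENNReal.continuous_ofReal.comp_continuousOn (continuous_frobeniusNormSq_clm.comp_continuousOn hD_cont)
  have hGi : AEMeasurable (Function.uncurry fun (σ : ℝ) (x : E3) => ENNReal.ofReal (frobeniusNormSq (fderiv ℝ (u σ) x)))
      ((volume.restrict I).prod (volume.restrict B)) := by
    rw [Measure.prod_restrict, ← Measure.volume_eq_prod]
    exact (hG_cont.mono (Set.prod_mono hI0 (Set.subset_univ _))).aemeasurable (measurableSet_Ioo.prod measurableSet_ball)
  have hslice : ∀ σ ∈ I, ENNReal.ofReal (∫ x in B, frobeniusNormSq (fderiv ℝ (u σ) x)) =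
      ∫⁻ x in B, ENNReal.ofReal (frobeniusNormSq (fderiv ℝ (u σ) x)) := by
    intro σ hσ
    have hv : ContDiff ℝ 1 (u σ) := (hcl.contDiff_velocity (hI0 hσ)).of_le (by norm_cast)
    have hFc : Continuous fun x => frobeniusNormSq (fderiv ℝ (u σ) x) := continuous_frobeniusNormSq_fderiv hv one_ne_zero
    have hint : IntegrableOn (fun x => frobeniusNormSq (fderiv ℝ (u σ) x)) B volume :=
      (hFc.continuousOn.integrableOn_compact (isCompact_closedBall (0 : E3) a)).mono_set Metric.ball_subset_closedBall
    exact ofReal_integral_eq_lintegral_ofReal hint (ae_of_all _ fun x => frobeniusNormSq_nonneg _)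
  have hae : (fun σ : ℝ => ∫⁻ x in B, ENNReal.ofReal (frobeniusNormSq (fderiv ℝ (u σ) x))) =ᵐ[volume.restrict I]
      fun σ : ℝ => ENNReal.ofReal (∫ x in B, frobeniusNormSq (fderiv ℝ (u σ) x)) :=
    (ae_restrict_iff' measurableSet_Ioo).2 (ae_of_all _ fun σ hσ => (hslice σ hσ).symm)
  refine ⟨hGi.lintegral_prod_right'.congr hae, ?_⟩
  calc ∫⁻ s in I, ENNReal.ofReal (∫ x in B, frobeniusNormSq (fderiv ℝ (u s) x))
      = ∫⁻ s in I, ∫⁻ x in B, ENNReal.ofReal (frobeniusNormSq (fderiv ℝ (u s) x)) := setLIntegral_congr_fun measurableSet_Ioo hslice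
    _ = ∫⁻ z in I ×ˢ B, ENNReal.ofReal (frobeniusNormSq (fderiv ℝ (u z.1) z.2)) := by
        rw [lintegral_lintegral hGi, Measure.prod_restrict, ← Measure.volume_eq_prod]
    _ ≤ ENNReal.ofReal ((c : ℝ) * a ^ (1 - ρ)) := by
        rw [hIdef, hBdef, show (-(a ^ 2) : ℝ) = -a ^ 2 by ring]
        exact SwirlfreeLedger.setLIntegral_window_frobenius_fderiv_le hH hcl hE ha

/-! ### K4 helper 7: the RACE SERIES (pure real analysis: the `j`-sum of `budget_j / floor_j` is `K₁A^{1−ρ} + K₂A^{2−2ρ} + K₃A^{2−5ρ}`) -/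

/-- pigeonhole share of shell `j`: `η_j = h / (4 (j+1)²)`. -/
def eta (h : ℝ) (j : ℕ) : ℝ := h / (4 * ((j : ℝ) + 1) ^ 2)

/-- the member shell floor's output (K4a) with share `η_j`, volume majorant `V` and ball radius `Rad`. -/
def eFloor (ρ C₁ c h V Rad : ℝ) (j : ℕ) : ℝ :=
  min (eta h j / (C₁ * V ^ (1 / 3 : ℝ))) (eta h j ^ 2 * Rad ^ (1 + 2 * ρ) / (C₁ * c * V ^ (2 / 3 : ℝ)))

/-- radius of the ball hosting shell `j` at scale `A`: `2^{j+1} A` (shell `0` = the core ball `B(0,2A)`, shell `j ≥ 1` = `{2^j A ≤ ‖x‖ < 2^{j+1}A}`). -/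
def shellRad (A : ℝ) (j : ℕ) : ℝ := 2 ^ (j + 1) * A

/-- volume majorant of the labels feeding shell `j`: all labels (`v₀`) for the core, the far-label bound (K4b, cubed form, radius `2^j A`) beyond. -/
def shellVol (ρ C₂ c v₀ A : ℝ) : ℕ → ℝ
  | 0 => v₀
  | (j + 1) => (C₂ * c * A ^ 2 * (2 ^ (j + 1) * A) ^ (-(1 + ρ))) ^ 3

theorem eta_pos {h : ℝ} (hh : 0 < h) (j : ℕ) : 0 < eta h j := by
  unfold eta; positivity

theorem eFloor_pos {ρ C₁ c h V Rad : ℝ} (hC₁ : 0 < C₁) (hc : 0 < c) (hh : 0 < h) (hV : 0 < V) (hRad : 0 < Rad) (j : ℕ) :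
    0 < eFloor ρ C₁ c h V Rad j := by
  unfold eFloor
  have := eta_pos hh j
  have h1 : 0 < V ^ (1 / 3 : ℝ) := Real.rpow_pos_of_pos hV _
  have h2 : 0 < V ^ (2 / 3 : ℝ) := Real.rpow_pos_of_pos hV _
  have h3 : 0 < Rad ^ (1 + 2 * ρ) := Real.rpow_pos_of_pos hRad _
  exact lt_min (by positivity) (by positivity)

theorem shellRad_pos {A : ℝ} (hA : 0 < A) (j : ℕ) : 0 < shellRad A j := by
  unfold shellRad; positivity

theorem shellVol_pos {ρ C₂ c v₀ A : ℝ} (hC₂ : 0 < C₂) (hc : 0 < c) (hv₀ : 0 < v₀) (hA : 0 < A) :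
    ∀ j : ℕ, 0 < shellVol ρ C₂ c v₀ A j
  | 0 => hv₀
  | (j + 1) => by
      simp only [shellVol]
      have : 0 < (2 ^ (j + 1) * A) ^ (-(1 + ρ)) := Real.rpow_pos_of_pos (by positivity) _
      positivity

theorem div_min_le_add {x a b : ℝ} (hx : 0 ≤ x) (ha : 0 < a) (hb : 0 < b) : x / min a b ≤ x / a + x / b := by
  rcases min_choice a b with hm | hm <;> rw [hm]
  · linarith [div_nonneg hx hb.le]
  · linarith [div_nonneg hx ha.le]

theorem summable_shift_sq_geometric {r : ℝ} (hr0 : 0 < r) (hr1 : r < 1) (k : ℕ) :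
    Summable fun i : ℕ => ((i : ℝ) + 2) ^ k * r ^ (i + 1) := by
  have hf := summable_pow_mul_geometric_of_norm_lt_one k (show ‖r‖ < 1 by rwa [Real.norm_of_nonneg hr0.le])
  have hf2 := ((summable_nat_add_iff 2).2 hf).mul_left r⁻¹
  refine hf2.congr fun i => ?_
  have hr : r ≠ 0 := hr0.ne'
  push_cast
  rw [show ((i : ℝ) + 2) ^ k * r ^ (i + 2) = r * (((i : ℝ) + 2) ^ k * r ^ (i + 1)) by ring, ← mul_assoc,
    inv_mul_cancel₀ hr, one_mul]

/-- race term `j = 0` (the core): `≤ K₁ A^{1−ρ}`. -/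
theorem raceTerm_zero {ρ C₁ C₂ c h v₀ : ℝ} (hρ : 0 < ρ) (hC₁ : 0 < C₁) (hc : 0 < c) (hh : 0 < h) (hv₀ : 0 < v₀)
    {A : ℝ} (hA : 1 ≤ A) :
    c * shellRad A 0 ^ (1 - ρ) / eFloor ρ C₁ c h (shellVol ρ C₂ c v₀ A 0) (shellRad A 0) 0 ≤
      (2 * c * C₁ * (v₀ ^ (1 / 3 : ℝ) / eta h 0 + c * v₀ ^ (2 / 3 : ℝ) / eta h 0 ^ 2)) * A ^ (1 - ρ) := by
  simp only [shellRad, shellVol, eFloor, zero_add, pow_one]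
  set η₀ : ℝ := eta h 0 with hη₀def
  have hη₀ : 0 < η₀ := eta_pos hh 0
  have hA0 : 0 < A := by linarith
  have hApow : 0 < A ^ (1 - ρ) := Real.rpow_pos_of_pos hA0 _
  have hv13 : 0 < v₀ ^ (1 / 3 : ℝ) := Real.rpow_pos_of_pos hv₀ _
  have hv23 : 0 < v₀ ^ (2 / 3 : ℝ) := Real.rpow_pos_of_pos hv₀ _
  have hRad : 0 < 2 * A := by positivity
  have hRad1 : 0 < (2 * A) ^ (1 - ρ) := Real.rpow_pos_of_pos hRad _
  have hRad2 : 0 < (2 * A) ^ (1 + 2 * ρ) := Real.rpow_pos_of_pos hRad _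
  have ha : 0 < η₀ / (C₁ * v₀ ^ (1 / 3 : ℝ)) := by positivity
  have hb : 0 < η₀ ^ 2 * (2 * A) ^ (1 + 2 * ρ) / (C₁ * c * v₀ ^ (2 / 3 : ℝ)) := by positivity
  have hx : 0 ≤ c * (2 * A) ^ (1 - ρ) := by positivity
  refine (div_min_le_add hx ha hb).trans ?_
  have e1 : (2 * A) ^ (1 - ρ) ≤ 2 * A ^ (1 - ρ) := by
    rw [Real.mul_rpow zero_le_two hA0.le]
    refine mul_le_mul_of_nonneg_right ?_ hApow.le
    calc (2 : ℝ) ^ (1 - ρ) ≤ (2 : ℝ) ^ (1 : ℝ) := Real.rpow_le_rpow_of_exponent_le one_le_two (by linarith)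
      _ = 2 := Real.rpow_one _
  have e2 : 1 ≤ (2 * A) ^ (1 + 2 * ρ) := Real.one_le_rpow (by linarith) (by linarith)
  have t1 : c * (2 * A) ^ (1 - ρ) / (η₀ / (C₁ * v₀ ^ (1 / 3 : ℝ))) ≤ 2 * c * C₁ * (v₀ ^ (1 / 3 : ℝ) / η₀) * A ^ (1 - ρ) := by
    rw [div_div_eq_mul_div, div_le_iff₀ hη₀]
    calc c * (2 * A) ^ (1 - ρ) * (C₁ * v₀ ^ (1 / 3 : ℝ)) ≤ c * (2 * A ^ (1 - ρ)) * (C₁ * v₀ ^ (1 / 3 : ℝ)) :=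
          mul_le_mul_of_nonneg_right (mul_le_mul_of_nonneg_left e1 hc.le) (by positivity)
      _ = 2 * c * C₁ * (v₀ ^ (1 / 3 : ℝ) / η₀) * A ^ (1 - ρ) * η₀ := by
          rw [mul_div_assoc']
          rw [div_mul_eq_mul_div, div_mul_eq_mul_div, eq_div_iff hη₀.ne']
          ring
  have t2 : c * (2 * A) ^ (1 - ρ) / (η₀ ^ 2 * (2 * A) ^ (1 + 2 * ρ) / (C₁ * c * v₀ ^ (2 / 3 : ℝ))) ≤
      2 * c * C₁ * (c * v₀ ^ (2 / 3 : ℝ) / η₀ ^ 2) * A ^ (1 - ρ) := by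
    rw [div_div_eq_mul_div, div_le_iff₀ (by positivity)]
    calc c * (2 * A) ^ (1 - ρ) * (C₁ * c * v₀ ^ (2 / 3 : ℝ)) ≤ c * (2 * A ^ (1 - ρ)) * (C₁ * c * v₀ ^ (2 / 3 : ℝ)) :=
          mul_le_mul_of_nonneg_right (mul_le_mul_of_nonneg_left e1 hc.le) (by positivity)
      _ = 2 * c * C₁ * (c * v₀ ^ (2 / 3 : ℝ) / η₀ ^ 2) * A ^ (1 - ρ) * (η₀ ^ 2 * 1) := by
          rw [mul_one, mul_div_assoc', div_mul_eq_mul_div, div_mul_eq_mul_div, eq_div_iff (pow_ne_zero 2 hη₀.ne')]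
          ring
      _ ≤ 2 * c * C₁ * (c * v₀ ^ (2 / 3 : ℝ) / η₀ ^ 2) * A ^ (1 - ρ) * (η₀ ^ 2 * (2 * A) ^ (1 + 2 * ρ)) :=
          mul_le_mul_of_nonneg_left (mul_le_mul_of_nonneg_left e2 (sq_nonneg _)) (by positivity)
  calc _ ≤ _ := add_le_add t1 t2
    _ = _ := by ring

/-- race term `j = i+1` (the shells): `≤ L₂ A^{2−2ρ} (i+2)² r₁^{i+1} + L₃ A^{2−5ρ} (i+2)⁴ 2^{−(i+1)}` with `r₁ = 2^{−2ρ}`. -/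
theorem raceTerm_succ {ρ C₁ C₂ c h v₀ : ℝ} (hρ : 0 < ρ) (hC₁ : 0 < C₁) (hC₂ : 0 < C₂) (hc : 0 < c) (hh : 0 < h)
    {A : ℝ} (hA : 1 ≤ A) (i : ℕ) :
    c * shellRad A (i + 1) ^ (1 - ρ) / eFloor ρ C₁ c h (shellVol ρ C₂ c v₀ A (i + 1)) (shellRad A (i + 1)) (i + 1) ≤
      (8 * C₁ * C₂ * c ^ 2 / h) * A ^ (2 - 2 * ρ) * (((i : ℝ) + 2) ^ 2 * ((2 : ℝ) ^ (-(2 * ρ))) ^ (i + 1)) +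
        (32 * C₁ * C₂ ^ 2 * c ^ 4 / h ^ 2) * A ^ (2 - 5 * ρ) * (((i : ℝ) + 2) ^ 4 * (1 / 2 : ℝ) ^ (i + 1)) := by
  simp only [shellRad, shellVol, eFloor]
  have hA0 : 0 < A := by linarith
  have hApow : ∀ e : ℝ, 0 < A ^ e := fun e => Real.rpow_pos_of_pos hA0 e
  set r₁ : ℝ := (2 : ℝ) ^ (-(2 * ρ)) with hr₁def
  set t : ℝ := (2 : ℝ) ^ (i + 1) with htdef
  have ht1 : 1 ≤ t := one_le_pow₀ one_le_two
  have ht0 : 0 < t := by positivity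
  have hRad_eq : (2 : ℝ) ^ (i + 1 + 1) * A = 2 * t * A := by rw [htdef, pow_succ]; ring
  rw [hRad_eq]
  set η : ℝ := eta h (i + 1) with hηdef
  have hη : 0 < η := eta_pos hh _
  have hη_eq : η = h / (4 * ((i : ℝ) + 2) ^ 2) := by
    rw [hηdef, eta]; push_cast; ring_nf
  set X : ℝ := C₂ * c * A ^ 2 * (t * A) ^ (-(1 + ρ)) with hXdef
  have htA : 0 < t * A := by positivity
  have htApow : 0 < (t * A) ^ (-(1 + ρ)) := Real.rpow_pos_of_pos htA _
  have hX0 : 0 < X := by positivity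
  have hV13 : (X ^ 3) ^ (1 / 3 : ℝ) = X := by
    rw [one_div, show (3 : ℝ) = ((3 : ℕ) : ℝ) by norm_num]
    exact Real.pow_rpow_inv_natCast hX0.le three_ne_zero
  have hV23 : (X ^ 3) ^ (2 / 3 : ℝ) = X ^ 2 := by
    rw [← Real.rpow_natCast X 3, ← Real.rpow_mul hX0.le]; norm_num
  rw [hV13, hV23]
  have hRad : 0 < 2 * t * A := by positivity
  have hRad1 : 0 < (2 * t * A) ^ (1 - ρ) := Real.rpow_pos_of_pos hRad _
  have hRad2 : 0 < (2 * t * A) ^ (1 + 2 * ρ) := Real.rpow_pos_of_pos hRad _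
  have ha : 0 < η / (C₁ * X) := by positivity
  have hb : 0 < η ^ 2 * (2 * t * A) ^ (1 + 2 * ρ) / (C₁ * c * X ^ 2) := by positivity
  have hx : 0 ≤ c * (2 * t * A) ^ (1 - ρ) := by positivity
  refine (div_min_le_add hx ha hb).trans ?_
  have ht1ρ : 0 ≤ t ^ (1 - ρ) := Real.rpow_nonneg ht0.le _
  have eRad : (2 * t * A) ^ (1 - ρ) ≤ 2 * t ^ (1 - ρ) * A ^ (1 - ρ) := by
    rw [Real.mul_rpow (by positivity) hA0.le, Real.mul_rpow zero_le_two ht0.le]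
    refine mul_le_mul_of_nonneg_right (mul_le_mul_of_nonneg_right ?_ ht1ρ) (hApow _).le
    calc (2 : ℝ) ^ (1 - ρ) ≤ (2 : ℝ) ^ (1 : ℝ) := Real.rpow_le_rpow_of_exponent_le one_le_two (by linarith)
      _ = 2 := Real.rpow_one _
  have eX : X = C₂ * c * t ^ (-(1 + ρ)) * A ^ (1 - ρ) := by
    have e2 : A ^ 2 * A ^ (-(1 + ρ)) = A ^ (1 - ρ) := by
      rw [← Real.rpow_natCast A 2, ← Real.rpow_add hA0, show ((2 : ℕ) : ℝ) + (-(1 + ρ)) = 1 - ρ by push_cast; ring]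
    rw [hXdef, Real.mul_rpow ht0.le hA0.le]
    calc C₂ * c * A ^ 2 * (t ^ (-(1 + ρ)) * A ^ (-(1 + ρ))) = C₂ * c * t ^ (-(1 + ρ)) * (A ^ 2 * A ^ (-(1 + ρ))) := by ring
      _ = _ := by rw [e2]
  have ett : t ^ (1 - ρ) * t ^ (-(1 + ρ)) = r₁ ^ (i + 1) := by
    rw [← Real.rpow_add ht0, show (1 - ρ) + (-(1 + ρ)) = -(2 * ρ) by ring, htdef, hr₁def,
      ← Real.rpow_natCast (2 : ℝ) (i + 1), ← Real.rpow_mul zero_le_two, mul_comm, Real.rpow_mul zero_le_two,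
      Real.rpow_natCast]
  have ett2 : t ^ (1 - ρ) * (t ^ (-(1 + ρ))) ^ 2 ≤ (1 / 2 : ℝ) ^ (i + 1) := by
    rw [← Real.rpow_natCast (t ^ (-(1 + ρ))) 2, ← Real.rpow_mul ht0.le, ← Real.rpow_add ht0]
    calc t ^ ((1 - ρ) + (-(1 + ρ)) * ((2 : ℕ) : ℝ)) ≤ t ^ (-1 : ℝ) :=
          Real.rpow_le_rpow_of_exponent_le ht1 (by push_cast; linarith)
      _ = (1 / 2 : ℝ) ^ (i + 1) := by rw [Real.rpow_neg_one, htdef, one_div, inv_pow]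
  have eAA : A ^ (1 - ρ) * A ^ (1 - ρ) = A ^ (2 - 2 * ρ) := by
    rw [show (2 - 2 * ρ : ℝ) = (1 - ρ) + (1 - ρ) by ring, Real.rpow_add hA0]
  have eRadbig : A ^ (1 + 2 * ρ) ≤ (2 * t * A) ^ (1 + 2 * ρ) := by
    rw [Real.mul_rpow (by positivity) hA0.le]
    have : 1 ≤ (2 * t) ^ (1 + 2 * ρ) := Real.one_le_rpow (by linarith) (by linarith)
    exact le_mul_of_one_le_left (hApow _).le this
  have eA3 : A ^ (1 - ρ) * A ^ (2 - 2 * ρ) = A ^ (2 - 5 * ρ) * A ^ (1 + 2 * ρ) := by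
    rw [← Real.rpow_add hA0, ← Real.rpow_add hA0, show (1 - ρ) + (2 - 2 * ρ) = (2 - 5 * ρ) + (1 + 2 * ρ) by ring]
  have hh0 : h ≠ 0 := hh.ne'
  have hi2 : ((i : ℝ) + 2) ≠ 0 := by positivity
  have t1 : c * (2 * t * A) ^ (1 - ρ) / (η / (C₁ * X)) ≤
      (8 * C₁ * C₂ * c ^ 2 / h) * A ^ (2 - 2 * ρ) * (((i : ℝ) + 2) ^ 2 * r₁ ^ (i + 1)) := by
    rw [div_div_eq_mul_div, div_le_iff₀ hη]
    calc c * (2 * t * A) ^ (1 - ρ) * (C₁ * X) ≤ c * (2 * t ^ (1 - ρ) * A ^ (1 - ρ)) * (C₁ * X) :=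
          mul_le_mul_of_nonneg_right (mul_le_mul_of_nonneg_left eRad hc.le) (by positivity)
      _ = 2 * C₁ * C₂ * c ^ 2 * (t ^ (1 - ρ) * t ^ (-(1 + ρ))) * (A ^ (1 - ρ) * A ^ (1 - ρ)) := by rw [eX]; ring
      _ = 2 * C₁ * C₂ * c ^ 2 * r₁ ^ (i + 1) * A ^ (2 - 2 * ρ) := by rw [ett, eAA]
      _ = (8 * C₁ * C₂ * c ^ 2 / h) * A ^ (2 - 2 * ρ) * (((i : ℝ) + 2) ^ 2 * r₁ ^ (i + 1)) * η := by
          rw [hη_eq]; field_simp; ring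
  have t2 : c * (2 * t * A) ^ (1 - ρ) / (η ^ 2 * (2 * t * A) ^ (1 + 2 * ρ) / (C₁ * c * X ^ 2)) ≤
      (32 * C₁ * C₂ ^ 2 * c ^ 4 / h ^ 2) * A ^ (2 - 5 * ρ) * (((i : ℝ) + 2) ^ 4 * (1 / 2 : ℝ) ^ (i + 1)) := by
    rw [div_div_eq_mul_div, div_le_iff₀ (by positivity)]
    calc c * (2 * t * A) ^ (1 - ρ) * (C₁ * c * X ^ 2) ≤ c * (2 * t ^ (1 - ρ) * A ^ (1 - ρ)) * (C₁ * c * X ^ 2) :=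
          mul_le_mul_of_nonneg_right (mul_le_mul_of_nonneg_left eRad hc.le) (by positivity)
      _ = 2 * C₁ * C₂ ^ 2 * c ^ 4 * (t ^ (1 - ρ) * (t ^ (-(1 + ρ))) ^ 2) * (A ^ (1 - ρ) * (A ^ (1 - ρ)) ^ 2) := by
          rw [eX]; ring
      _ ≤ 2 * C₁ * C₂ ^ 2 * c ^ 4 * (1 / 2 : ℝ) ^ (i + 1) * (A ^ (1 - ρ) * (A ^ (1 - ρ)) ^ 2) := by
          have h0 : 0 ≤ A ^ (1 - ρ) * (A ^ (1 - ρ)) ^ 2 := by positivity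
          have h1 : 0 ≤ 2 * C₁ * C₂ ^ 2 * c ^ 4 := by positivity
          exact mul_le_mul_of_nonneg_right (mul_le_mul_of_nonneg_left ett2 h1) h0
      _ = 2 * C₁ * C₂ ^ 2 * c ^ 4 * (1 / 2 : ℝ) ^ (i + 1) * (A ^ (2 - 5 * ρ) * A ^ (1 + 2 * ρ)) := by
          rw [sq (A ^ (1 - ρ)), eAA, eA3]
      _ ≤ 2 * C₁ * C₂ ^ 2 * c ^ 4 * (1 / 2 : ℝ) ^ (i + 1) * (A ^ (2 - 5 * ρ) * (2 * t * A) ^ (1 + 2 * ρ)) := by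
          have h1 : 0 ≤ 2 * C₁ * C₂ ^ 2 * c ^ 4 * (1 / 2 : ℝ) ^ (i + 1) := by positivity
          exact mul_le_mul_of_nonneg_left (mul_le_mul_of_nonneg_left eRadbig (hApow _).le) h1
      _ = (32 * C₁ * C₂ ^ 2 * c ^ 4 / h ^ 2) * A ^ (2 - 5 * ρ) * (((i : ℝ) + 2) ^ 4 * (1 / 2 : ℝ) ^ (i + 1)) *
            (η ^ 2 * (2 * t * A) ^ (1 + 2 * ρ)) := by
          rw [hη_eq]; field_simp; ring
  exact add_le_add t1 t2

/-- **Race series**: for `ρ > 0` and positive constants, there are `K₁ K₂ K₃ ≥ 0` such that for every scale `A ≥ 1` and every number of shells `J`,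
`∑_{j<J} c (2^{j+1}A)^{1−ρ} / eFloor_j ≤ K₁ A^{1−ρ} + K₂ A^{2−2ρ} + K₃ A^{2−5ρ}`. -/
theorem raceSeries {ρ C₁ C₂ c h v₀ : ℝ} (hρ : 0 < ρ) (hC₁ : 0 < C₁) (hC₂ : 0 < C₂) (hc : 0 < c) (hh : 0 < h)
    (hv₀ : 0 < v₀) :
    ∃ K₁ K₂ K₃ : ℝ, 0 ≤ K₁ ∧ 0 ≤ K₂ ∧ 0 ≤ K₃ ∧ ∀ A : ℝ, 1 ≤ A → ∀ J : ℕ,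
      ∑ j ∈ Finset.range J, c * shellRad A j ^ (1 - ρ) / eFloor ρ C₁ c h (shellVol ρ C₂ c v₀ A j) (shellRad A j) j ≤
        K₁ * A ^ (1 - ρ) + K₂ * A ^ (2 - 2 * ρ) + K₃ * A ^ (2 - 5 * ρ) := by
  set r₁ : ℝ := (2 : ℝ) ^ (-(2 * ρ)) with hr₁def
  have hr₁pos : 0 < r₁ := Real.rpow_pos_of_pos two_pos _
  have hr₁lt : r₁ < 1 := Real.rpow_lt_one_of_one_lt_of_neg one_lt_two (by linarith)
  set p₁ : ℕ → ℝ := fun i => ((i : ℝ) + 2) ^ 2 * r₁ ^ (i + 1) with hp₁def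
  set p₂ : ℕ → ℝ := fun i => ((i : ℝ) + 2) ^ 4 * (1 / 2 : ℝ) ^ (i + 1) with hp₂def
  have hp₁s : Summable p₁ := summable_shift_sq_geometric hr₁pos hr₁lt 2
  have hp₂s : Summable p₂ := summable_shift_sq_geometric (by norm_num) (by norm_num) 4
  have hp₁0 : ∀ i, 0 ≤ p₁ i := fun i => by positivity
  have hp₂0 : ∀ i, 0 ≤ p₂ i := fun i => by positivity
  have hη₀ : 0 < eta h 0 := eta_pos hh 0
  have hv13 : 0 < v₀ ^ (1 / 3 : ℝ) := Real.rpow_pos_of_pos hv₀ _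
  have hv23 : 0 < v₀ ^ (2 / 3 : ℝ) := Real.rpow_pos_of_pos hv₀ _
  set K₁ : ℝ := 2 * c * C₁ * (v₀ ^ (1 / 3 : ℝ) / eta h 0 + c * v₀ ^ (2 / 3 : ℝ) / eta h 0 ^ 2) with hK₁def
  set L₂ : ℝ := 8 * C₁ * C₂ * c ^ 2 / h with hL₂def
  set L₃ : ℝ := 32 * C₁ * C₂ ^ 2 * c ^ 4 / h ^ 2 with hL₃def
  have hK₁ : 0 ≤ K₁ := by positivity
  have hL₂ : 0 ≤ L₂ := by positivity
  have hL₃ : 0 ≤ L₃ := by positivity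
  refine ⟨K₁, L₂ * ∑' i, p₁ i, L₃ * ∑' i, p₂ i, hK₁, mul_nonneg hL₂ (tsum_nonneg hp₁0),
    mul_nonneg hL₃ (tsum_nonneg hp₂0), ?_⟩
  intro A hA J
  have hA0 : 0 < A := by linarith
  have hApow : ∀ e : ℝ, 0 < A ^ e := fun e => Real.rpow_pos_of_pos hA0 e
  have hterm0 := raceTerm_zero (C₂ := C₂) hρ hC₁ hc hh hv₀ hA
  have htermS := raceTerm_succ (v₀ := v₀) hρ hC₁ hC₂ hc hh hA
  have hRHS0 : 0 ≤ K₁ * A ^ (1 - ρ) + (L₂ * ∑' i, p₁ i) * A ^ (2 - 2 * ρ) + (L₃ * ∑' i, p₂ i) * A ^ (2 - 5 * ρ) := by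
    have h1 : 0 ≤ ∑' i, p₁ i := tsum_nonneg hp₁0
    have h2 : 0 ≤ ∑' i, p₂ i := tsum_nonneg hp₂0
    have := hApow (1 - ρ); have := hApow (2 - 2 * ρ); have := hApow (2 - 5 * ρ)
    positivity
  cases J with
  | zero => simpa using hRHS0
  | succ n =>
    rw [Finset.sum_range_succ']
    have hS : ∑ i ∈ Finset.range n,
        c * shellRad A (i + 1) ^ (1 - ρ) / eFloor ρ C₁ c h (shellVol ρ C₂ c v₀ A (i + 1)) (shellRad A (i + 1)) (i + 1) ≤
        (L₂ * ∑' i, p₁ i) * A ^ (2 - 2 * ρ) + (L₃ * ∑' i, p₂ i) * A ^ (2 - 5 * ρ) := by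
      calc _ ≤ ∑ i ∈ Finset.range n, (L₂ * A ^ (2 - 2 * ρ) * p₁ i + L₃ * A ^ (2 - 5 * ρ) * p₂ i) :=
            Finset.sum_le_sum fun i _ => htermS i
        _ = L₂ * A ^ (2 - 2 * ρ) * ∑ i ∈ Finset.range n, p₁ i + L₃ * A ^ (2 - 5 * ρ) * ∑ i ∈ Finset.range n, p₂ i := by
            rw [Finset.sum_add_distrib, Finset.mul_sum, Finset.mul_sum]
        _ ≤ L₂ * A ^ (2 - 2 * ρ) * ∑' i, p₁ i + L₃ * A ^ (2 - 5 * ρ) * ∑' i, p₂ i := by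
            have h1 := hp₁s.sum_le_tsum (Finset.range n) (fun i _ => hp₁0 i)
            have h2 := hp₂s.sum_le_tsum (Finset.range n) (fun i _ => hp₂0 i)
            have h3 : 0 ≤ L₂ * A ^ (2 - 2 * ρ) := mul_nonneg hL₂ (hApow _).le
            have h4 : 0 ≤ L₃ * A ^ (2 - 5 * ρ) := mul_nonneg hL₃ (hApow _).le
            exact add_le_add (mul_le_mul_of_nonneg_left h1 h3) (mul_le_mul_of_nonneg_left h2 h4)
        _ = _ := by ring
    linarith [hS, hterm0]

/-! ### K4 helper 8: the HOSTING SHELL (dyadic shell decomposition of a weighted helicity + pigeonhole) -/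

/-- shell `j` at scale `A`: the core ball `{‖x‖ < 2A}` for `j = 0`, the dyadic shell `{2^j A ≤ ‖x‖ < 2^{j+1} A}` for `j ≥ 1`. -/
def shellSet (A : ℝ) (j : ℕ) : Set E3 := {x : E3 | (j = 0 ∨ 2 ^ j * A ≤ ‖x‖) ∧ ‖x‖ < 2 ^ (j + 1) * A}

theorem measurableSet_shellSet (A : ℝ) (j : ℕ) : MeasurableSet (shellSet A j) := by
  have h1 : MeasurableSet {x : E3 | j = 0 ∨ 2 ^ j * A ≤ ‖x‖} := by
    by_cases hj : j = 0
    · simp [hj]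
    · simp only [hj, false_or]; exact measurableSet_le measurable_const continuous_norm.measurable
  exact h1.inter (measurableSet_lt continuous_norm.measurable measurable_const)

theorem shellSet_subset_ball (A : ℝ) (j : ℕ) : shellSet A j ⊆ Metric.ball (0 : E3) (2 ^ (j + 1) * A) :=
  fun x hx => by rw [Metric.mem_ball, dist_zero_right]; exact hx.2

theorem shellSet_disjoint {A : ℝ} (hA : 0 < A) {j k : ℕ} (hjk : j ≠ k) {x : E3} (hj : x ∈ shellSet A j) (hk : x ∈ shellSet A k) :
    False := by
  wlog h : j < k generalizing j k
  · exact this hjk.symm hk hj (lt_of_le_of_ne (not_lt.1 h) hjk.symm)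
  have hk1 : k ≠ 0 := by omega
  rcases hk.1 with h0 | hle
  · exact hk1 h0
  have hlt := hj.2
  have hpow : (2 : ℝ) ^ (j + 1) * A ≤ 2 ^ k * A :=
    mul_le_mul_of_nonneg_right (pow_le_pow_right₀ one_le_two (by omega)) hA.le
  linarith

theorem exists_shellSet (A : ℝ) : ∀ J : ℕ, 1 ≤ J → ∀ x : E3, ‖x‖ < 2 ^ J * A → ∃ j, j < J ∧ x ∈ shellSet A j := by
  intro J hJ
  induction J, hJ using Nat.le_induction with
  | base => intro x hx; exact ⟨0, zero_lt_one, Or.inl rfl, by simpa using hx⟩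
  | succ n hn ih =>
      intro x hx
      by_cases h : ‖x‖ < 2 ^ n * A
      · obtain ⟨j, hj, hjx⟩ := ih x h
        exact ⟨j, by omega, hjx⟩
      · exact ⟨n, by omega, Or.inr (not_lt.1 h), hx⟩

theorem sum_indicator_shellSet {A : ℝ} (hA : 0 < A) {J : ℕ} (hJ : 1 ≤ J) (χ : E3 → ℝ) {R' : ℝ} (hR' : R' ≤ 2 ^ J * A)
    (hsupp : ∀ x : E3, χ x ≠ 0 → ‖x‖ < R') (x : E3) :
    ∑ j ∈ Finset.range J, (shellSet A j).indicator χ x = χ x := by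
  classical
  by_cases hx : ‖x‖ < 2 ^ J * A
  · obtain ⟨j₀, hj₀, hx₀⟩ := exists_shellSet A J hJ x hx
    rw [Finset.sum_eq_single j₀, Set.indicator_of_mem hx₀]
    · intro j _ hj
      rw [Set.indicator_of_notMem]
      exact fun hxj => shellSet_disjoint hA hj hxj hx₀
    · intro h; exact absurd (Finset.mem_range.2 hj₀) h
  · have hχ : χ x = 0 := by
      by_contra h; exact hx (lt_of_lt_of_le (hsupp x h) hR')
    rw [hχ]
    refine Finset.sum_eq_zero fun j hj => ?_
    rw [Set.indicator_of_notMem]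
    intro hxj
    have := hxj.2
    have hpow : (2 : ℝ) ^ (j + 1) * A ≤ 2 ^ J * A :=
      mul_le_mul_of_nonneg_right (pow_le_pow_right₀ one_le_two (by have := Finset.mem_range.1 hj; omega)) hA.le
    exact hx (lt_of_lt_of_le this hpow)

/-- **Hosting shell**: if `χ·g` is integrable, `χ` vanishes where `‖x‖ ≥ R'`, `R' ≤ 2^J A` (`J ≥ 1`) and `H = ∫ χ g ≠ 0`, then some shell `j < J`
hosts the pigeonhole share: `|H| / (4 (j+1)²) ≤ |∫_{B(0, 2^{j+1}A)} 𝟙_{shell j} χ g|`. -/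
theorem hostingShell {χ g : E3 → ℝ} (hint : Integrable (fun x => χ x * g x)) {A R' : ℝ} (hA : 0 < A)
    (hsupp : ∀ x : E3, χ x ≠ 0 → ‖x‖ < R') {J : ℕ} (hJ : 1 ≤ J) (hR' : R' ≤ 2 ^ J * A)
    (hH : ∫ x, χ x * g x ≠ 0) :
    ∃ j, j < J ∧ |∫ x, χ x * g x| / (4 * ((j : ℝ) + 1) ^ 2) ≤
      |∫ x in Metric.ball (0 : E3) (2 ^ (j + 1) * A), (shellSet A j).indicator χ x * g x| := by
  classical
  set hj : ℕ → ℝ := fun j => ∫ x, (shellSet A j).indicator χ x * g x with hhj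
  have hind : ∀ j, (fun x => (shellSet A j).indicator χ x * g x) = (shellSet A j).indicator (fun x => χ x * g x) := by
    intro j; funext x
    by_cases hx : x ∈ shellSet A j
    · simp [Set.indicator_of_mem hx]
    · simp [Set.indicator_of_notMem hx]
  have hintj : ∀ j, Integrable (fun x => (shellSet A j).indicator χ x * g x) := by
    intro j; rw [hind j]; exact hint.indicator (measurableSet_shellSet A j)
  have hsum : ∑ j ∈ Finset.range J, hj j = ∫ x, χ x * g x := by
    rw [hhj]
    simp only
    rw [← integral_finsetSum _ fun j _ => hintj j]
    refine integral_congr_ae (ae_of_all _ fun x => ?_)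
    simp only
    rw [← Finset.sum_mul, sum_indicator_shellSet hA hJ χ hR' hsupp x]
  obtain ⟨j, hjJ, hle⟩ := pigeonhole_sq_weights hj hH hsum
  refine ⟨j, hjJ, ?_⟩
  rw [mul_comm (4 : ℝ)] at hle
  have hset : ∫ x in Metric.ball (0 : E3) (2 ^ (j + 1) * A), (shellSet A j).indicator χ x * g x = hj j := by
    rw [hhj]
    refine setIntegral_eq_integral_of_forall_compl_eq_zero fun x hx => ?_
    have hx' : x ∉ shellSet A j := fun h => hx (shellSet_subset_ball A j h)
    simp [Set.indicator_of_notMem hx']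
  rw [hset]
  simpa [mul_comm] using hle

/-! ### K4 itself: the ANCHOR RACE (assembly of helpers 1–8) -/

open Literature.Analysis.FluidPDE in
/-- **The anchor race** (K4): given the shell helicity floor (K2) and the far-volume bound (K3), no member of the class (any `ρ > 0`) lies in the
chiral-tube stratum while having anchor flows. -/
theorem anchorRace (hK2 : ShellHelicityFloor) (hK3 : FarVolumeBound) :
    ∀ ρ : ℝ, 0 < ρ → ∀ (u : ℝ → E3 → E3) (p : ℝ → E3 → ℝ) (H : ℝ → E3 → E3 →L[ℝ] E3) (c : ℝ≥0),
      InClass ρ u p H c → IsChiralTubePast u p → HasAnchorFlows u → False := by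
  classical
  intro ρ hρ u p H c hcls htube hflows
  obtain ⟨hcl, t₀, ht₀, hslab, χ, R₀, hR₀, hdatum, hH₀⟩ := htube
  obtain ⟨C₁, hC₁, hfloor⟩ := memberShellFloor hK2
  obtain ⟨C₂, hC₂, hfar⟩ := farLabelVolume hK3
  have hA_gauge : ∀ a : ℝ, 0 < a → ENNReal.ofReal (a ^ (2 * ρ)) * cknA a (0 : ℝ × E3) u ≤ (c : ℝ≥0∞) :=
    fun a ha => le_trans (le_trans le_self_add le_self_add) (hcls.2.2 a ha)
  have ht₀' : t₀ ∈ Set.Iio (0 : ℝ) := ht₀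
  set L : Set E3 := {x : E3 | χ x ≠ 0} with hLdef
  have hχc : Continuous χ := hdatum.1.continuous
  have hLopen : IsOpen L := isOpen_ne_fun hχc continuous_const
  have hLm : MeasurableSet L := hLopen.measurableSet
  have hLball : L ⊆ Metric.ball (0 : E3) R₀ := by
    intro x hx
    rw [Metric.mem_ball, dist_zero_right]
    by_contra h
    exact hx (hdatum.2.2.1 x (not_lt.1 h))
  have hLfin : volume L < ⊤ := (measure_mono hLball).trans_lt measure_ball_lt_top
  have hLne : L.Nonempty := by
    by_contra hne
    apply hH₀
    refine integral_eq_zero_of_ae (ae_of_all _ fun x => ?_)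
    have : χ x = 0 := by
      by_contra h
      exact hne ⟨x, h⟩
    simp [this]
  set v₀ : ℝ := (volume L).toReal with hv₀def
  have hv₀ : 0 < v₀ := ENNReal.toReal_pos (hLopen.measure_pos volume hLne).ne' hLfin.ne
  have hc : 0 < (c : ℝ) := by
    by_contra hcn
    have hc0 : (c : ℝ) = 0 := le_antisymm (not_lt.1 hcn) c.coe_nonneg
    apply hH₀
    set a : ℝ := R₀ + Real.sqrt (-t₀) + 1 with hadef
    have hsq : 0 ≤ Real.sqrt (-t₀) := Real.sqrt_nonneg _
    have ha : 0 < a := by rw [hadef]; linarith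
    have hat₀ : t₀ ∈ Set.Ioo (-(a ^ 2)) 0 := by
      refine ⟨?_, ht₀⟩
      have h1 : Real.sqrt (-t₀) ^ 2 = -t₀ := Real.sq_sqrt (by linarith)
      have h2 : Real.sqrt (-t₀) < a := by rw [hadef]; linarith
      nlinarith
    have hball := Backward.lintegral_ball_le_of_gaugeA (u := u) ha (hA_gauge a ha) hat₀
    rw [hc0, zero_mul, ENNReal.ofReal_zero, nonpos_iff_eq_zero] at hball
    have hv0c : Continuous (u t₀) := (hcl.contDiff_velocity ht₀').continuous
    have hae : ∀ᵐ x ∂(volume.restrict (Metric.ball (0 : E3) a)), u t₀ x = 0 := by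
      have hm : AEMeasurable (fun x => ‖u t₀ x‖ₑ ^ 2) (volume.restrict (Metric.ball (0 : E3) a)) :=
        (hv0c.measurable.enorm.pow_const 2).aemeasurable
      have := (lintegral_eq_zero_iff' hm).1 hball
      filter_upwards [this] with x hx
      simpa using hx
    have hae' : ∀ᵐ x ∂(volume : Measure E3), x ∈ Metric.ball (0 : E3) a → u t₀ x = 0 :=
      (ae_restrict_iff' measurableSet_ball).1 hae
    refine integral_eq_zero_of_ae ?_
    filter_upwards [hae'] with x hx
    by_cases hxb : x ∈ Metric.ball (0 : E3) a
    · simp [hx hxb]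
    · have : χ x = 0 := hdatum.2.2.1 x (by
        rw [Metric.mem_ball, dist_zero_right, not_lt] at hxb
        rw [hadef] at hxb; linarith)
      simp [this]
  set h : ℝ := |tubeHelicity (u t₀) χ| with hhdef
  have hh : 0 < h := abs_pos.2 hH₀
  obtain ⟨K₁, K₂, K₃, hK₁, hK₂, hK₃, hrace⟩ := raceSeries hρ hC₁ hC₂ hc hh hv₀
  obtain ⟨A₀, hA₀1, hA₀⟩ := exponent_race hρ K₁ K₂ K₃
  set A : ℝ := max A₀ (max R₀ (Real.sqrt (-t₀) + 1)) with hAdef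
  have hA1 : 1 ≤ A := hA₀1.trans (le_max_left _ _)
  have hA0 : 0 < A := by linarith
  have hAR₀ : R₀ ≤ A := (le_max_left _ _).trans (le_max_right _ _)
  have hAsq : -t₀ < A ^ 2 := by
    have h1 : Real.sqrt (-t₀) ^ 2 = -t₀ := Real.sq_sqrt (by linarith)
    have h2 : Real.sqrt (-t₀) + 1 ≤ A := (le_max_right _ _).trans (le_max_right _ _)
    have h3 : 0 ≤ Real.sqrt (-t₀) := Real.sqrt_nonneg _
    nlinarith
  set t₁ : ℝ := t₀ - A ^ 2 with ht₁def
  have ht₁ : t₁ < t₀ := by rw [ht₁def]; nlinarith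
  have hlen : t₀ - t₁ ≤ A ^ 2 := by rw [ht₁def]; linarith
  have ht₁low : -((2 * A) ^ 2) < t₁ := by rw [ht₁def]; nlinarith
  obtain ⟨B, hB⟩ := hslab t₁ ht₁
  obtain ⟨X, χ', hX, hTr⟩ := hflows t₀ ht₀ t₁ ht₁ ⟨B, hB⟩ χ R₀ hR₀ hdatum
  obtain ⟨R', hR'⟩ := hX.2.2.2.2.2.2
  obtain ⟨J₀, hJ₀⟩ := pow_unbounded_of_one_lt (R' / A) one_lt_two
  set J : ℕ := J₀ + 1 with hJdef
  have hJ1 : 1 ≤ J := by omega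
  have hJ : R' ≤ 2 ^ J * A := by
    have h1 : R' < 2 ^ J₀ * A := by rwa [div_lt_iff₀ hA0] at hJ₀
    have h2 : (2 : ℝ) ^ J₀ * A ≤ 2 ^ J * A :=
      mul_le_mul_of_nonneg_right (pow_le_pow_right₀ one_le_two (by omega)) hA0.le
    linarith
  have hRad_ge : ∀ j : ℕ, 2 * A ≤ shellRad A j := fun j => by
    unfold shellRad
    have : (2 : ℝ) ^ 1 ≤ 2 ^ (j + 1) := pow_le_pow_right₀ one_le_two (by omega)
    nlinarith
  have hsubj : ∀ j : ℕ, Set.Ioo t₁ t₀ ⊆ Set.Ioo (-(shellRad A j ^ 2)) 0 := by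
    intro j s hs
    refine ⟨?_, hs.2.trans ht₀⟩
    have h1 := hRad_ge j
    have h2 : (2 * A) ^ 2 ≤ shellRad A j ^ 2 := pow_le_pow_left₀ (by positivity) h1 2
    linarith [hs.1]
  set e : ℕ → ℝ := fun j => eFloor ρ C₁ (c : ℝ) h (shellVol ρ C₂ (c : ℝ) v₀ A j) (shellRad A j) j with hedef
  have he : ∀ j, 0 < e j := fun j =>
    eFloor_pos hC₁ hc hh (shellVol_pos hC₂ hc hv₀ hA0 j) (shellRad_pos hA0 j) j
  set F : ℝ → ℝ → ℝ := fun a s => ∫ x in Metric.ball (0 : E3) a, frobeniusNormSq (fderiv ℝ (u s) x) with hFdef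
  have hslice : ∀ s ∈ Set.Ioo t₁ t₀, ∃ j, j < J ∧ e j ≤ F (shellRad A j) s := by
    intro s hs
    have hsI : s ∈ Set.Icc t₁ t₀ := ⟨hs.1.le, hs.2.le⟩
    have hs0 : s ∈ Set.Iio (0 : ℝ) := hs.2.trans ht₀
    obtain ⟨⟨R's, hR's, hdat⟩, hlab, hsupp, hhel⟩ := hTr.2 s hsI
    have hvs : ContDiff ℝ 1 (u s) := (hcl.contDiff_velocity hs0).of_le (by norm_cast)
    have hχ'c : Continuous (χ' s) := hdat.1.continuous
    have hcurlc : Continuous (curl (u s)) := by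
      rw [curl_eq_curlCLM_comp]; exact curlCLM.continuous.comp (hvs.continuous_fderiv one_ne_zero)
    set g : E3 → ℝ := fun x => inner ℝ (u s x) (curl (u s) x) with hgdef
    have hgc : Continuous g := hvs.continuous.inner hcurlc
    have hint : Integrable (fun x => χ' s x * g x) := by
      refine (hχ'c.mul hgc).integrable_of_hasCompactSupport ?_
      refine HasCompactSupport.intro (isCompact_closedBall (0 : E3) R's) fun x hx => ?_
      rw [Metric.mem_closedBall, dist_zero_right, not_le] at hx
      simp [hdat.2.2.1 x hx.le]
    have hsuppR' : ∀ x : E3, χ' s x ≠ 0 → ‖x‖ < R' := by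
      intro x hx
      have := hR' s hsI (hsupp x hx)
      rwa [Metric.mem_ball, dist_zero_right] at this
    have hHs_eq : ∫ x, χ' s x * g x = tubeHelicity (u t₀) χ := hhel
    have hHs : ∫ x, χ' s x * g x ≠ 0 := by rw [hHs_eq]; exact hH₀
    obtain ⟨j, hjJ, hj⟩ := hostingShell hint hA0 hsuppR' hJ1 hJ hHs
    rw [hHs_eq, ← hhdef] at hj
    refine ⟨j, hjJ, ?_⟩
    set w : E3 → ℝ := (shellSet A j).indicator (χ' s) with hwdef
    have hwm : Measurable w := hχ'c.measurable.indicator (measurableSet_shellSet A j)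
    have hw1 : ∀ x : E3, |w x| ≤ 1 := by
      intro x
      rw [hwdef, Set.indicator_apply]
      split_ifs
      · exact hdat.2.1 x
      · simp
    have hwne : ∀ x : E3, w x ≠ 0 → x ∈ shellSet A j ∧ χ' s x ≠ 0 := by
      intro x hx
      rw [hwdef, Set.indicator_apply] at hx
      split_ifs at hx with hmem
      · exact ⟨hmem, hx⟩
      · exact absurd rfl hx
    have hsR : s ∈ Set.Ioo (-(shellRad A j ^ 2)) 0 := hsubj j hs
    have hηle : eta h j ≤ |∫ x in Metric.ball (0 : E3) (shellRad A j), w x * inner ℝ (u s x) (curl (u s) x)| := by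
      unfold eta shellRad; exact hj
    obtain ⟨E, hEL, hEm, hEvol, hwE⟩ : ∃ E : Set E3, E ⊆ L ∧ MeasurableSet E ∧
        (volume E).toReal ≤ shellVol ρ C₂ (c : ℝ) v₀ A j ∧ ∀ x : E3, w x ≠ 0 → x ∈ X s '' E := by
      rcases Nat.eq_zero_or_pos j with hj0 | hjpos
      · subst hj0
        refine ⟨L, subset_rfl, hLm, le_rfl, fun x hx => hsupp x (hwne x hx).2⟩
      · obtain ⟨i, rfl⟩ : ∃ i, j = i + 1 := ⟨j - 1, by omega⟩
        have hRi : (2 : ℝ) * R₀ ≤ 2 ^ (i + 1) * A := by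
          have : (2 : ℝ) ^ 1 ≤ 2 ^ (i + 1) := pow_le_pow_right₀ one_le_two (by omega)
          nlinarith
        have hAi : A ≤ 2 ^ (i + 1) * A := by
          have : (1 : ℝ) ≤ 2 ^ (i + 1) := one_le_pow₀ one_le_two
          nlinarith
        have hti : -(2 ^ (i + 1) * A) ^ 2 < t₁ := by
          have h1 : (2 * A) ^ 2 ≤ (2 ^ (i + 1) * A) ^ 2 := by
            have : (2 : ℝ) * A ≤ 2 ^ (i + 1) * A := by
              have : (2 : ℝ) ^ 1 ≤ 2 ^ (i + 1) := pow_le_pow_right₀ one_le_two (by omega)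
              nlinarith
            exact pow_le_pow_left₀ (by positivity) this 2
          linarith
        obtain ⟨hEm, hEvol⟩ := hfar ρ hρ u p H c hcls hcl t₁ t₀ L X ht₁ ht₀ hLm hX R₀ hR₀ hLball A hA1 hlen
          (2 ^ (i + 1) * A) hRi hAi hti s hsI
        refine ⟨{y : E3 | y ∈ L ∧ 2 ^ (i + 1) * A ≤ ‖X s y‖}, fun y hy => hy.1, hEm, ?_, ?_⟩
        · simpa only [shellVol] using hEvol
        · intro x hx
          obtain ⟨hxs, hxχ⟩ := hwne x hx
          obtain ⟨y, hyL, rfl⟩ := hsupp x hxχ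
          refine ⟨y, ⟨hyL, ?_⟩, rfl⟩
          rcases hxs.1 with h0 | hle
          · omega
          · exact hle
    obtain ⟨hTm, hTvol⟩ := hX.2.2.2.2.1 s hsI E hEL hEm
    have hTfin : volume (X s '' E) < ⊤ := by
      rw [hTvol]; exact (measure_mono hEL).trans_lt hLfin
    have hTV : (volume (X s '' E)).toReal ≤ shellVol ρ C₂ (c : ℝ) v₀ A j := by rw [hTvol]; exact hEvol
    have hwT : ∀ x : E3, x ∉ X s '' E → w x = 0 := by
      intro x hx; by_contra h; exact hx (hwE x h)
    have := hfloor ρ hρ u p H c hcls hcl (shellRad A j) (shellRad_pos hA0 j) s hsR w hwm hw1 (X s '' E) hTm hTfin hwT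
      (shellVol ρ C₂ (c : ℝ) v₀ A j) hTV (eta h j) (eta_pos hh j) hηle
    simpa only [hedef, eFloor, hFdef] using this
  have hmeasF : ∀ j : ℕ, AEMeasurable (fun s : ℝ => ENNReal.ofReal (F (shellRad A j) s)) (volume.restrict (Set.Ioo t₁ t₀)) :=
    fun j => ((windowBudget hcls hcl (shellRad_pos hA0 j)).1).mono_measure (Measure.restrict_mono (hsubj j) le_rfl)
  have hbudget : ∀ j : ℕ, ∫⁻ s in Set.Ioo t₁ t₀, ENNReal.ofReal (F (shellRad A j) s) ≤
      ENNReal.ofReal ((c : ℝ) * shellRad A j ^ (1 - ρ)) :=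
    fun j => (lintegral_mono_set (hsubj j)).trans (windowBudget hcls hcl (shellRad_pos hA0 j)).2
  have hpt : ∀ s ∈ Set.Ioo t₁ t₀,
      (1 : ℝ≥0∞) ≤ ∑ j ∈ Finset.range J, ENNReal.ofReal (F (shellRad A j) s) * (ENNReal.ofReal (e j))⁻¹ := by
    intro s hs
    obtain ⟨j, hjJ, hej⟩ := hslice s hs
    have h1 : (1 : ℝ≥0∞) ≤ ENNReal.ofReal (F (shellRad A j) s) * (ENNReal.ofReal (e j))⁻¹ := by
      rw [← div_eq_mul_inv, ENNReal.le_div_iff_mul_le (Or.inl ((ENNReal.ofReal_pos.2 (he j)).ne'))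
        (Or.inl ENNReal.ofReal_ne_top), one_mul]
      exact ENNReal.ofReal_le_ofReal hej
    exact h1.trans (Finset.single_le_sum (f := fun j => ENNReal.ofReal (F (shellRad A j) s) * (ENNReal.ofReal (e j))⁻¹)
      (fun _ _ => zero_le) (Finset.mem_range.2 hjJ))
  have hterm0 : ∀ j, 0 ≤ (c : ℝ) * shellRad A j ^ (1 - ρ) / e j := fun j =>
    div_nonneg (mul_nonneg c.coe_nonneg (Real.rpow_nonneg (shellRad_pos hA0 j).le _)) (he j).le
  have hmain : ENNReal.ofReal (A ^ 2) ≤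
      ENNReal.ofReal (K₁ * A ^ (1 - ρ) + K₂ * A ^ (2 - 2 * ρ) + K₃ * A ^ (2 - 5 * ρ)) := by
    calc ENNReal.ofReal (A ^ 2) = volume (Set.Ioo t₁ t₀) := by
          rw [Real.volume_Ioo, ht₁def]; congr 1; ring
      _ = ∫⁻ s in Set.Ioo t₁ t₀, (1 : ℝ≥0∞) := by rw [setLIntegral_const, one_mul]
      _ ≤ ∫⁻ s in Set.Ioo t₁ t₀, ∑ j ∈ Finset.range J, ENNReal.ofReal (F (shellRad A j) s) * (ENNReal.ofReal (e j))⁻¹ :=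
          lintegral_mono_ae ((ae_restrict_iff' measurableSet_Ioo).2 (ae_of_all _ hpt))
      _ = ∑ j ∈ Finset.range J, ∫⁻ s in Set.Ioo t₁ t₀, ENNReal.ofReal (F (shellRad A j) s) * (ENNReal.ofReal (e j))⁻¹ :=
          lintegral_finsetSum' _ fun j _ => (hmeasF j).mul_const _
      _ = ∑ j ∈ Finset.range J, (∫⁻ s in Set.Ioo t₁ t₀, ENNReal.ofReal (F (shellRad A j) s)) * (ENNReal.ofReal (e j))⁻¹ := by
          refine Finset.sum_congr rfl fun j _ => ?_
          rw [lintegral_mul_const'' _ (hmeasF j)]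
      _ ≤ ∑ j ∈ Finset.range J, ENNReal.ofReal ((c : ℝ) * shellRad A j ^ (1 - ρ)) * (ENNReal.ofReal (e j))⁻¹ :=
          Finset.sum_le_sum fun j _ => mul_le_mul_of_nonneg_right (hbudget j) zero_le
      _ = ∑ j ∈ Finset.range J, ENNReal.ofReal ((c : ℝ) * shellRad A j ^ (1 - ρ) / e j) := by
          refine Finset.sum_congr rfl fun j _ => ?_
          rw [ENNReal.ofReal_div_of_pos (he j), div_eq_mul_inv]
      _ = ENNReal.ofReal (∑ j ∈ Finset.range J, (c : ℝ) * shellRad A j ^ (1 - ρ) / e j) :=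
          (ENNReal.ofReal_sum_of_nonneg fun j _ => hterm0 j).symm
      _ ≤ _ := ENNReal.ofReal_le_ofReal (hrace A hA1 J)
  have hfin := hA₀ A (le_max_left _ _)
  have hpos : 0 ≤ K₁ * A ^ (1 - ρ) + K₂ * A ^ (2 - 2 * ρ) + K₃ * A ^ (2 - 5 * ρ) := by
    have := Real.rpow_pos_of_pos hA0 (1 - ρ); have := Real.rpow_pos_of_pos hA0 (2 - 2 * ρ)
    have := Real.rpow_pos_of_pos hA0 (2 - 5 * ρ); positivity
  have := (ENNReal.ofReal_le_ofReal_iff hpos).1 hmain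
  linarith

end K4

end K4Proof

/-- K4 (M/L, the heart — THE RACE): given the shell floor K2 and the far-volume bound K3, a member of Seregin's class (ANY `ρ > 0`) in the chiral-tube
stratum with anchor flows is absurd (window `(t₀−A², t₀)`, dyadic shells, shell-helicity pigeonhole, floor vs `E`-gauge budget, exponent race — the full
recipe is in the card `Lines/chiral_anchor.md` and in the proof `K4.anchorRace` below). -/
def Sig.stub_anchorRace : Prop :=
  ShellHelicityFloor → FarVolumeBound →
    ∀ ρ : ℝ, 0 < ρ → ∀ (u : ℝ → E3 → E3) (p : ℝ → E3 → ℝ) (H : ℝ → E3 → E3 →L[ℝ] E3) (c : ℝ≥0),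
      InClass ρ u p H c → IsChiralTubePast u p → HasAnchorFlows u → False

theorem stub_anchorRace : Sig.stub_anchorRace := fun hK2 hK3 => K4.anchorRace hK2 hK3

/-- ★ THE STRATUM KILL, sorry-free (REV5 = K1 tree theorem + K2, K3, K4 proved in this line): NO member of Seregin's class (ANY `ρ > 0`) is a
chiral-tube past — no drift envelope, no symmetry, no compact vorticity support, no `D`-gauge, no `ρ ≤ ½`. -/
theorem not_isChiralTubePast_of_inClass {ρ : ℝ} (hρ : 0 < ρ) {u : ℝ → E3 → E3} {p : ℝ → E3 → ℝ} {H : ℝ → E3 → E3 →L[ℝ] E3} {c : ℝ≥0}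
    (hcls : InClass ρ u p H c) : ¬ IsChiralTubePast u p :=
  fun hc => stub_anchorRace stub_shellFloor stub_farVolume ρ hρ u p H c hcls hc (stub_anchorFlow u p hc.1)

/-- K6 (OPEN COMPLEMENT — the honest face): the target's hypotheses VERBATIM plus «NOT in the chiral-tube stratum» ⇒ trivial.  Exactly the LEAD's
open stub minus the new stratum; not claimed easier than the crux. -/
def Sig.stub_anchorFace : Prop :=
  ∀ ρ : ℝ, 0 < ρ → ρ ≤ 1 / 2 →
    ∀ (u : ℝ → E3 → E3) (p : ℝ → E3 → ℝ) (H : ℝ → E3 → E3 →L[ℝ] E3) (c : ℝ≥0), InClass ρ u p H c →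
      ¬ QuiescentPast u → ¬ IsPastSteady ρ u → ¬ IsWeakTamePast u H → ¬ PastFrozenDirection H → ¬ IsSelfSimilarVelocity u →
      ¬ IsCollapseClockC2 u → ¬ IsPastSelfSimilarClassical ρ u → ¬ IsPastSelfSimilarSubExtremal ρ u → ¬ IsShapeFastClock ρ u →
      ¬ IsSwirlFreeDrifting u p → ¬ IsSwirlFreeSlowDrifting ρ u p → ¬ IsMirrorOutgoing ρ u p → ¬ IsAxisymSlowDrifting ρ u p →
      ¬ IsTameBreather ρ u p → ¬ IsDiscreteBreather ρ u → ¬ IsDiscreteClock ρ u → ¬ IsOffRateSelfSimilar ρ u →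
      ¬ IsBernoulliClockedCore u p → ¬ IsHelicalTubePast ρ u p → ¬ IsStretchingBudgeted ρ u p → ¬ IsAnchoredBudgeted ρ u p →
      ¬ IsConfinedVortex ρ u p → ¬ IsFadingTamePast u p → ¬ IsTameClassicalShapePreserving ρ u p → ¬ HasOneSidedPressurePast ρ u p →
      ¬ IsExtinctConservative ρ u p → ¬ (ρ = 1 / 2 ∧ IsDSSPowerSpread ρ u) → ¬ IsDSSCompactVorticity ρ u p → ¬ IsDSSClassicalTame ρ u p →
      ¬ IsDSSClassicalEnergy ρ u p → ¬ IsClassicalVorticityTame u p → ¬ IsSymmetricWeak u H → ¬ IsWeakFluxTame u p H →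
      ¬ IsClassicalConcentrating ρ u p →
      ¬ IsChiralTubePast u p → VanishesAE u

theorem stub_anchorFace : Sig.stub_anchorFace := by
  sorry

/-! ## The kernel-checked composition: the five stubs prove the LEAD's open stub BY NAME (REV5: K1–K4 are theorems, so `nonSelfSimilarRest_of_face : K6 → target`) -/

/-- `chiral_anchor` composition: K1–K4 empty the chiral-tube stratum, K6 is the open complement. -/
theorem nonSelfSimilarRest_of (h1 : Sig.stub_anchorFlow) (h2 : Sig.stub_shellFloor) (h3 : Sig.stub_farVolume)
    (h4 : Sig.stub_anchorRace) (h6 : Sig.stub_anchorFace) : Sig.stub_nonSelfSimilarRest := by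
  intro ρ hρ hρ2 u p H c hcls n1 n2 n3 n4 n5 n6 n7 n8 _nsp _ntw n9 n10 n11 n12 _nS _nS' n13 _n13' n14 n15 n16 n17 n18 n19 _nχ n20 n21 n22 n23 n24
    n25 n26 n27 n28 n29 _n29' n30 n31 n32 n33 n34
  by_cases hc : IsChiralTubePast u p
  · exact (h4 h2 h3 ρ hρ u p H c hcls hc (h1 u p hc.1)).elim
  · exact h6 ρ hρ hρ2 u p H c hcls n1 n2 n3 n4 n5 n6 n7 n8 n9 n10 n11 n12 n13 n14 n15 n16 n17 n18 n19 n20 n21 n22 n23 n24 n25 n26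
      n27 n28 n29 n30 n31 n32 n33 n34 hc

/-- REV5: with K1–K4 theorems, the LEAD's open stub follows from the open complement K6 ALONE. -/
theorem nonSelfSimilarRest_of_face (h6 : Sig.stub_anchorFace) : Sig.stub_nonSelfSimilarRest :=
  nonSelfSimilarRest_of stub_anchorFlow stub_shellFloor stub_farVolume stub_anchorRace h6

/-- REV7 (v114 ABSORPTION, documentation): since v114 the target itself carries `¬ IsChiralTubePast u p` (binder 20 of 35), so K6 gives the target by a
mere re-ordering of binders — K1–K4 are no longer needed for the composition (they live on in the skeleton's filled stub `stub_chiralTubePast`). -/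
theorem nonSelfSimilarRest_of_face' (h6 : Sig.stub_anchorFace) : Sig.stub_nonSelfSimilarRest :=
  fun ρ hρ hρ2 u p H c hcls n1 n2 n3 n4 n5 n6 n7 n8 _nsp _ntw n9 n10 n11 n12 _nS _nS' n13 _n13' n14 n15 n16 n17 n18 n19 nχ n20 n21 n22 n23 n24 n25 n26
      n27 n28 n29 _n29' n30 n31 n32 n33 n34 =>
    h6 ρ hρ hρ2 u p H c hcls n1 n2 n3 n4 n5 n6 n7 n8 n9 n10 n11 n12 n13 n14 n15 n16 n17 n18 n19 n20 n21 n22 n23 n24 n25 n26 n27 n28 n29 n30 n31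
      n32 n33 n34 nχ

/-! ## The new stratum CONTAINS the LEAD's face `IsHelicalTubePast` (every `ρ`, EVERY `κ < 1`) — proved -/

/-- A drifting classical far past carrying a tube datum of non-zero helicity at `τ < T₁` is a chiral-tube past with anchor time `τ`: the envelope
`‖u(r,x)‖ ≤ M(−r)^{−κ}` (`r < T₁`) bounds the velocity on every slab `[t₁,τ]` by `M · max((−t₁)^{−κ}, (−τ)^{−κ})`.  No threshold on `κ` is used. -/
theorem isChiralTubePast_of_isHelicalTubePast {ρ : ℝ} {u : ℝ → E3 → E3} {p : ℝ → E3 → ℝ} (h : IsHelicalTubePast ρ u p) :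
    IsChiralTubePast u p := by
  obtain ⟨T₁, M, κ, ⟨hcl, hT₁, hM, -, henv⟩, -, τ, hτ, χ, R, hR, hχ, hne⟩ := h
  refine ⟨hcl, τ, by linarith, fun t₁ ht₁ => ?_, χ, R, hR, hχ, hne⟩
  refine ⟨M * max ((-t₁) ^ (-κ)) ((-τ) ^ (-κ)), fun r hr x => (henv r (lt_of_le_of_lt hr.2 hτ) x).trans ?_⟩
  refine mul_le_mul_of_nonneg_left ?_ hM
  rcases le_or_gt 0 κ with hκ | hκ
  · refine le_trans ?_ (le_max_right _ _)
    exact Real.rpow_le_rpow_of_nonpos (by linarith) (by linarith [hr.2]) (by linarith)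
  · refine le_trans ?_ (le_max_left _ _)
    exact Real.rpow_le_rpow (by linarith [hr.2]) (by linarith [hr.1]) (by linarith)

/-- Hence, under `¬ IsChiralTubePast u p`, the binder `¬ IsHelicalTubePast ρ u p` of the target is automatic (the face is absorbed). -/
theorem not_isHelicalTubePast_of_not_isChiralTubePast {ρ : ℝ} {u : ℝ → E3 → E3} {p : ℝ → E3 → ℝ} (h : ¬ IsChiralTubePast u p) :
    ¬ IsHelicalTubePast ρ u p :=
  fun hh => h (isChiralTubePast_of_isHelicalTubePast hh)

/-- ★ In particular the LEAD's face `IsHelicalTubePast ρ` is EMPTY in the class for EVERY `ρ > 0` and EVERY drift exponent `κ < 1` — sorry-free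
(its recorded residue «κ ≤ (1−3ρ)/(2−3ρ)» is gone). -/
theorem not_isHelicalTubePast_of_inClass {ρ : ℝ} (hρ : 0 < ρ) {u : ℝ → E3 → E3} {p : ℝ → E3 → ℝ} {H : ℝ → E3 → E3 →L[ℝ] E3} {c : ℝ≥0}
    (hcls : InClass ρ u p H c) : ¬ IsHelicalTubePast ρ u p :=
  fun hh => not_isChiralTubePast_of_inClass hρ hcls (isChiralTubePast_of_isHelicalTubePast hh)

/-! ## COROLLARY (REV6, sorry-free): compactly supported vorticity of non-zero TOTAL helicity is impossible in the class -/
section Cor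
open Literature.Analysis.FluidPDE

/-- A classical Euler past with slab-bounded velocity before `t₀ < 0` whose slice `u t₀` has vorticity supported in `B(0,R₁)` and non-zero total
helicity IS a chiral-tube past: the tube datum is the smooth bump `φ` (`rIn = R₁`, `rOut = R₁ + 1`), constant along vortex lines since `Dφ = 0` on
`B(0,R₁)` and `curl u(t₀) = 0` off it, and `∫ φ ⟪u, curl u⟫ = ∫ ⟪u, curl u⟫`. -/
theorem isChiralTubePast_of_compactVorticity {u : ℝ → E3 → E3} {p : ℝ → E3 → ℝ}
    (hcl : IsClassicalEulerSolutionOn (Set.Iio 0) 0 u p) {t₀ : ℝ} (ht₀ : t₀ < 0)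
    (hslab : ∀ t₁ : ℝ, t₁ < t₀ → ∃ B : ℝ, ∀ r ∈ Set.Icc t₁ t₀, ∀ x : E3, ‖u r x‖ ≤ B)
    {R₁ : ℝ} (hR₁ : 0 < R₁) (hsupp : ∀ x : E3, R₁ ≤ ‖x‖ → curl (u t₀) x = 0)
    (hhel : ∫ x, inner ℝ (u t₀ x) (curl (u t₀) x) ≠ 0) : IsChiralTubePast u p := by
  let φ : ContDiffBump (0 : E3) := ⟨R₁, R₁ + 1, hR₁, by linarith⟩
  have hφ1 : ∀ x : E3, ‖x‖ ≤ R₁ → φ x = 1 := fun x hx =>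
    φ.one_of_mem_closedBall (by rw [mem_closedBall, dist_zero_right]; exact hx)
  have hint_eq : ∀ x : E3, (φ : E3 → ℝ) x * inner ℝ (u t₀ x) (curl (u t₀) x) = inner ℝ (u t₀ x) (curl (u t₀) x) := by
    intro x
    by_cases hx : ‖x‖ ≤ R₁
    · rw [hφ1 x hx, one_mul]
    · rw [hsupp x (le_of_lt (not_le.1 hx)), inner_zero_right, mul_zero]
  refine ⟨hcl, t₀, ht₀, hslab, (φ : E3 → ℝ), R₁ + 1, by linarith, ⟨φ.contDiff, ?_, ?_, ?_⟩, ?_⟩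
  · intro x
    rw [abs_le]
    exact ⟨by linarith [φ.nonneg (x := x)], φ.le_one⟩
  · intro x hx
    exact φ.zero_of_le_dist (by rw [dist_zero_right]; exact hx)
  · intro x
    by_cases hx : ‖x‖ < R₁
    · have h1 : (φ : E3 → ℝ) =ᶠ[nhds x] (fun _ => (1 : ℝ)) :=
        φ.eventuallyEq_one_of_mem_ball (by rw [mem_ball, dist_zero_right]; exact hx)
      rw [Filter.EventuallyEq.fderiv_eq h1, fderiv_const_apply]
      simp
    · rw [hsupp x (not_lt.1 hx), map_zero]
  · show (∫ x, (φ : E3 → ℝ) x * inner ℝ (u t₀ x) (curl (u t₀) x)) ≠ 0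
    rw [integral_congr_ae (ae_of_all _ hint_eq)]
    exact hhel

/-- ★ COROLLARY (sorry-free): in Seregin's class (ANY `ρ > 0`) no classical Euler past with velocity bounded on the slabs `[t₁,t₀] × ℝ³` has, at time
`t₀ < 0`, a compactly supported vorticity of non-zero total helicity. -/
theorem no_helical_compactVorticity_slice {ρ : ℝ} (hρ : 0 < ρ) {u : ℝ → E3 → E3} {p : ℝ → E3 → ℝ} {H : ℝ → E3 → E3 →L[ℝ] E3} {c : ℝ≥0}
    (hcls : InClass ρ u p H c) (hcl : IsClassicalEulerSolutionOn (Set.Iio 0) 0 u p) {t₀ : ℝ} (ht₀ : t₀ < 0)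
    (hslab : ∀ t₁ : ℝ, t₁ < t₀ → ∃ B : ℝ, ∀ r ∈ Set.Icc t₁ t₀, ∀ x : E3, ‖u r x‖ ≤ B)
    {R₁ : ℝ} (hR₁ : 0 < R₁) (hsupp : ∀ x : E3, R₁ ≤ ‖x‖ → curl (u t₀) x = 0)
    (hhel : ∫ x, inner ℝ (u t₀ x) (curl (u t₀) x) ≠ 0) : False :=
  not_isChiralTubePast_of_inClass hρ hcls (isChiralTubePast_of_compactVorticity hcl ht₀ hslab hR₁ hsupp hhel)

end Cor

end Summit.NavierStokesRegularity.NavierStokesRegularity.Cruxes.PowerGaugeEulerLiouville.ChiralAnchor
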